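import Summits.QuantumFields.YangMills.Theses.EquipartitionCriticality
import Summits.QuantumFields.YangMills.Theorems.EquipartitionCriticalityEquipartitionPinsProbeEquipartition
import Summits.QuantumFields.YangMills.Theorems.EquipartitionCriticalityEquipartitionPinsProbeGaussianProfile
import Summits.QuantumFields.YangMills.Theorems.EquipartitionCriticalityEquipartitionPinsProbePoissonIntegral
import Summits.QuantumFields.YangMills.Theorems.EquipartitionCriticalityEquipartitionPinsProbeAxisFourier
import Summits.QuantumFields.YangMills.Theorems.EquipartitionCriticalityEquipartitionPinsProbeProfile
import Summits.QuantumFields.YangMills.Theorems.EquipartitionCriticalityEquipartitionPinsProbeSecondDifference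
import Literature.MathematicalPhysics.QuantumFieldTheory.CurvatureGaussianField
import Summits.QuantumFields.YangMills.Theorems.EquipartitionCriticalityEquipartitionPinsProbeCosMoment
import Summits.QuantumFields.YangMills.Theorems.EquipartitionCriticalityEquipartitionPinsProbeCubeShiftInvariance
import Summits.QuantumFields.YangMills.Theorems.EquipartitionCriticalityEquipartitionPinsProbeDensity
import Summits.QuantumFields.YangMills.Theorems.EquipartitionCriticalityEquipartitionPinsProbeExactShiftInvariance
import Summits.QuantumFields.YangMills.Theorems.EquipartitionCriticalityEquipartitionPinsProbeFactorization
import Summits.QuantumFields.YangMills.Theorems.EquipartitionCriticalityEquipartitionPinsProbeGaussFromCharFun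
import Summits.QuantumFields.YangMills.Theorems.EquipartitionCriticalityEquipartitionPinsProbeHodge
import Summits.QuantumFields.YangMills.Theorems.EquipartitionCriticalityEquipartitionPinsProbeKernelClosed
import Summits.QuantumFields.YangMills.Theorems.EquipartitionCriticalityEquipartitionPinsProbeKernelDecay
import Summits.QuantumFields.YangMills.Theorems.EquipartitionCriticalityEquipartitionPinsProbeKernelExact
import Summits.QuantumFields.YangMills.Theorems.EquipartitionCriticalityEquipartitionPinsProbeKernelFixesExact
import Summits.QuantumFields.YangMills.Theorems.EquipartitionCriticalityEquipartitionPinsProbeLiePos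
import Summits.QuantumFields.YangMills.Theorems.EquipartitionCriticalityEquipartitionPinsProbeLineVariance
import Summits.QuantumFields.YangMills.Theorems.EquipartitionCriticalityEquipartitionPinsProbeLiouville
import Summits.QuantumFields.YangMills.Theorems.EquipartitionCriticalityEquipartitionPinsProbeRigidity
import Summits.QuantumFields.YangMills.Theorems.EquipartitionCriticalityEquipartitionPinsProbeSteinFlow
import Mathlib.MeasureTheory.Measure.Prokhorov
import Summits.QuantumFields.YangMills.Theorems.EquipartitionCriticalityEquipartitionPinsProbeTangentClosedLimit
import Summits.QuantumFields.YangMills.Theorems.EquipartitionCriticalityEquipartitionPinsProbeTangentComb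
import Summits.QuantumFields.YangMills.Theorems.EquipartitionCriticalityEquipartitionPinsProbeTangentCurlClosed
import Summits.QuantumFields.YangMills.Theorems.EquipartitionCriticalityEquipartitionPinsProbeTangentExtraction
import Summits.QuantumFields.YangMills.Theorems.EquipartitionCriticalityEquipartitionPinsProbeTangentHaarShiftLimit
import Summits.QuantumFields.YangMills.Theorems.EquipartitionCriticalityEquipartitionPinsProbeTangentHaarShiftSkew
import Summits.QuantumFields.YangMills.Theorems.EquipartitionCriticalityEquipartitionPinsProbeTangentLieFrame
import Summits.QuantumFields.YangMills.Theorems.EquipartitionCriticalityEquipartitionPinsProbeTangentPlaquetteEnergy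
import Summits.QuantumFields.YangMills.Theorems.EquipartitionCriticalityEquipartitionPinsProbeTangentTruncatedFatou
import Summits.QuantumFields.YangMills.Theorems.EquipartitionCriticalityEquipartitionPinsProbeTangentCombPoincare
import Summits.QuantumFields.YangMills.Theorems.EquipartitionCriticalityEquipartitionPinsProbeTangentEnergyAlgebra
import Summits.QuantumFields.YangMills.Theorems.EquipartitionCriticalityEquipartitionPinsProbeTangentEnergyLaw
import Summits.QuantumFields.YangMills.Theorems.EquipartitionCriticalityEquipartitionPinsProbeTangentFieldMoments
import Summits.QuantumFields.YangMills.Theorems.EquipartitionCriticalityEquipartitionPinsProbeTangentPlaqFieldContinuous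
import Summits.QuantumFields.YangMills.Theorems.EquipartitionCriticalityEquipartitionPinsProbeTangentSecondMoments
import Summits.QuantumFields.YangMills.Theorems.EquipartitionCriticalityEquipartitionPinsProbeTangentTangentDefect
import Summits.QuantumFields.YangMills.Theorems.EquipartitionCriticalityEquipartitionPinsProbeTangentDefs
import Summits.QuantumFields.YangMills.Theorems.EquipartitionCriticalityEquipartitionPinsProbeTangentDiffIdentity
import Summits.QuantumFields.YangMills.Theorems.EquipartitionCriticalityEquipartitionPinsProbeTangentUiLimit
import Summits.QuantumFields.YangMills.Theorems.EquipartitionCriticalityEquipartitionPinsProbeTangentSteinSingleEdgeLimit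
import Summits.QuantumFields.YangMills.Theorems.EquipartitionCriticalityEquipartitionPinsProbeTangentSteinReduction
import Summits.QuantumFields.YangMills.Theorems.EquipartitionCriticalityEquipartitionPinsProbeTangentCombShift
import Summits.QuantumFields.YangMills.Theorems.EquipartitionCriticalityEquipartitionPinsProbeTangentShiftDerivField
import Summits.QuantumFields.YangMills.Theorems.EquipartitionCriticalityEquipartitionPinsProbeTangentShiftDerivAction
import Summits.QuantumFields.YangMills.Theorems.EquipartitionCriticalityEquipartitionPinsProbeTangentSteinFiniteBeta

/-!
# Line `Sketch` — LEAD's working skeleton for crux `stmt-QuantumFields-8760`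
(`Summit.QuantumFields.YangMills.Theses.EquipartitionCriticality.EquipartitionPinsProbe`)

The crux: IF the torus free energy per site of 4-D Wilson lattice gauge theory with compact simple
`G` in the faithful unitary representation `r` satisfies `f_r(β) + (3D/2) log β → K` THEN the
time-covariances of the bounded probe `φ(β(N − Re tr r(U_p)))` converge, uniformly over torus-limit
states, to a positive, sub-exponentially decaying profile `g`.

**Composition (`EquipartitionPinsProbe_of`, proved below modulo the `stub_*`).**
Probe `φ(x) = exp(−2 x₊)`; profile `g_D(n) = 2^{−D} ((1 − c_n²)^{−D/2} − 1)` with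
`c_n = curvaturePlaquetteCorr n` the lattice-Maxwell plaquette two-point numbers along `e₀`.

LANDED (lead cycle 1, gen 0): `stub_equipartition` (p102412), `stub_gaussianProfile` (p107617),
`stub_secondDifference` (p107700), `stub_poissonIntegral` (p103989), `stub_axisFourier` (p105895),
`stub_profile` (p106718); the reduction `crux ⇐ local law` (p108170,
`equipartitionPinsProbe_of_localLaw`, whose glue is repeated in §3–§4 to keep this file independent of it); the one-link Haar shift (p108068).

RESHAPE (lead c1, cycle 1, 2026-08-16): the one remaining physics statement, the LOCAL FREE-GLUON LAW
(`localLaw`, formerly the stub `stub_localLaw`), is now PROVED here from two stubs by a soft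
compactness-and-contradiction argument (`localLaw_of_tangent_of_rigidity`):

* STUB T `stub_tangent` (gauge theory; compactness half; why-fail (i) of the item): uniform
  equipartition ⇒ there is `D ≥ 1` such that every sequence of torus-limit states `μ_k` at
  `β_k → ∞` has a subsequence along which the joint laws of the rescaled plaquette energies
  `β_k (N − Re tr r(U_p))` converge (bounded continuous test functions of finitely many plaquettes) to
  the laws of `½|Y_p|²` under SOME probability measure `τ` on `ℝ^D`-valued 2-cochains `Y` of `ℤ⁴`
  which is (T1) a.s. closed (`dY = 0` on every 3-cell), (T2) square integrable with uniformly bounded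
  second moments and the equipartition budget `∑_{i<j} ∑_a E (Y^a_{(0;i,j)})² ≤ 3D`, and (T3) obeys
  the linearised one-link Schwinger–Dyson identity = the Stein identity of the lattice Maxwell field
  in trigonometric form: `E[cos⟨Y,h⟩ ⟨Y,dα⟩] = −⟨dα,h⟩ E[sin⟨Y,h⟩]`,
  `E[sin⟨Y,h⟩ ⟨Y,dα⟩] = ⟨dα,h⟩ E[cos⟨Y,h⟩]` for finitely supported `h`, `α`.
* STUB R `stub_rigidity` (pure probability; identification half; why-fail (ii) of the item): every
  probability measure `τ` with (T1)–(T3) IS `curvatureGaussianField 4 D`. Proof route (held by the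
  lead): Stein ODE along exact directions `h ↦ h + t dα` (needs STUB K1 `d*T = d*` for the Gaussian
  factor), closedness along co-exact directions (STUB K2 `dT = 0`), Hahn–Banach in `ℓ¹` + STUB H
  (Hodge identity on 2-forms) + STUB L (Liouville on `ℤ⁴`) ⇒ `Φ_τ = Φ_Gauss · ψ∘π` with `π` the
  projection onto constant 2-forms; STUB K3 (kernel decay) ⇒ line averages have vanishing Gaussian
  variance ⇒ `ψ`'s second moments are ≥ 0 and the budget (T2) forces them to vanish ⇒ `ψ ≡ 1`.
  `stub_rigidity` takes the statements of K1, K2, K3, H, L as hypotheses (as `stub_axisFourier`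
  took `stub_poissonIntegral`'s), so that the five lattice-calculus stubs are proved independently.

RESHAPE (lead c2, cycle 1, 2026-08-16): STUB T_main (`stub_tangentCore`) is now PROVED here from the
stubs of §T (`stub_tangentCore` = extraction + (T0)–(T3) glue): the tangent law is the weak limit of the
laws of the EXACTLY CLOSED rescaled plaquette field `Y^β = dA^β`, `A^β_e = √β ⟨ρ(Ũ_e) − 1, e_a⟩_a` in the
complete axial (comb) gauge of `ℤ⁴` (definitions file
`Theorems/EquipartitionCriticalityEquipartitionPinsProbeTangentDefs.lean`, p121528). No matrix logarithm and
no Bianchi estimate are needed; the Stein identity is the `β → ∞` limit of the differentiated skew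
Haar-shift identity (STUBS TS0–TS2, T3').
-/

noncomputable section

open MeasureTheory Filter Topology
open scoped BigOperators Matrix

namespace Summit.QuantumFields.YangMills.Cruxes.EquipartitionPinsProbe.Sketch

/-! ## §1 The registered stubs (signatures verbatim, `let`-free, fully qualified)

NOTE (transient): STUBS K1, K2, K3, H, L are LANDED (p110317, p109912, p110629, p110812, p111448) and so
are STUBS R1, R2, R3, R4, R6 (p112456, p116527, p116724, p113292, p112870);
their `sorry`s below are replaced by `exact Summit.QuantumFields.YangMills.Theorems.EquipartitionPinsProbe.stub_…`
(with the five `…Theorems.EquipartitionCriticalityEquipartitionPinsProbe{KernelExact,KernelClosed,KernelDecay,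
Hodge,Liouville}` imports) as soon as the farm snapshot has built those modules — see
`work/EquipartitionPinsProbe.v4-imports.lean` in the lead's folder. -/

/-- STUB 1 (LANDED p102412) — **equipartition of the plaquette energy, uniformly over torus-limit
states**. -/
theorem stub_equipartition :
    ∀ (G : Type) [Group G] [TopologicalSpace G] [IsTopologicalGroup G] [CompactSpace G],
      Literature.MathematicalPhysics.QuantumFieldTheory.IsCompactSimpleLieGroup G →
      letI : MeasurableSpace G := borel G
      haveI : BorelSpace G := ⟨rfl⟩
      ∀ r : Literature.MathematicalPhysics.QuantumFieldTheory.LatticeRep G,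
        (∃ K : ℝ, Filter.Tendsto (fun β : ℝ =>
          Literature.MathematicalPhysics.QuantumLattice.freeEnergyDensity 4 r.ρ β +
            (3 * (Module.finrank ℝ ↥(Submodule.span ℝ {X : Matrix (Fin r.N) (Fin r.N) ℂ |
              ∀ t : ℝ, NormedSpace.exp ((t : ℂ) • X) ∈ Set.range r.ρ}) : ℝ) / 2) * Real.log β)
          Filter.atTop (nhds K)) →
        ∀ ε : ℝ, 0 < ε → ∀ᶠ β : ℝ in Filter.atTop,
          ∀ μ ∈ Literature.MathematicalPhysics.QuantumLattice.infiniteVolumeLimitPoints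
              (d := 4) r.ρ β,
            |β * (∫ U, (∑ i : Fin 4, ∑ j : Fin 4,
                if i < j then ((r.N : ℝ) -
                  Literature.MathematicalPhysics.QuantumLattice.plaquetteObs r.ρ 0 i j U) else 0) ∂μ) -
              3 * (Module.finrank ℝ ↥(Submodule.span ℝ {X : Matrix (Fin r.N) (Fin r.N) ℂ |
                ∀ t : ℝ, NormedSpace.exp ((t : ℂ) • X) ∈ Set.range r.ρ}) : ℝ) / 2| < ε :=
  Summit.QuantumFields.YangMills.Theorems.EquipartitionPinsProbe.stub_equipartition

/-! STUB T (docstring of the former stub; now a theorem below) — **tangent laws of the rescaled plaquette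
field exist and are closed, budgeted, Stein** (the compactness half of the local free-gluon law; THE gauge-theory stub). Uniform equipartition ⇒
`∃ D ≥ 1` (intended: `D = dim G`) such that for all sequences `β_k → ∞`, `μ_k ∈
infiniteVolumeLimitPoints r.ρ β_k`, there are a subsequence `φ` and a probability measure `τ` on
`ZdPlaquette 4 → Fin D → ℝ` with: (T0) for every `m`, plaquettes `p : Fin m → ZdPlaquette 4` and
bounded continuous `f : (Fin m → ℝ) → ℝ`,
`∫ f((β_{φ j}(N − Re tr r(U_{p i})))ᵢ) dμ_{φ j} → ∫ f((½ ∑_a (Y_{p i}^a)²)ᵢ) dτ`; (T1) `τ`-a.s.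
`(dY)(x; i<j<k) = ∂ᵢY_{jk} − ∂ⱼY_{ik} + ∂ₖY_{ij} = 0`; (T2) `E_τ (Y_p^a)² ≤ B` for all `p, a` and
`∑_{i<j} ∑_a E_τ (Y^a_{(0;i,j)})² ≤ 3D`; (T3) for all finitely supported `h` (2-form) and `α`
(1-form), `E[cos⟨Y,h⟩ ⟨Y,dα⟩] = −⟨dα,h⟩ E[sin⟨Y,h⟩]` and `E[sin⟨Y,h⟩ ⟨Y,dα⟩] = ⟨dα,h⟩ E[cos⟨Y,h⟩]`
(`dα = plaquetteCurl α`). Intended proof: exponential chart of `r(G) ⊆ U(N)`, comb gauge, tightness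
of `√β log U_p` from equipartition (`1 − cos θ ≥ 2θ²/π²`), Prokhorov, Bianchi identity, Fatou for the
budget, and the `β → ∞` limit of the one-link Haar-shift (Schwinger–Dyson) identity (p108068). -/
/-- STUB T_a — **the Lie algebra of `r(G)` is non-zero**: for a compact simple (connected,
non-abelian) `G` and a faithful continuous unitary representation `r`,
`0 < dim_ℝ span{X | exp(tX) ∈ r(G) ∀ t}` (von Neumann's exponential chart
`Literature.Analysis.Calculus.exists_exp_chart_range`: if the span were `0`, a neighbourhood of `1`
in `G` would be `{1}`, so `{1}` is clopen, `G = {1}` by connectedness, contradicting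
non-commutativity). -/
theorem stub_liePos :
    ∀ (G : Type) [Group G] [TopologicalSpace G] [IsTopologicalGroup G] [CompactSpace G],
      Literature.MathematicalPhysics.QuantumFieldTheory.IsCompactSimpleLieGroup G →
      ∀ r : Literature.MathematicalPhysics.QuantumFieldTheory.LatticeRep G,
        0 < Module.finrank ℝ ↥(Submodule.span ℝ {X : Matrix (Fin r.N) (Fin r.N) ℂ |
          ∀ t : ℝ, NormedSpace.exp ((t : ℂ) • X) ∈ Set.range r.ρ}) :=
  Summit.QuantumFields.YangMills.Theorems.EquipartitionPinsProbe.stub_liePos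

/-! ## §T The reshaped STUB T_main (lead c2): `Y^β = dA^β` in the comb gauge

Objects (tree, `…Theorems.EquipartitionCriticalityEquipartitionPinsProbeTangentDefs`, namespace
`Summit.QuantumFields.YangMills.Theorems.EquipartitionPinsProbe`): `combTransport`, `axialFix`, `shadow`, `lieDim`, `lieVec`, `lieCoord`, `linkField`, `plaqField`. -/

/-- STUB TC1 — **comb basics** (Prop. 9.2 on `ℤ⁴`, triviality of the gauge-fixed configuration on
comb edges, conjugation of plaquette holonomies, locality). LANDED by the lead (CombBasics). -/
theorem stub_combBasics :
    ∀ (G : Type) [Group G] (U : Literature.MathematicalPhysics.QuantumLattice.LGConfig 4 G),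
      (∀ (x : Literature.Probability.LatticeModels.Site 4) (i : Fin 4), (∀ j : Fin 4, i < j → x j = 0) →
        Summit.QuantumFields.YangMills.Theorems.EquipartitionPinsProbe.combTransport U (x + Pi.single i 1) = Summit.QuantumFields.YangMills.Theorems.EquipartitionPinsProbe.combTransport U x * U (x, i)) ∧
      (∀ (y : Literature.Probability.LatticeModels.Site 4) (j : Fin 4), (∀ j' : Fin 4, j < j' → y j' = 0) → Summit.QuantumFields.YangMills.Theorems.EquipartitionPinsProbe.axialFix U (y, j) = 1) ∧
      (∀ (x : Literature.Probability.LatticeModels.Site 4) (i j : Fin 4), Literature.MathematicalPhysics.QuantumLattice.plaquetteHolonomyZd (Summit.QuantumFields.YangMills.Theorems.EquipartitionPinsProbe.axialFix U) x i j =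
        Summit.QuantumFields.YangMills.Theorems.EquipartitionPinsProbe.combTransport U x * Literature.MathematicalPhysics.QuantumLattice.plaquetteHolonomyZd U x i j * (Summit.QuantumFields.YangMills.Theorems.EquipartitionPinsProbe.combTransport U x)⁻¹) ∧
      (∀ (e : Literature.MathematicalPhysics.QuantumLattice.ZdEdge 4), (¬ ∀ j : Fin 4, e.2 < j → e.1 j = 0) → ∀ (g : G) (x : Literature.Probability.LatticeModels.Site 4),
        Summit.QuantumFields.YangMills.Theorems.EquipartitionPinsProbe.combTransport (Function.update U e g) x = Summit.QuantumFields.YangMills.Theorems.EquipartitionPinsProbe.combTransport U x) :=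
  Summit.QuantumFields.YangMills.Theorems.EquipartitionPinsProbe.stub_combBasics

/-- STUB TC2 — **comb Poincaré inequality** (Chatterjee Lemma 10.2 on `ℤ⁴`, both signs): the energy of a
gauge-fixed link is controlled by the energies of finitely many plaquettes (`N − Re tr` is half the squared
Hilbert–Schmidt distance to `1` on unitaries; induct on the largest non-zero coordinate with the plaquette
`(x − e_k; j, k)` / `(x; j, k)`, whose direction-`k` links are comb links). -/
theorem stub_combPoincare :
    ∀ (G : Type) [Group G] {N : ℕ} (ρ : G →* Matrix (Fin N) (Fin N) ℂ),
      (∀ g, ρ g ∈ Matrix.unitaryGroup (Fin N) ℂ) →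
      ∀ e : Literature.MathematicalPhysics.QuantumLattice.ZdEdge 4, ∃ (S : Finset (Literature.MathematicalPhysics.QuantumLattice.ZdPlaquette 4)) (C : ℝ), 0 ≤ C ∧
        ∀ U : Literature.MathematicalPhysics.QuantumLattice.LGConfig 4 G,
          (N : ℝ) - (ρ (Summit.QuantumFields.YangMills.Theorems.EquipartitionPinsProbe.axialFix U e)).trace.re ≤
            C * ∑ p ∈ S, ((N : ℝ) - (ρ (Literature.MathematicalPhysics.QuantumLattice.plaquetteHolonomyZd U p.1 p.2.1.1 p.2.1.2)).trace.re) :=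
  Summit.QuantumFields.YangMills.Theorems.EquipartitionPinsProbe.stub_combPoincare

/-- STUB TC3 — **continuity and locality of the plaquette field**: `U ↦ Y^β(U)` is continuous into the
product space and each coordinate is a cylinder function. -/
theorem stub_plaqFieldContinuous :
    ∀ (G : Type) [Group G] [TopologicalSpace G] [IsTopologicalGroup G]
      (r : Literature.MathematicalPhysics.QuantumFieldTheory.LatticeRep G) (β : ℝ),
      Continuous (Summit.QuantumFields.YangMills.Theorems.EquipartitionPinsProbe.plaqField r β) ∧
      ∀ (p : Literature.MathematicalPhysics.QuantumLattice.ZdPlaquette 4) (a : Fin (Summit.QuantumFields.YangMills.Theorems.EquipartitionPinsProbe.lieDim r)), ∃ S : Finset (Literature.MathematicalPhysics.QuantumLattice.ZdEdge 4),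
        Literature.MathematicalPhysics.QuantumLattice.IsCylinder (fun U : Literature.MathematicalPhysics.QuantumLattice.LGConfig 4 G => Summit.QuantumFields.YangMills.Theorems.EquipartitionPinsProbe.plaqField r β U p a) S :=
  Summit.QuantumFields.YangMills.Theorems.EquipartitionPinsProbe.stub_plaqFieldContinuous

/-- STUB TL — **the Lie frame**: `e_a = lieVec r a` is an orthonormal basis of `𝔤_r` for `Re tr(X Y†)`,
skew-Hermitian, generating one-parameter subgroups of `r(G)`; `lieCoord` gives the coordinates on `𝔤_r`
and satisfies Bessel's inequality `∑_a ⟨M, e_a⟩² ≤ ‖M‖²_HS = Re tr(M M†)` for every matrix `M`. -/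
theorem stub_lieFrame :
    ∀ (G : Type) [Group G] [TopologicalSpace G] [CompactSpace G] (r : Literature.MathematicalPhysics.QuantumFieldTheory.LatticeRep G),
      (∀ a b : Fin (Summit.QuantumFields.YangMills.Theorems.EquipartitionPinsProbe.lieDim r), Summit.QuantumFields.YangMills.Theorems.EquipartitionPinsProbe.lieCoord r (Summit.QuantumFields.YangMills.Theorems.EquipartitionPinsProbe.lieVec r a) b = if a = b then 1 else 0) ∧
      (∀ a : Fin (Summit.QuantumFields.YangMills.Theorems.EquipartitionPinsProbe.lieDim r), Matrix.conjTranspose (Summit.QuantumFields.YangMills.Theorems.EquipartitionPinsProbe.lieVec r a) = -Summit.QuantumFields.YangMills.Theorems.EquipartitionPinsProbe.lieVec r a) ∧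
      (∀ (a : Fin (Summit.QuantumFields.YangMills.Theorems.EquipartitionPinsProbe.lieDim r)) (t : ℝ), NormedSpace.exp ((t : ℂ) • Summit.QuantumFields.YangMills.Theorems.EquipartitionPinsProbe.lieVec r a) ∈ Set.range r.ρ) ∧
      (∀ X : Matrix (Fin r.N) (Fin r.N) ℂ,
        X ∈ Submodule.span ℝ {X : Matrix (Fin r.N) (Fin r.N) ℂ |
            ∀ t : ℝ, NormedSpace.exp ((t : ℂ) • X) ∈ Set.range r.ρ} →
          X = ∑ a : Fin (Summit.QuantumFields.YangMills.Theorems.EquipartitionPinsProbe.lieDim r), (Summit.QuantumFields.YangMills.Theorems.EquipartitionPinsProbe.lieCoord r X a : ℂ) • Summit.QuantumFields.YangMills.Theorems.EquipartitionPinsProbe.lieVec r a) ∧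
      (∀ M : Matrix (Fin r.N) (Fin r.N) ℂ,
        ∑ a : Fin (Summit.QuantumFields.YangMills.Theorems.EquipartitionPinsProbe.lieDim r), (Summit.QuantumFields.YangMills.Theorems.EquipartitionPinsProbe.lieCoord r M a) ^ 2 ≤ (M * Matrix.conjTranspose M).trace.re) :=
  Summit.QuantumFields.YangMills.Theorems.EquipartitionPinsProbe.stub_lieFrame

/-- STUB TA — **second-order energy algebra**: the curl of the link coordinates differs from the
coordinates of the plaquette deviation by products of ≥ 2 link deviations
(`V₁V₂V₃⁻¹V₄⁻¹ − 1 − ∑(V_i^{±1} − 1) = ∑_{|I| ≥ 2} ∏_{i∈I}(V_i^{±1} − 1)`, `Re tr((V⁻¹−1)e†) = −Re tr((V−1)e†)`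
for unitary `V` and skew `e`, `‖V^{±1} − 1‖²_HS = 2(N − Re tr V)`). -/
theorem stub_energyAlgebra :
    ∀ (G : Type) [Group G] [TopologicalSpace G] (r : Literature.MathematicalPhysics.QuantumFieldTheory.LatticeRep G), ∃ K : ℝ,
      ∀ (U : Literature.MathematicalPhysics.QuantumLattice.LGConfig 4 G) (p : Literature.MathematicalPhysics.QuantumLattice.ZdPlaquette 4) (a : Fin (Summit.QuantumFields.YangMills.Theorems.EquipartitionPinsProbe.lieDim r)),
        |Literature.MathematicalPhysics.QuantumFieldTheory.plaquetteCurl (fun e => Summit.QuantumFields.YangMills.Theorems.EquipartitionPinsProbe.lieCoord r (r.ρ (Summit.QuantumFields.YangMills.Theorems.EquipartitionPinsProbe.axialFix U e) - 1) a) p -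
            Summit.QuantumFields.YangMills.Theorems.EquipartitionPinsProbe.lieCoord r (r.ρ (Literature.MathematicalPhysics.QuantumLattice.plaquetteHolonomyZd (Summit.QuantumFields.YangMills.Theorems.EquipartitionPinsProbe.axialFix U) p.1 p.2.1.1 p.2.1.2) - 1) a| ≤
          K * ∑ i : Fin 4, ((r.N : ℝ) - (r.ρ (Summit.QuantumFields.YangMills.Theorems.EquipartitionPinsProbe.axialFix U (Literature.MathematicalPhysics.QuantumFieldTheory.plaquetteBoundary p i))).trace.re) :=
  Summit.QuantumFields.YangMills.Theorems.EquipartitionPinsProbe.stub_energyAlgebra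

/-- STUB TB — **tangency defect** (von Neumann's chart): for `g ∈ G`, `ρ(g) − 1` is tangent to `𝔤_r` to
second order, `0 ≤ ‖ρ g − 1‖²_HS − ∑_a ⟨ρ g − 1, e_a⟩² ≤ K (N − Re tr ρ g)²`
(`ρ g = exp X`, `X ∈ 𝔤_r`, `‖X‖ ≤ 2‖ρ g − 1‖` near `1`, tree `exists_exp_chart_range`; far from `1` both sides
are bounded). -/
theorem stub_tangentDefect :
    ∀ (G : Type) [Group G] [TopologicalSpace G] [CompactSpace G] (r : Literature.MathematicalPhysics.QuantumFieldTheory.LatticeRep G), ∃ K : ℝ,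
      ∀ g : G,
        0 ≤ 2 * ((r.N : ℝ) - (r.ρ g).trace.re) - ∑ a : Fin (Summit.QuantumFields.YangMills.Theorems.EquipartitionPinsProbe.lieDim r), (Summit.QuantumFields.YangMills.Theorems.EquipartitionPinsProbe.lieCoord r (r.ρ g - 1) a) ^ 2 ∧
        2 * ((r.N : ℝ) - (r.ρ g).trace.re) - ∑ a : Fin (Summit.QuantumFields.YangMills.Theorems.EquipartitionPinsProbe.lieDim r), (Summit.QuantumFields.YangMills.Theorems.EquipartitionPinsProbe.lieCoord r (r.ρ g - 1) a) ^ 2 ≤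
          K * ((r.N : ℝ) - (r.ρ g).trace.re) ^ 2 :=
  Summit.QuantumFields.YangMills.Theorems.EquipartitionPinsProbe.stub_tangentDefect

/-- STUB TE — **uniform plaquette energy bound**: uniform equipartition at the origin and translation
covariance of the torus-limit states (`map_configShift_mem_infiniteVolumeLimitPoints`) bound
`β E_μ[N − Re tr ρ(U_p)]` at every plaquette, eventually in `β`, uniformly over limit states. -/
theorem stub_plaquetteEnergy :
    ∀ (G : Type) [Group G] [TopologicalSpace G] [IsTopologicalGroup G] [CompactSpace G],
      Literature.MathematicalPhysics.QuantumFieldTheory.IsCompactSimpleLieGroup G →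
      letI : MeasurableSpace G := borel G
      haveI : BorelSpace G := ⟨rfl⟩
      ∀ r : Literature.MathematicalPhysics.QuantumFieldTheory.LatticeRep G,
        (∀ ε : ℝ, 0 < ε → ∀ᶠ β : ℝ in Filter.atTop,
          ∀ μ ∈ Literature.MathematicalPhysics.QuantumLattice.infiniteVolumeLimitPoints (d := 4) r.ρ β,
            |β * (∫ U, (∑ i : Fin 4, ∑ j : Fin 4,
                if i < j then ((r.N : ℝ) - Literature.MathematicalPhysics.QuantumLattice.plaquetteObs r.ρ 0 i j U) else 0) ∂μ) -
              3 * (Summit.QuantumFields.YangMills.Theorems.EquipartitionPinsProbe.lieDim r : ℝ) / 2| < ε) →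
        ∀ᶠ β : ℝ in Filter.atTop, ∀ μ ∈ Literature.MathematicalPhysics.QuantumLattice.infiniteVolumeLimitPoints (d := 4) r.ρ β,
          ∀ p : Literature.MathematicalPhysics.QuantumLattice.ZdPlaquette 4,
            MeasureTheory.Integrable (fun U => (r.N : ℝ) - Literature.MathematicalPhysics.QuantumLattice.plaquetteObs r.ρ p.1 p.2.1.1 p.2.1.2 U) μ ∧
            β * ∫ U, ((r.N : ℝ) - Literature.MathematicalPhysics.QuantumLattice.plaquetteObs r.ρ p.1 p.2.1.1 p.2.1.2 U) ∂μ ≤ 3 * (Summit.QuantumFields.YangMills.Theorems.EquipartitionPinsProbe.lieDim r : ℝ) / 2 + 1 :=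
  Summit.QuantumFields.YangMills.Theorems.EquipartitionPinsProbe.stub_plaquetteEnergy

/-- STUB TM — **second moments of the plaquette field along a sequence of states**: for `β_k → ∞` and
`μ_k ∈ infiniteVolumeLimitPoints r.ρ β_k`, every coordinate `Y^{β_k}_p{}^a` is square integrable under `μ_k`
with a bound uniform in `k` (STUBS TC2, TE, TL: `(Y_p^a)² ≤ 4 ∑_{e ∈ ∂p} |A_e|²`,
`∑_a (A_e^a)² ≤ 2β(N − Re tr ρ(Ũ_e))`; crude bounds for the finitely many small `k`). -/
theorem stub_fieldMoments :
    ∀ (G : Type) [Group G] [TopologicalSpace G] [IsTopologicalGroup G] [CompactSpace G],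
      Literature.MathematicalPhysics.QuantumFieldTheory.IsCompactSimpleLieGroup G →
      letI : MeasurableSpace G := borel G
      haveI : BorelSpace G := ⟨rfl⟩
      ∀ r : Literature.MathematicalPhysics.QuantumFieldTheory.LatticeRep G,
        (∀ ε : ℝ, 0 < ε → ∀ᶠ β : ℝ in Filter.atTop,
          ∀ μ ∈ Literature.MathematicalPhysics.QuantumLattice.infiniteVolumeLimitPoints (d := 4) r.ρ β,
            |β * (∫ U, (∑ i : Fin 4, ∑ j : Fin 4,
                if i < j then ((r.N : ℝ) - Literature.MathematicalPhysics.QuantumLattice.plaquetteObs r.ρ 0 i j U) else 0) ∂μ) -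
              3 * (Summit.QuantumFields.YangMills.Theorems.EquipartitionPinsProbe.lieDim r : ℝ) / 2| < ε) →
        ∀ (β : ℕ → ℝ) (μ : ℕ → MeasureTheory.Measure (Literature.MathematicalPhysics.QuantumLattice.LGConfig 4 G)),
          Filter.Tendsto β Filter.atTop Filter.atTop →
          (∀ k, μ k ∈ Literature.MathematicalPhysics.QuantumLattice.infiniteVolumeLimitPoints (d := 4) r.ρ (β k)) →
          ∀ (p : Literature.MathematicalPhysics.QuantumLattice.ZdPlaquette 4) (a : Fin (Summit.QuantumFields.YangMills.Theorems.EquipartitionPinsProbe.lieDim r)), ∃ C : ℝ, ∀ k : ℕ,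
            MeasureTheory.Integrable (fun U => (Summit.QuantumFields.YangMills.Theorems.EquipartitionPinsProbe.plaqField r (β k) U p a) ^ 2) (μ k) ∧
            ∫ U, (Summit.QuantumFields.YangMills.Theorems.EquipartitionPinsProbe.plaqField r (β k) U p a) ^ 2 ∂(μ k) ≤ C :=
  Summit.QuantumFields.YangMills.Theorems.EquipartitionPinsProbe.stub_fieldMoments

/-- STUB TX — **extraction of a tangent law** (Chebyshev ⇒ tightness on the countable product,
Prokhorov `isCompact_closure_of_isTightMeasureSet`, metrisability of `ProbabilityMeasure`): a sequence of
probability measures on `ℝ^D`-valued `2`-cochains with coordinatewise bounded second moments has a weakly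
convergent subsequence. -/
theorem stub_extraction :
    ∀ (D : ℕ) (ν : ℕ → MeasureTheory.Measure (Literature.MathematicalPhysics.QuantumLattice.ZdPlaquette 4 → Fin D → ℝ)),
      (∀ k, MeasureTheory.IsProbabilityMeasure (ν k)) →
      (∀ (p : Literature.MathematicalPhysics.QuantumLattice.ZdPlaquette 4) (a : Fin D), ∃ C : ℝ, ∀ k : ℕ,
        MeasureTheory.Integrable (fun Y => (Y p a) ^ 2) (ν k) ∧ ∫ Y, (Y p a) ^ 2 ∂(ν k) ≤ C) →
      ∃ (φ : ℕ → ℕ) (τ : MeasureTheory.Measure (Literature.MathematicalPhysics.QuantumLattice.ZdPlaquette 4 → Fin D → ℝ)),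
        StrictMono φ ∧ MeasureTheory.IsProbabilityMeasure τ ∧
        ∀ f : (Literature.MathematicalPhysics.QuantumLattice.ZdPlaquette 4 → Fin D → ℝ) → ℝ, Continuous f → (∃ C : ℝ, ∀ Y, |f Y| ≤ C) →
          Filter.Tendsto (fun j : ℕ => ∫ Y, f Y ∂(ν (φ j))) Filter.atTop (nhds (∫ Y, f Y ∂τ)) :=
  Summit.QuantumFields.YangMills.Theorems.EquipartitionPinsProbe.stub_extraction

/-- STUB TK — **`d ∘ d = 0` on `ℤ⁴`**: the curl of any `1`-cochain is closed on every `3`-cell. -/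
theorem stub_curlClosed :
    ∀ (A : Literature.MathematicalPhysics.QuantumLattice.ZdEdge 4 → ℝ) (x : Literature.Probability.LatticeModels.Site 4) (i j k : Fin 4) (hij : i < j) (hjk : j < k),
      (Literature.MathematicalPhysics.QuantumFieldTheory.plaquetteCurl A (x + Pi.single i 1, ⟨(j, k), hjk⟩) - Literature.MathematicalPhysics.QuantumFieldTheory.plaquetteCurl A (x, ⟨(j, k), hjk⟩)) -
        (Literature.MathematicalPhysics.QuantumFieldTheory.plaquetteCurl A (x + Pi.single j 1, ⟨(i, k), hij.trans hjk⟩) -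
          Literature.MathematicalPhysics.QuantumFieldTheory.plaquetteCurl A (x, ⟨(i, k), hij.trans hjk⟩)) +
        (Literature.MathematicalPhysics.QuantumFieldTheory.plaquetteCurl A (x + Pi.single k 1, ⟨(i, j), hij⟩) - Literature.MathematicalPhysics.QuantumFieldTheory.plaquetteCurl A (x, ⟨(i, j), hij⟩)) = 0 :=
  Summit.QuantumFields.YangMills.Theorems.EquipartitionPinsProbe.stub_curlClosed

/-- STUB TW — **closedness survives weak limits**: if every `ν_k` is carried by cochains that are closed
on a given `3`-cell and colour, so is every weak limit (test against `min(|dY|, 1)`). -/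
theorem stub_closedLimit :
    ∀ (D : ℕ) (ν : ℕ → MeasureTheory.Measure (Literature.MathematicalPhysics.QuantumLattice.ZdPlaquette 4 → Fin D → ℝ))
      (τ : MeasureTheory.Measure (Literature.MathematicalPhysics.QuantumLattice.ZdPlaquette 4 → Fin D → ℝ)),
      (∀ k, MeasureTheory.IsProbabilityMeasure (ν k)) → MeasureTheory.IsProbabilityMeasure τ →
      (∀ f : (Literature.MathematicalPhysics.QuantumLattice.ZdPlaquette 4 → Fin D → ℝ) → ℝ, Continuous f → (∃ C : ℝ, ∀ Y, |f Y| ≤ C) →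
          Filter.Tendsto (fun k : ℕ => ∫ Y, f Y ∂(ν k)) Filter.atTop (nhds (∫ Y, f Y ∂τ))) →
      ∀ (x : Literature.Probability.LatticeModels.Site 4) (i j k : Fin 4) (hij : i < j) (hjk : j < k) (a : Fin D),
        (∀ n : ℕ, ∀ᵐ Y ∂(ν n),
          (Y (x + Pi.single i 1, ⟨(j, k), hjk⟩) a - Y (x, ⟨(j, k), hjk⟩) a) -
            (Y (x + Pi.single j 1, ⟨(i, k), hij.trans hjk⟩) a - Y (x, ⟨(i, k), hij.trans hjk⟩) a) +
            (Y (x + Pi.single k 1, ⟨(i, j), hij⟩) a - Y (x, ⟨(i, j), hij⟩) a) = 0) →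
        ∀ᵐ Y ∂τ,
          (Y (x + Pi.single i 1, ⟨(j, k), hjk⟩) a - Y (x, ⟨(j, k), hjk⟩) a) -
            (Y (x + Pi.single j 1, ⟨(i, k), hij.trans hjk⟩) a - Y (x, ⟨(i, k), hij.trans hjk⟩) a) +
            (Y (x + Pi.single k 1, ⟨(i, j), hij⟩) a - Y (x, ⟨(i, j), hij⟩) a) = 0 :=
  Summit.QuantumFields.YangMills.Theorems.EquipartitionPinsProbe.stub_closedLimit

/-- STUB TF — **truncated Fatou with approximation in probability** (abstract): if `Y_t − Z_t → 0` in
probability for each `t` of a finite family and `∑_t E Z_t² ≤ B` eventually, then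
`∑_t E[Y_t² ∧ M] ≤ (1 + η) B + η` eventually (`(y² ∧ M) ≤ (1+η) z² + ((1 + η⁻¹)(y − z)² ∧ M)`). -/
theorem stub_truncatedFatou :
    ∀ (Ω : Type) [MeasurableSpace Ω] (T : Type) [Fintype T] (μ : ℕ → MeasureTheory.Measure Ω),
      (∀ k, MeasureTheory.IsProbabilityMeasure (μ k)) →
      ∀ (Y Z : T → ℕ → Ω → ℝ), (∀ t k, Measurable (Y t k)) → (∀ t k, Measurable (Z t k)) →
        (∀ (t : T) (δ : ℝ), 0 < δ →
          Filter.Tendsto (fun k : ℕ => (μ k).real {ω | δ < |Y t k ω - Z t k ω|}) Filter.atTop (nhds 0)) →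
        ∀ B : ℝ, (∀ᶠ k : ℕ in Filter.atTop,
          (∀ t, MeasureTheory.Integrable (fun ω => (Z t k ω) ^ 2) (μ k)) ∧
            ∑ t, ∫ ω, (Z t k ω) ^ 2 ∂(μ k) ≤ B) →
        ∀ (M η : ℝ), 0 < M → 0 < η → ∀ᶠ k : ℕ in Filter.atTop,
          ∑ t, ∫ ω, min ((Y t k ω) ^ 2) M ∂(μ k) ≤ (1 + η) * B + η :=
  Summit.QuantumFields.YangMills.Theorems.EquipartitionPinsProbe.stub_truncatedFatou

/-- STUB T0' — **the energies follow the field** (T0 in probability, uniformly over limit states): for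
bounded continuous `f` of finitely many plaquette energies, `E_μ f(βE) − E_μ f(½|Y^β|²) → 0` as `β → ∞`
uniformly in `μ ∈ infiniteVolumeLimitPoints r.ρ β` (STUBS TA, TB, TC2, TE, TL: `βE_p = ½‖√β(V_p − 1)‖²`,
`|½‖√β(V_p−1)‖² − ½|Y_p|²| → 0` in probability; `f` is uniformly continuous on large balls). -/
theorem stub_energyLaw :
    ∀ (G : Type) [Group G] [TopologicalSpace G] [IsTopologicalGroup G] [CompactSpace G],
      Literature.MathematicalPhysics.QuantumFieldTheory.IsCompactSimpleLieGroup G →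
      letI : MeasurableSpace G := borel G
      haveI : BorelSpace G := ⟨rfl⟩
      ∀ r : Literature.MathematicalPhysics.QuantumFieldTheory.LatticeRep G,
        (∀ ε : ℝ, 0 < ε → ∀ᶠ β : ℝ in Filter.atTop,
          ∀ μ ∈ Literature.MathematicalPhysics.QuantumLattice.infiniteVolumeLimitPoints (d := 4) r.ρ β,
            |β * (∫ U, (∑ i : Fin 4, ∑ j : Fin 4,
                if i < j then ((r.N : ℝ) - Literature.MathematicalPhysics.QuantumLattice.plaquetteObs r.ρ 0 i j U) else 0) ∂μ) -
              3 * (Summit.QuantumFields.YangMills.Theorems.EquipartitionPinsProbe.lieDim r : ℝ) / 2| < ε) →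
        ∀ (m : ℕ) (p : Fin m → Literature.MathematicalPhysics.QuantumLattice.ZdPlaquette 4) (f : (Fin m → ℝ) → ℝ),
          Continuous f → (∃ C : ℝ, ∀ v, |f v| ≤ C) →
          ∀ ε : ℝ, 0 < ε → ∀ᶠ β : ℝ in Filter.atTop,
            ∀ μ ∈ Literature.MathematicalPhysics.QuantumLattice.infiniteVolumeLimitPoints (d := 4) r.ρ β,
              |(∫ U, f (fun i => β * ((r.N : ℝ) -
                  Literature.MathematicalPhysics.QuantumLattice.plaquetteObs r.ρ (p i).1 (p i).2.1.1 (p i).2.1.2 U)) ∂μ) -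
                ∫ U, f (fun i => (1 / 2 : ℝ) * ∑ a : Fin (Summit.QuantumFields.YangMills.Theorems.EquipartitionPinsProbe.lieDim r), (Summit.QuantumFields.YangMills.Theorems.EquipartitionPinsProbe.plaqField r β U (p i) a) ^ 2) ∂μ| < ε :=
  Summit.QuantumFields.YangMills.Theorems.EquipartitionPinsProbe.stub_energyLaw

/-- STUB T2' — **second moments and the budget of a tangent law** (T2): along `β_k → ∞`,
`μ_k ∈ infiniteVolumeLimitPoints r.ρ β_k` with `law(Y^{β_k}) → τ` weakly, `E_τ (Y_p^a)² ≤ B` uniformly and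
`∑_{i<j}∑_a E_τ (Y^a_{(0;i,j)})² ≤ 3D` (STUB TF with `Z_p^a = √β ⟨ρ(Ũ_p) − 1, e_a⟩`,
`∑_a (Z_p^a)² ≤ 2β(N − Re tr ρ U_p)` by Bessel, STUBS TA, TE, and monotone convergence in the truncation). -/
theorem stub_secondMoments :
    ∀ (G : Type) [Group G] [TopologicalSpace G] [IsTopologicalGroup G] [CompactSpace G],
      Literature.MathematicalPhysics.QuantumFieldTheory.IsCompactSimpleLieGroup G →
      letI : MeasurableSpace G := borel G
      haveI : BorelSpace G := ⟨rfl⟩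
      ∀ r : Literature.MathematicalPhysics.QuantumFieldTheory.LatticeRep G,
        (∀ ε : ℝ, 0 < ε → ∀ᶠ β : ℝ in Filter.atTop,
          ∀ μ ∈ Literature.MathematicalPhysics.QuantumLattice.infiniteVolumeLimitPoints (d := 4) r.ρ β,
            |β * (∫ U, (∑ i : Fin 4, ∑ j : Fin 4,
                if i < j then ((r.N : ℝ) - Literature.MathematicalPhysics.QuantumLattice.plaquetteObs r.ρ 0 i j U) else 0) ∂μ) -
              3 * (Summit.QuantumFields.YangMills.Theorems.EquipartitionPinsProbe.lieDim r : ℝ) / 2| < ε) →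
        ∀ (β : ℕ → ℝ) (μ : ℕ → MeasureTheory.Measure (Literature.MathematicalPhysics.QuantumLattice.LGConfig 4 G)),
          Filter.Tendsto β Filter.atTop Filter.atTop →
          (∀ k, μ k ∈ Literature.MathematicalPhysics.QuantumLattice.infiniteVolumeLimitPoints (d := 4) r.ρ (β k)) →
          ∀ τ : MeasureTheory.Measure (Literature.MathematicalPhysics.QuantumLattice.ZdPlaquette 4 → Fin (Summit.QuantumFields.YangMills.Theorems.EquipartitionPinsProbe.lieDim r) → ℝ),
            MeasureTheory.IsProbabilityMeasure τ →
            (∀ f : (Literature.MathematicalPhysics.QuantumLattice.ZdPlaquette 4 → Fin (Summit.QuantumFields.YangMills.Theorems.EquipartitionPinsProbe.lieDim r) → ℝ) → ℝ, Continuous f →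
                (∃ C : ℝ, ∀ Y, |f Y| ≤ C) →
              Filter.Tendsto (fun k : ℕ => ∫ U, f (Summit.QuantumFields.YangMills.Theorems.EquipartitionPinsProbe.plaqField r (β k) U) ∂(μ k)) Filter.atTop
                (nhds (∫ Y, f Y ∂τ))) →
            (∃ B : ℝ, ∀ (p : Literature.MathematicalPhysics.QuantumLattice.ZdPlaquette 4) (a : Fin (Summit.QuantumFields.YangMills.Theorems.EquipartitionPinsProbe.lieDim r)),
                MeasureTheory.Integrable (fun Y => (Y p a) ^ 2) τ ∧ ∫ Y, (Y p a) ^ 2 ∂τ ≤ B) ∧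
            (∑ i : Fin 4, ∑ j : Fin 4, ∑ a : Fin (Summit.QuantumFields.YangMills.Theorems.EquipartitionPinsProbe.lieDim r),
                if hij : i < j then ∫ Y, (Y ((0 : Literature.Probability.LatticeModels.Site 4), ⟨(i, j), hij⟩) a) ^ 2 ∂τ else 0) ≤
              3 * (Summit.QuantumFields.YangMills.Theorems.EquipartitionPinsProbe.lieDim r : ℝ) :=
  Summit.QuantumFields.YangMills.Theorems.EquipartitionPinsProbe.stub_secondMoments

/-- STUB TS0 — **the comb transport of a shifted configuration**: shifting a forward comb link `e = (x,i)`
(`x_j = 0` for `j > i`, `x_i ≥ 0`) on the LEFT by `G_U(x)⁻¹ k G_U(x)`, or a backward comb link (`x_i < 0`) on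
the RIGHT by `G_U(x+eᵢ)⁻¹ k⁻¹ G_U(x+eᵢ)`, multiplies `G_U(y)` on the left by `k` exactly for `y` in the shadow
of `e`; and the transports `G_U(x)` (`x_i ≥ 0`), `G_U(x + eᵢ)` (`x_i < 0`) do not read the link `(x, i)` at all
(STUB TC1 and the path algebra `CombBasics.lineZ_add`). -/
theorem stub_combShift :
    ∀ (G : Type) [Group G] (U : Literature.MathematicalPhysics.QuantumLattice.LGConfig 4 G) (e : Literature.MathematicalPhysics.QuantumLattice.ZdEdge 4) (k : G),
      ((∀ j : Fin 4, e.2 < j → e.1 j = 0) → 0 ≤ e.1 e.2 → ∀ y : Literature.Probability.LatticeModels.Site 4,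
        Summit.QuantumFields.YangMills.Theorems.EquipartitionPinsProbe.combTransport (Function.update U e
            ((Summit.QuantumFields.YangMills.Theorems.EquipartitionPinsProbe.combTransport U e.1)⁻¹ * k * Summit.QuantumFields.YangMills.Theorems.EquipartitionPinsProbe.combTransport U e.1 * U e)) y =
          (if y ∈ Summit.QuantumFields.YangMills.Theorems.EquipartitionPinsProbe.shadow e then k else 1) * Summit.QuantumFields.YangMills.Theorems.EquipartitionPinsProbe.combTransport U y) ∧
      ((∀ j : Fin 4, e.2 < j → e.1 j = 0) → e.1 e.2 < 0 → ∀ y : Literature.Probability.LatticeModels.Site 4,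
        Summit.QuantumFields.YangMills.Theorems.EquipartitionPinsProbe.combTransport (Function.update U e
            (U e * ((Summit.QuantumFields.YangMills.Theorems.EquipartitionPinsProbe.combTransport U (e.1 + Pi.single e.2 1))⁻¹ * k⁻¹ *
              Summit.QuantumFields.YangMills.Theorems.EquipartitionPinsProbe.combTransport U (e.1 + Pi.single e.2 1)))) y =
          (if y ∈ Summit.QuantumFields.YangMills.Theorems.EquipartitionPinsProbe.shadow e then k else 1) * Summit.QuantumFields.YangMills.Theorems.EquipartitionPinsProbe.combTransport U y) ∧
      (0 ≤ e.1 e.2 → ∀ g : G, Summit.QuantumFields.YangMills.Theorems.EquipartitionPinsProbe.combTransport (Function.update U e g) e.1 = Summit.QuantumFields.YangMills.Theorems.EquipartitionPinsProbe.combTransport U e.1) ∧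
      (e.1 e.2 < 0 → ∀ g : G,
        Summit.QuantumFields.YangMills.Theorems.EquipartitionPinsProbe.combTransport (Function.update U e g) (e.1 + Pi.single e.2 1) =
          Summit.QuantumFields.YangMills.Theorems.EquipartitionPinsProbe.combTransport U (e.1 + Pi.single e.2 1)) :=
  Summit.QuantumFields.YangMills.Theorems.EquipartitionPinsProbe.stub_combShift

/-- STUB TS1 — **the skew Haar shift on the torus** (generalises p108068 `haarShift_wilsonExpectation`):
the one-link Haar-shift identity for Wilson's torus measure with a shift element `γ(U)` that does not read
the shifted link, on the left and on the right (left/right invariance of Haar measure in the coordinate `e`,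
Fubini via `MeasurePreserving.skew_product`). -/
theorem stub_haarShiftSkew :
    ∀ (G : Type) [Group G] [TopologicalSpace G] [IsTopologicalGroup G] [CompactSpace G]
      [SecondCountableTopology G] [MeasurableSpace G] [BorelSpace G] {N : ℕ}
      (ρ : G →* Matrix (Fin N) (Fin N) ℂ), Continuous ρ →
      ∀ (d L : ℕ) [NeZero L] (β : ℝ) (e : Literature.MathematicalPhysics.QuantumFieldTheory.Edge d L) (γ : Literature.MathematicalPhysics.QuantumFieldTheory.GaugeConfig d L G → G),
        Measurable γ → (∀ (U : Literature.MathematicalPhysics.QuantumFieldTheory.GaugeConfig d L G) (g : G), γ (Function.update U e g) = γ U) →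
        ∀ f : Literature.MathematicalPhysics.QuantumFieldTheory.GaugeConfig d L G → ℝ,
          (∫ U, f (Function.update U e (γ U * U e)) ∂(Literature.MathematicalPhysics.QuantumFieldTheory.wilsonMeasure (d := d) (L := L) ρ β) =
            ∫ U, f U * Real.exp (-(β * (Literature.MathematicalPhysics.QuantumFieldTheory.wilsonAction (d := d) (L := L) ρ
                (Function.update U e ((γ U)⁻¹ * U e)) - Literature.MathematicalPhysics.QuantumFieldTheory.wilsonAction (d := d) (L := L) ρ U)))
              ∂(Literature.MathematicalPhysics.QuantumFieldTheory.wilsonMeasure (d := d) (L := L) ρ β)) ∧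
          (∫ U, f (Function.update U e (U e * γ U)) ∂(Literature.MathematicalPhysics.QuantumFieldTheory.wilsonMeasure (d := d) (L := L) ρ β) =
            ∫ U, f U * Real.exp (-(β * (Literature.MathematicalPhysics.QuantumFieldTheory.wilsonAction (d := d) (L := L) ρ
                (Function.update U e (U e * (γ U)⁻¹)) - Literature.MathematicalPhysics.QuantumFieldTheory.wilsonAction (d := d) (L := L) ρ U)))
              ∂(Literature.MathematicalPhysics.QuantumFieldTheory.wilsonMeasure (d := d) (L := L) ρ β)) :=
  Summit.QuantumFields.YangMills.Theorems.EquipartitionPinsProbe.stub_haarShiftSkew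

/-- STUB TS2 — **the skew Haar shift for torus-limit states** on `ℤ⁴`: the identity of STUB TS1 passes to
every `μ ∈ infiniteVolumeLimitPoints ρ β` for bounded continuous cylinder `F` and continuous cylinder `γ`,
the action difference being that of the plaquettes touching `e` (`wilsonBoundaryAction ρ {e}`): for large
tori the periodic lift intertwines the shifted observables (`eventually_injOn_torusEdge`). -/
theorem stub_haarShiftLimit :
    ∀ (G : Type) [Group G] [TopologicalSpace G] [IsTopologicalGroup G] [CompactSpace G] [T2Space G]
      [SecondCountableTopology G] [MeasurableSpace G] [BorelSpace G] {N : ℕ}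
      (ρ : G →* Matrix (Fin N) (Fin N) ℂ), Continuous ρ →
      ∀ (β : ℝ) (μ : MeasureTheory.Measure (Literature.MathematicalPhysics.QuantumLattice.LGConfig 4 G)),
        μ ∈ Literature.MathematicalPhysics.QuantumLattice.infiniteVolumeLimitPoints (d := 4) ρ β →
        ∀ (e : Literature.MathematicalPhysics.QuantumLattice.ZdEdge 4) (γ : Literature.MathematicalPhysics.QuantumLattice.LGConfig 4 G → G) (Sγ : Finset (Literature.MathematicalPhysics.QuantumLattice.ZdEdge 4)),
          Literature.MathematicalPhysics.QuantumLattice.IsCylinder γ Sγ → Continuous γ → (∀ (U : Literature.MathematicalPhysics.QuantumLattice.LGConfig 4 G) (g : G), γ (Function.update U e g) = γ U) →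
          ∀ (F : Literature.MathematicalPhysics.QuantumLattice.LGConfig 4 G → ℝ) (SF : Finset (Literature.MathematicalPhysics.QuantumLattice.ZdEdge 4)),
            Literature.MathematicalPhysics.QuantumLattice.IsCylinder F SF → Continuous F → (∃ C : ℝ, ∀ U, |F U| ≤ C) →
            (∫ U, F (Function.update U e (γ U * U e)) ∂μ =
              ∫ U, F U * Real.exp (-(β * (Literature.MathematicalPhysics.QuantumLattice.wilsonBoundaryAction ρ {e}
                  (Function.update U e ((γ U)⁻¹ * U e)) - Literature.MathematicalPhysics.QuantumLattice.wilsonBoundaryAction ρ {e} U))) ∂μ) ∧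
            (∫ U, F (Function.update U e (U e * γ U)) ∂μ =
              ∫ U, F U * Real.exp (-(β * (Literature.MathematicalPhysics.QuantumLattice.wilsonBoundaryAction ρ {e}
                  (Function.update U e (U e * (γ U)⁻¹)) - Literature.MathematicalPhysics.QuantumLattice.wilsonBoundaryAction ρ {e} U))) ∂μ) :=
  Summit.QuantumFields.YangMills.Theorems.EquipartitionPinsProbe.stub_haarShiftLimit

/-- STUB TS3 — **derivative of the plaquette field along the link shift** (deterministic): along the left
family (non-comb or forward comb link `e`) resp. the right family (backward comb link), with a one-parameter
subgroup `k` of `G` over `e_b`, `t ↦ Y^β_p{}^a(T_t U)` is differentiable at `0` with derivative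
`√β (±[p : e] δ_{ab} + err)`, `err² ≤ K · (link energies of p)` (STUB TS0: `G_{T_tU}(y) = k_t^{[y ∈ shadow e]} G_U(y)`,
so `ρ(Ũ'_{e'}) = e^{a tX} ρ(Ũ_{e'}) e^{−b tX}` with `a − b = ±δ_e(e') − (d 1_shadow)(e')`, and the curl of a
gradient vanishes). RESHAPE (lead c3): the statement of STUB TS0 (for the same `G`) is taken as a hypothesis, so
that the two stubs are proved independently. -/
theorem stub_shiftDerivField :
    ∀ (G : Type) [Group G] [TopologicalSpace G] [IsTopologicalGroup G] [CompactSpace G]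
      (r : Literature.MathematicalPhysics.QuantumFieldTheory.LatticeRep G) (b : Fin (Summit.QuantumFields.YangMills.Theorems.EquipartitionPinsProbe.lieDim r)) (k : ℝ → G),
      (∀ t : ℝ, r.ρ (k t) = NormedSpace.exp ((t : ℂ) • Summit.QuantumFields.YangMills.Theorems.EquipartitionPinsProbe.lieVec r b)) →
      (∀ (U : Literature.MathematicalPhysics.QuantumLattice.LGConfig 4 G) (e : Literature.MathematicalPhysics.QuantumLattice.ZdEdge 4) (k : G),
        ((∀ j : Fin 4, e.2 < j → e.1 j = 0) → 0 ≤ e.1 e.2 → ∀ y : Literature.Probability.LatticeModels.Site 4,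
          Summit.QuantumFields.YangMills.Theorems.EquipartitionPinsProbe.combTransport (Function.update U e
              ((Summit.QuantumFields.YangMills.Theorems.EquipartitionPinsProbe.combTransport U e.1)⁻¹ * k * Summit.QuantumFields.YangMills.Theorems.EquipartitionPinsProbe.combTransport U e.1 * U e)) y =
            (if y ∈ Summit.QuantumFields.YangMills.Theorems.EquipartitionPinsProbe.shadow e then k else 1) * Summit.QuantumFields.YangMills.Theorems.EquipartitionPinsProbe.combTransport U y) ∧
        ((∀ j : Fin 4, e.2 < j → e.1 j = 0) → e.1 e.2 < 0 → ∀ y : Literature.Probability.LatticeModels.Site 4,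
          Summit.QuantumFields.YangMills.Theorems.EquipartitionPinsProbe.combTransport (Function.update U e
              (U e * ((Summit.QuantumFields.YangMills.Theorems.EquipartitionPinsProbe.combTransport U (e.1 + Pi.single e.2 1))⁻¹ * k⁻¹ *
                Summit.QuantumFields.YangMills.Theorems.EquipartitionPinsProbe.combTransport U (e.1 + Pi.single e.2 1)))) y =
            (if y ∈ Summit.QuantumFields.YangMills.Theorems.EquipartitionPinsProbe.shadow e then k else 1) * Summit.QuantumFields.YangMills.Theorems.EquipartitionPinsProbe.combTransport U y) ∧
        (0 ≤ e.1 e.2 → ∀ g : G, Summit.QuantumFields.YangMills.Theorems.EquipartitionPinsProbe.combTransport (Function.update U e g) e.1 = Summit.QuantumFields.YangMills.Theorems.EquipartitionPinsProbe.combTransport U e.1) ∧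
        (e.1 e.2 < 0 → ∀ g : G,
          Summit.QuantumFields.YangMills.Theorems.EquipartitionPinsProbe.combTransport (Function.update U e g) (e.1 + Pi.single e.2 1) =
            Summit.QuantumFields.YangMills.Theorems.EquipartitionPinsProbe.combTransport U (e.1 + Pi.single e.2 1))) →
      ∃ K : ℝ, ∀ (β : ℝ) (U : Literature.MathematicalPhysics.QuantumLattice.LGConfig 4 G) (e : Literature.MathematicalPhysics.QuantumLattice.ZdEdge 4) (p : Literature.MathematicalPhysics.QuantumLattice.ZdPlaquette 4) (a : Fin (Summit.QuantumFields.YangMills.Theorems.EquipartitionPinsProbe.lieDim r)),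
        (((¬ ∀ j : Fin 4, e.2 < j → e.1 j = 0) ∨ 0 ≤ e.1 e.2) → ∃ err : ℝ,
          HasDerivAt (fun t : ℝ => Summit.QuantumFields.YangMills.Theorems.EquipartitionPinsProbe.plaqField r β (Function.update U e
              ((Summit.QuantumFields.YangMills.Theorems.EquipartitionPinsProbe.combTransport U e.1)⁻¹ * k t * Summit.QuantumFields.YangMills.Theorems.EquipartitionPinsProbe.combTransport U e.1 * U e)) p a)
            (Real.sqrt β * ((if a = b then Literature.MathematicalPhysics.QuantumFieldTheory.plaquetteCurl (fun e' => if e' = e then (1 : ℝ) else 0) p else 0) + err)) 0 ∧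
          err ^ 2 ≤ K * ∑ i : Fin 4, ((r.N : ℝ) - (r.ρ (Summit.QuantumFields.YangMills.Theorems.EquipartitionPinsProbe.axialFix U (Literature.MathematicalPhysics.QuantumFieldTheory.plaquetteBoundary p i))).trace.re)) ∧
        ((∀ j : Fin 4, e.2 < j → e.1 j = 0) → e.1 e.2 < 0 → ∃ err : ℝ,
          HasDerivAt (fun t : ℝ => Summit.QuantumFields.YangMills.Theorems.EquipartitionPinsProbe.plaqField r β (Function.update U e
              (U e * ((Summit.QuantumFields.YangMills.Theorems.EquipartitionPinsProbe.combTransport U (e.1 + Pi.single e.2 1))⁻¹ * (k t)⁻¹ *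
                Summit.QuantumFields.YangMills.Theorems.EquipartitionPinsProbe.combTransport U (e.1 + Pi.single e.2 1)))) p a)
            (Real.sqrt β * (-(if a = b then Literature.MathematicalPhysics.QuantumFieldTheory.plaquetteCurl (fun e' => if e' = e then (1 : ℝ) else 0) p else 0) + err)) 0 ∧
          err ^ 2 ≤ K * ∑ i : Fin 4, ((r.N : ℝ) - (r.ρ (Summit.QuantumFields.YangMills.Theorems.EquipartitionPinsProbe.axialFix U (Literature.MathematicalPhysics.QuantumFieldTheory.plaquetteBoundary p i))).trace.re)) :=
  Summit.QuantumFields.YangMills.Theorems.EquipartitionPinsProbe.stub_shiftDerivField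

/-- STUB TS4 — **derivative of the one-link action along the link shift** (deterministic): along the same
families, `t ↦ S_e(T_t U)` (`S_e = wilsonBoundaryAction ρ {e}`) is differentiable at `0` with derivative `D`,
and `√β D` is `± ∑_{q ∋ e} [q : e] Y^β_q{}^b(U)` up to `K √β · (link energies near e)` (the derivative is exactly
`∑ ±⟨ρ(rot_e Ũ_q) − 1, e_b⟩`, and a cyclic rotation of the plaquette word agrees with `Ũ_q` and with the curl
of the link deviations to first order — the algebra of STUB TA). -/
theorem stub_shiftDerivAction :
    ∀ (G : Type) [Group G] [TopologicalSpace G] [IsTopologicalGroup G] [CompactSpace G]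
      (r : Literature.MathematicalPhysics.QuantumFieldTheory.LatticeRep G) (b : Fin (Summit.QuantumFields.YangMills.Theorems.EquipartitionPinsProbe.lieDim r)) (k : ℝ → G),
      (∀ t : ℝ, r.ρ (k t) = NormedSpace.exp ((t : ℂ) • Summit.QuantumFields.YangMills.Theorems.EquipartitionPinsProbe.lieVec r b)) →
      ∃ K : ℝ, ∀ (β : ℝ) (U : Literature.MathematicalPhysics.QuantumLattice.LGConfig 4 G) (e : Literature.MathematicalPhysics.QuantumLattice.ZdEdge 4),
        (((¬ ∀ j : Fin 4, e.2 < j → e.1 j = 0) ∨ 0 ≤ e.1 e.2) → ∃ D : ℝ,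
          HasDerivAt (fun t : ℝ => Literature.MathematicalPhysics.QuantumLattice.wilsonBoundaryAction r.ρ {e} (Function.update U e
              ((Summit.QuantumFields.YangMills.Theorems.EquipartitionPinsProbe.combTransport U e.1)⁻¹ * k t * Summit.QuantumFields.YangMills.Theorems.EquipartitionPinsProbe.combTransport U e.1 * U e))) D 0 ∧
          |Real.sqrt β * D - ∑ q ∈ Literature.MathematicalPhysics.QuantumLattice.plaquettesTouching {e},
              Literature.MathematicalPhysics.QuantumFieldTheory.plaquetteCurl (fun e' => if e' = e then (1 : ℝ) else 0) q * Summit.QuantumFields.YangMills.Theorems.EquipartitionPinsProbe.plaqField r β U q b| ≤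
            K * Real.sqrt β * ∑ q ∈ Literature.MathematicalPhysics.QuantumLattice.plaquettesTouching {e}, ∑ i : Fin 4,
              ((r.N : ℝ) - (r.ρ (Summit.QuantumFields.YangMills.Theorems.EquipartitionPinsProbe.axialFix U (Literature.MathematicalPhysics.QuantumFieldTheory.plaquetteBoundary q i))).trace.re)) ∧
        ((∀ j : Fin 4, e.2 < j → e.1 j = 0) → e.1 e.2 < 0 → ∃ D : ℝ,
          HasDerivAt (fun t : ℝ => Literature.MathematicalPhysics.QuantumLattice.wilsonBoundaryAction r.ρ {e} (Function.update U e
              (U e * ((Summit.QuantumFields.YangMills.Theorems.EquipartitionPinsProbe.combTransport U (e.1 + Pi.single e.2 1))⁻¹ * (k t)⁻¹ *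
                Summit.QuantumFields.YangMills.Theorems.EquipartitionPinsProbe.combTransport U (e.1 + Pi.single e.2 1))))) D 0 ∧
          |Real.sqrt β * D + ∑ q ∈ Literature.MathematicalPhysics.QuantumLattice.plaquettesTouching {e},
              Literature.MathematicalPhysics.QuantumFieldTheory.plaquetteCurl (fun e' => if e' = e then (1 : ℝ) else 0) q * Summit.QuantumFields.YangMills.Theorems.EquipartitionPinsProbe.plaqField r β U q b| ≤
            K * Real.sqrt β * ∑ q ∈ Literature.MathematicalPhysics.QuantumLattice.plaquettesTouching {e}, ∑ i : Fin 4,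
              ((r.N : ℝ) - (r.ρ (Summit.QuantumFields.YangMills.Theorems.EquipartitionPinsProbe.axialFix U (Literature.MathematicalPhysics.QuantumFieldTheory.plaquetteBoundary q i))).trace.re)) :=
  Summit.QuantumFields.YangMills.Theorems.EquipartitionPinsProbe.stub_shiftDerivAction

/-- STUB TS5 — **differentiating an identity of integrals** (abstract): two families of uniformly bounded,
uniformly Lipschitz-in-the-parameter measurable functions on a finite measure space with equal integrals for
every parameter have equal integrals of their parameter-derivatives at `0`
(`hasDerivAt_integral_of_dominated_loc_of_lip` twice and uniqueness of derivatives). -/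
theorem stub_diffIdentity :
    ∀ (Ω : Type) [MeasurableSpace Ω] (μ : MeasureTheory.Measure Ω), MeasureTheory.IsFiniteMeasure μ →
      ∀ (A B : ℝ → Ω → ℝ) (a b : Ω → ℝ) (K : ℝ),
        (∀ t, Measurable (A t)) → (∀ t, Measurable (B t)) → Measurable a → Measurable b →
        (∀ t ω, |A t ω| ≤ K) → (∀ t ω, |B t ω| ≤ K) →
        (∀ ω t s, |A t ω - A s ω| ≤ K * |t - s|) → (∀ ω t s, |B t ω - B s ω| ≤ K * |t - s|) →
        (∀ ω, HasDerivAt (fun t => A t ω) (a ω) 0) → (∀ ω, HasDerivAt (fun t => B t ω) (b ω) 0) →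
        (∀ t, ∫ ω, A t ω ∂μ = ∫ ω, B t ω ∂μ) →
        ∫ ω, a ω ∂μ = ∫ ω, b ω ∂μ :=
  Summit.QuantumFields.YangMills.Theorems.EquipartitionPinsProbe.stub_diffIdentity

/-- STUB TS6 — **weak convergence with a uniformly square-integrable weight** (abstract): if `ν_k → τ`
weakly, `g` is bounded continuous and `ℓ` is continuous with second moments bounded by `C` under every `ν_k`
and under `τ`, then `∫ g ℓ dν_k → ∫ g ℓ dτ` (truncate `ℓ` at level `M`; the tails cost `≤ ‖g‖_∞ C / M`). -/
theorem stub_uiLimit :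
    ∀ (D : ℕ) (ν : ℕ → MeasureTheory.Measure (Literature.MathematicalPhysics.QuantumLattice.ZdPlaquette 4 → Fin D → ℝ))
      (τ : MeasureTheory.Measure (Literature.MathematicalPhysics.QuantumLattice.ZdPlaquette 4 → Fin D → ℝ)),
      (∀ k, MeasureTheory.IsProbabilityMeasure (ν k)) → MeasureTheory.IsProbabilityMeasure τ →
      (∀ f : (Literature.MathematicalPhysics.QuantumLattice.ZdPlaquette 4 → Fin D → ℝ) → ℝ, Continuous f → (∃ C : ℝ, ∀ Y, |f Y| ≤ C) →
          Filter.Tendsto (fun k : ℕ => ∫ Y, f Y ∂(ν k)) Filter.atTop (nhds (∫ Y, f Y ∂τ))) →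
      ∀ (g ℓ : (Literature.MathematicalPhysics.QuantumLattice.ZdPlaquette 4 → Fin D → ℝ) → ℝ), Continuous g → (∃ C : ℝ, ∀ Y, |g Y| ≤ C) →
        Continuous ℓ →
        (∃ C : ℝ, (∀ k, MeasureTheory.Integrable (fun Y => (ℓ Y) ^ 2) (ν k) ∧ ∫ Y, (ℓ Y) ^ 2 ∂(ν k) ≤ C) ∧
          MeasureTheory.Integrable (fun Y => (ℓ Y) ^ 2) τ ∧ ∫ Y, (ℓ Y) ^ 2 ∂τ ≤ C) →
        Filter.Tendsto (fun k : ℕ => ∫ Y, g Y * ℓ Y ∂(ν k)) Filter.atTop (nhds (∫ Y, g Y * ℓ Y ∂τ)) :=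
  Summit.QuantumFields.YangMills.Theorems.EquipartitionPinsProbe.stub_uiLimit

/-! ### RESHAPE (lead c3, cycle 1, 2026-08-16): STUB T3' = TS7 ∘ TS8 ∘ TS9

`stub_steinLimit` is PROVED below from three stubs: TS7 `stub_steinFiniteBeta` (the differentiated
one-link skew Haar-shift identity at finite `β`, with its defect `o(1)` as `β → ∞` uniformly over
torus-limit states — the gauge-theory heart, held by the lead; proof from TS0, TS2–TS5, TA, TC2, TE, TL),
TS8 `stub_steinSingleEdgeLimit` (abstract: approximate single-edge identities pass to the weak limit,
by TS6) and TS9 `stub_steinReduction` (abstract: single-edge identities ⇒ the identity for every finitely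
supported `α`, by linearity after enlarging `S`). -/

/-- STUB TS7 — **the differentiated skew Haar shift at finite `β`** (single edge `e`, single colour `b`):
under uniform equipartition, for `S ⊇ plaquettesTouching {e}` and every `h`, the defects of the two
trigonometric single-edge Stein identities of the rescaled plaquette field `Y^β` under any
`μ ∈ infiniteVolumeLimitPoints r.ρ β` are `≤ η` for all large `β` (differentiate STUB TS2 along
`k_t = exp(t e_b)` conjugated by the comb transport, STUBS TS0/TS3/TS4 for the derivatives, TS5 for
exchanging `d/dt` and `∫`; the error terms are `O(E_μ[link energies]^{1/2}) = O(β^{-1/2})` by STUBS TC2, TE). -/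
theorem stub_steinFiniteBeta :
    ∀ (G : Type) [Group G] [TopologicalSpace G] [IsTopologicalGroup G] [CompactSpace G],
      Literature.MathematicalPhysics.QuantumFieldTheory.IsCompactSimpleLieGroup G →
      letI : MeasurableSpace G := borel G
      haveI : BorelSpace G := ⟨rfl⟩
      ∀ r : Literature.MathematicalPhysics.QuantumFieldTheory.LatticeRep G,
        (∀ ε : ℝ, 0 < ε → ∀ᶠ β : ℝ in Filter.atTop,
          ∀ μ ∈ Literature.MathematicalPhysics.QuantumLattice.infiniteVolumeLimitPoints (d := 4) r.ρ β,
            |β * (∫ U, (∑ i : Fin 4, ∑ j : Fin 4,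
                if i < j then ((r.N : ℝ) - Literature.MathematicalPhysics.QuantumLattice.plaquetteObs r.ρ 0 i j U) else 0) ∂μ) -
              3 * (Summit.QuantumFields.YangMills.Theorems.EquipartitionPinsProbe.lieDim r : ℝ) / 2| < ε) →
        ∀ (e : Literature.MathematicalPhysics.QuantumLattice.ZdEdge 4) (b : Fin (Summit.QuantumFields.YangMills.Theorems.EquipartitionPinsProbe.lieDim r))
          (S : Finset (Literature.MathematicalPhysics.QuantumLattice.ZdPlaquette 4))
          (h : Literature.MathematicalPhysics.QuantumLattice.ZdPlaquette 4 → Fin (Summit.QuantumFields.YangMills.Theorems.EquipartitionPinsProbe.lieDim r) → ℝ),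
          Literature.MathematicalPhysics.QuantumLattice.plaquettesTouching {e} ⊆ S →
          ∀ η : ℝ, 0 < η → ∀ᶠ β : ℝ in Filter.atTop,
            ∀ μ ∈ Literature.MathematicalPhysics.QuantumLattice.infiniteVolumeLimitPoints (d := 4) r.ρ β,
              |(∑ p ∈ S, Literature.MathematicalPhysics.QuantumFieldTheory.plaquetteCurl (fun e' => if e' = e then (1 : ℝ) else 0) p * h p b) *
                    (∫ U, Real.sin (∑ p ∈ S, ∑ a : Fin (Summit.QuantumFields.YangMills.Theorems.EquipartitionPinsProbe.lieDim r),
                      h p a * Summit.QuantumFields.YangMills.Theorems.EquipartitionPinsProbe.plaqField r β U p a) ∂μ) +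
                  ∫ U, Real.cos (∑ p ∈ S, ∑ a : Fin (Summit.QuantumFields.YangMills.Theorems.EquipartitionPinsProbe.lieDim r),
                      h p a * Summit.QuantumFields.YangMills.Theorems.EquipartitionPinsProbe.plaqField r β U p a) *
                    (∑ p ∈ S, Literature.MathematicalPhysics.QuantumFieldTheory.plaquetteCurl (fun e' => if e' = e then (1 : ℝ) else 0) p *
                      Summit.QuantumFields.YangMills.Theorems.EquipartitionPinsProbe.plaqField r β U p b) ∂μ| ≤ η ∧
              |(∫ U, Real.sin (∑ p ∈ S, ∑ a : Fin (Summit.QuantumFields.YangMills.Theorems.EquipartitionPinsProbe.lieDim r),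
                      h p a * Summit.QuantumFields.YangMills.Theorems.EquipartitionPinsProbe.plaqField r β U p a) *
                    (∑ p ∈ S, Literature.MathematicalPhysics.QuantumFieldTheory.plaquetteCurl (fun e' => if e' = e then (1 : ℝ) else 0) p *
                      Summit.QuantumFields.YangMills.Theorems.EquipartitionPinsProbe.plaqField r β U p b) ∂μ) -
                  (∑ p ∈ S, Literature.MathematicalPhysics.QuantumFieldTheory.plaquetteCurl (fun e' => if e' = e then (1 : ℝ) else 0) p * h p b) *
                    ∫ U, Real.cos (∑ p ∈ S, ∑ a : Fin (Summit.QuantumFields.YangMills.Theorems.EquipartitionPinsProbe.lieDim r),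
                      h p a * Summit.QuantumFields.YangMills.Theorems.EquipartitionPinsProbe.plaqField r β U p a) ∂μ| ≤ η :=
  Summit.QuantumFields.YangMills.Theorems.EquipartitionPinsProbe.stub_steinFiniteBeta

/-- STUB TS8 — **approximate single-edge Stein identities pass to the weak limit** (abstract): if
`ν_k → τ` weakly (probability measures on `ℝ^D`-valued `2`-cochains), the coordinates have second moments
bounded uniformly in `k` and under `τ`, and the two trigonometric identities with coefficient `c` hold under
`ν_k` up to defects that are eventually `≤ η` for every `η > 0`, then they hold exactly under `τ`
(STUB TS6 for the term with the linear weight `∑_p c_p Y_p^b`; plain weak convergence for the other). -/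
theorem stub_steinSingleEdgeLimit :
    ∀ (D : ℕ) (ν : ℕ → MeasureTheory.Measure (Literature.MathematicalPhysics.QuantumLattice.ZdPlaquette 4 → Fin D → ℝ))
      (τ : MeasureTheory.Measure (Literature.MathematicalPhysics.QuantumLattice.ZdPlaquette 4 → Fin D → ℝ)),
      (∀ k, MeasureTheory.IsProbabilityMeasure (ν k)) → MeasureTheory.IsProbabilityMeasure τ →
      (∀ f : (Literature.MathematicalPhysics.QuantumLattice.ZdPlaquette 4 → Fin D → ℝ) → ℝ, Continuous f → (∃ C : ℝ, ∀ Y, |f Y| ≤ C) →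
          Filter.Tendsto (fun k : ℕ => ∫ Y, f Y ∂(ν k)) Filter.atTop (nhds (∫ Y, f Y ∂τ))) →
      (∀ (p : Literature.MathematicalPhysics.QuantumLattice.ZdPlaquette 4) (a : Fin D), ∃ C : ℝ, ∀ k : ℕ,
        MeasureTheory.Integrable (fun Y => (Y p a) ^ 2) (ν k) ∧ ∫ Y, (Y p a) ^ 2 ∂(ν k) ≤ C) →
      (∃ B : ℝ, ∀ (p : Literature.MathematicalPhysics.QuantumLattice.ZdPlaquette 4) (a : Fin D),
        MeasureTheory.Integrable (fun Y => (Y p a) ^ 2) τ ∧ ∫ Y, (Y p a) ^ 2 ∂τ ≤ B) →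
      ∀ (S : Finset (Literature.MathematicalPhysics.QuantumLattice.ZdPlaquette 4)) (h : Literature.MathematicalPhysics.QuantumLattice.ZdPlaquette 4 → Fin D → ℝ)
        (c : Literature.MathematicalPhysics.QuantumLattice.ZdPlaquette 4 → ℝ) (b : Fin D),
        (∀ η : ℝ, 0 < η → ∀ᶠ k : ℕ in Filter.atTop,
          |(∑ p ∈ S, c p * h p b) * (∫ Y, Real.sin (∑ p ∈ S, ∑ a : Fin D, h p a * Y p a) ∂(ν k)) +
              ∫ Y, Real.cos (∑ p ∈ S, ∑ a : Fin D, h p a * Y p a) * (∑ p ∈ S, c p * Y p b) ∂(ν k)| ≤ η ∧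
          |(∫ Y, Real.sin (∑ p ∈ S, ∑ a : Fin D, h p a * Y p a) * (∑ p ∈ S, c p * Y p b) ∂(ν k)) -
              (∑ p ∈ S, c p * h p b) * ∫ Y, Real.cos (∑ p ∈ S, ∑ a : Fin D, h p a * Y p a) ∂(ν k)| ≤ η) →
        (∫ Y, Real.cos (∑ p ∈ S, ∑ a : Fin D, h p a * Y p a) * (∑ p ∈ S, c p * Y p b) ∂τ =
            -(∑ p ∈ S, c p * h p b) * ∫ Y, Real.sin (∑ p ∈ S, ∑ a : Fin D, h p a * Y p a) ∂τ) ∧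
        (∫ Y, Real.sin (∑ p ∈ S, ∑ a : Fin D, h p a * Y p a) * (∑ p ∈ S, c p * Y p b) ∂τ =
            (∑ p ∈ S, c p * h p b) * ∫ Y, Real.cos (∑ p ∈ S, ∑ a : Fin D, h p a * Y p a) ∂τ) :=
  Summit.QuantumFields.YangMills.Theorems.EquipartitionPinsProbe.stub_steinSingleEdgeLimit

/-- STUB TS9 — **from single edges to finitely supported `1`-forms** (abstract): if a probability measure
`τ` on `ℝ^D`-valued `2`-cochains with square-integrable coordinates satisfies the two trigonometric Stein
identities for every `α = δ_e ⊗ δ_b` and every finite `S ⊇ plaquettesTouching {e}`, then it satisfies them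
for every finitely supported `α` whose curl is supported in `S` (enlarge `S` by the plaquettes touching the
support of `α`, extend `h` by `0`, and use linearity of `plaquetteCurl` and of the integral). -/
theorem stub_steinReduction :
    ∀ (D : ℕ) (τ : MeasureTheory.Measure (Literature.MathematicalPhysics.QuantumLattice.ZdPlaquette 4 → Fin D → ℝ)),
      MeasureTheory.IsProbabilityMeasure τ →
      (∀ (p : Literature.MathematicalPhysics.QuantumLattice.ZdPlaquette 4) (a : Fin D), MeasureTheory.Integrable (fun Y => (Y p a) ^ 2) τ) →
      (∀ (S : Finset (Literature.MathematicalPhysics.QuantumLattice.ZdPlaquette 4)) (h : Literature.MathematicalPhysics.QuantumLattice.ZdPlaquette 4 → Fin D → ℝ)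
          (e : Literature.MathematicalPhysics.QuantumLattice.ZdEdge 4) (b : Fin D),
        Literature.MathematicalPhysics.QuantumLattice.plaquettesTouching {e} ⊆ S →
        (∫ Y, Real.cos (∑ p ∈ S, ∑ a : Fin D, h p a * Y p a) *
              (∑ p ∈ S, Literature.MathematicalPhysics.QuantumFieldTheory.plaquetteCurl (fun e' => if e' = e then (1 : ℝ) else 0) p * Y p b) ∂τ =
            -(∑ p ∈ S, Literature.MathematicalPhysics.QuantumFieldTheory.plaquetteCurl (fun e' => if e' = e then (1 : ℝ) else 0) p * h p b) *
              ∫ Y, Real.sin (∑ p ∈ S, ∑ a : Fin D, h p a * Y p a) ∂τ) ∧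
        (∫ Y, Real.sin (∑ p ∈ S, ∑ a : Fin D, h p a * Y p a) *
              (∑ p ∈ S, Literature.MathematicalPhysics.QuantumFieldTheory.plaquetteCurl (fun e' => if e' = e then (1 : ℝ) else 0) p * Y p b) ∂τ =
            (∑ p ∈ S, Literature.MathematicalPhysics.QuantumFieldTheory.plaquetteCurl (fun e' => if e' = e then (1 : ℝ) else 0) p * h p b) *
              ∫ Y, Real.cos (∑ p ∈ S, ∑ a : Fin D, h p a * Y p a) ∂τ)) →
      ∀ (S : Finset (Literature.MathematicalPhysics.QuantumLattice.ZdPlaquette 4)) (E : Finset (Literature.MathematicalPhysics.QuantumLattice.ZdEdge 4))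
        (h : Literature.MathematicalPhysics.QuantumLattice.ZdPlaquette 4 → Fin D → ℝ) (α : Literature.MathematicalPhysics.QuantumLattice.ZdEdge 4 → Fin D → ℝ),
        (∀ e, e ∉ E → α e = 0) →
        (∀ p, p ∉ S → ∀ a : Fin D, Literature.MathematicalPhysics.QuantumFieldTheory.plaquetteCurl (fun e => α e a) p = 0) →
        (∫ Y, Real.cos (∑ p ∈ S, ∑ a : Fin D, h p a * Y p a) *
              (∑ p ∈ S, ∑ a : Fin D, Literature.MathematicalPhysics.QuantumFieldTheory.plaquetteCurl (fun e => α e a) p * Y p a) ∂τ =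
            -(∑ p ∈ S, ∑ a : Fin D, Literature.MathematicalPhysics.QuantumFieldTheory.plaquetteCurl (fun e => α e a) p * h p a) *
              ∫ Y, Real.sin (∑ p ∈ S, ∑ a : Fin D, h p a * Y p a) ∂τ) ∧
        (∫ Y, Real.sin (∑ p ∈ S, ∑ a : Fin D, h p a * Y p a) *
              (∑ p ∈ S, ∑ a : Fin D, Literature.MathematicalPhysics.QuantumFieldTheory.plaquetteCurl (fun e => α e a) p * Y p a) ∂τ =
            (∑ p ∈ S, ∑ a : Fin D, Literature.MathematicalPhysics.QuantumFieldTheory.plaquetteCurl (fun e => α e a) p * h p a) *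
              ∫ Y, Real.cos (∑ p ∈ S, ∑ a : Fin D, h p a * Y p a) ∂τ) :=
  Summit.QuantumFields.YangMills.Theorems.EquipartitionPinsProbe.stub_steinReduction

/-- STUB T3' (now a theorem of the skeleton, lead c3) — **the Stein identity of a tangent law** (T3; the `β → ∞` limit of the differentiated skew
Haar-shift identity, held by the lead): along `β_k → ∞`, `μ_k ∈ infiniteVolumeLimitPoints r.ρ β_k` with
`law(Y^{β_k}) → τ` weakly, `E_τ[cos⟨Y,h⟩⟨Y,dα⟩] = −⟨dα,h⟩E_τ[sin⟨Y,h⟩]` and the companion identity, for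
finitely supported `h`, `α` (linearity in `α`; for `α = δ_e ⊗ e_a` differentiate STUB TS2 at `s = 0` along
`k_s = expChart(s e_a/√β)` with STUB TS0: `∂_s Y = dδ_e ⊗ e_a + O(‖V − 1‖)` by STUB TK, and
`β ∂_s S_e = ⟨Y, dδ_e ⊗ e_a⟩ + o(1)` in `L¹` by STUBS TA, TM; pass to the limit with uniform integrability). -/
theorem stub_steinLimit :
    ∀ (G : Type) [Group G] [TopologicalSpace G] [IsTopologicalGroup G] [CompactSpace G],
      Literature.MathematicalPhysics.QuantumFieldTheory.IsCompactSimpleLieGroup G →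
      letI : MeasurableSpace G := borel G
      haveI : BorelSpace G := ⟨rfl⟩
      ∀ r : Literature.MathematicalPhysics.QuantumFieldTheory.LatticeRep G,
        (∀ ε : ℝ, 0 < ε → ∀ᶠ β : ℝ in Filter.atTop,
          ∀ μ ∈ Literature.MathematicalPhysics.QuantumLattice.infiniteVolumeLimitPoints (d := 4) r.ρ β,
            |β * (∫ U, (∑ i : Fin 4, ∑ j : Fin 4,
                if i < j then ((r.N : ℝ) - Literature.MathematicalPhysics.QuantumLattice.plaquetteObs r.ρ 0 i j U) else 0) ∂μ) -
              3 * (Summit.QuantumFields.YangMills.Theorems.EquipartitionPinsProbe.lieDim r : ℝ) / 2| < ε) →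
        ∀ (β : ℕ → ℝ) (μ : ℕ → MeasureTheory.Measure (Literature.MathematicalPhysics.QuantumLattice.LGConfig 4 G)),
          Filter.Tendsto β Filter.atTop Filter.atTop →
          (∀ k, μ k ∈ Literature.MathematicalPhysics.QuantumLattice.infiniteVolumeLimitPoints (d := 4) r.ρ (β k)) →
          ∀ τ : MeasureTheory.Measure (Literature.MathematicalPhysics.QuantumLattice.ZdPlaquette 4 → Fin (Summit.QuantumFields.YangMills.Theorems.EquipartitionPinsProbe.lieDim r) → ℝ),
            MeasureTheory.IsProbabilityMeasure τ →
            (∀ f : (Literature.MathematicalPhysics.QuantumLattice.ZdPlaquette 4 → Fin (Summit.QuantumFields.YangMills.Theorems.EquipartitionPinsProbe.lieDim r) → ℝ) → ℝ, Continuous f →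
                (∃ C : ℝ, ∀ Y, |f Y| ≤ C) →
              Filter.Tendsto (fun k : ℕ => ∫ U, f (Summit.QuantumFields.YangMills.Theorems.EquipartitionPinsProbe.plaqField r (β k) U) ∂(μ k)) Filter.atTop
                (nhds (∫ Y, f Y ∂τ))) →
            ∀ (S : Finset (Literature.MathematicalPhysics.QuantumLattice.ZdPlaquette 4)) (E : Finset (Literature.MathematicalPhysics.QuantumLattice.ZdEdge 4))
              (h : Literature.MathematicalPhysics.QuantumLattice.ZdPlaquette 4 → Fin (Summit.QuantumFields.YangMills.Theorems.EquipartitionPinsProbe.lieDim r) → ℝ)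
              (α : Literature.MathematicalPhysics.QuantumLattice.ZdEdge 4 → Fin (Summit.QuantumFields.YangMills.Theorems.EquipartitionPinsProbe.lieDim r) → ℝ),
              (∀ e, e ∉ E → α e = 0) →
              (∀ p, p ∉ S → ∀ a : Fin (Summit.QuantumFields.YangMills.Theorems.EquipartitionPinsProbe.lieDim r),
                Literature.MathematicalPhysics.QuantumFieldTheory.plaquetteCurl (fun e => α e a) p = 0) →
              (∫ Y, Real.cos (∑ p ∈ S, ∑ a : Fin (Summit.QuantumFields.YangMills.Theorems.EquipartitionPinsProbe.lieDim r), h p a * Y p a) *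
                  (∑ p ∈ S, ∑ a : Fin (Summit.QuantumFields.YangMills.Theorems.EquipartitionPinsProbe.lieDim r),
                    Literature.MathematicalPhysics.QuantumFieldTheory.plaquetteCurl (fun e => α e a) p * Y p a) ∂τ =
                -(∑ p ∈ S, ∑ a : Fin (Summit.QuantumFields.YangMills.Theorems.EquipartitionPinsProbe.lieDim r),
                    Literature.MathematicalPhysics.QuantumFieldTheory.plaquetteCurl (fun e => α e a) p * h p a) *
                  ∫ Y, Real.sin (∑ p ∈ S, ∑ a : Fin (Summit.QuantumFields.YangMills.Theorems.EquipartitionPinsProbe.lieDim r), h p a * Y p a) ∂τ) ∧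
              (∫ Y, Real.sin (∑ p ∈ S, ∑ a : Fin (Summit.QuantumFields.YangMills.Theorems.EquipartitionPinsProbe.lieDim r), h p a * Y p a) *
                  (∑ p ∈ S, ∑ a : Fin (Summit.QuantumFields.YangMills.Theorems.EquipartitionPinsProbe.lieDim r),
                    Literature.MathematicalPhysics.QuantumFieldTheory.plaquetteCurl (fun e => α e a) p * Y p a) ∂τ =
                (∑ p ∈ S, ∑ a : Fin (Summit.QuantumFields.YangMills.Theorems.EquipartitionPinsProbe.lieDim r),
                    Literature.MathematicalPhysics.QuantumFieldTheory.plaquetteCurl (fun e => α e a) p * h p a) *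
                  ∫ Y, Real.cos (∑ p ∈ S, ∑ a : Fin (Summit.QuantumFields.YangMills.Theorems.EquipartitionPinsProbe.lieDim r), h p a * Y p a) ∂τ) := by
  intro G _ _ _ _ hG
  letI : MeasurableSpace G := borel G
  haveI : BorelSpace G := ⟨rfl⟩
  intro r hequi β μ hβ hμ τ hτ hweak S E h α hαE hαS
  haveI : SecondCountableTopology G :=
    (r.continuous.isClosedEmbedding r.injective).isEmbedding.secondCountableTopology
  have hcont : ∀ b : ℝ, Continuous (Summit.QuantumFields.YangMills.Theorems.EquipartitionPinsProbe.plaqField r b) := fun b =>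
    (stub_plaqFieldContinuous G r b).1
  have hmeas : ∀ b : ℝ, Measurable (Summit.QuantumFields.YangMills.Theorems.EquipartitionPinsProbe.plaqField r b) := fun b => (hcont b).measurable
  have hprob : ∀ k, MeasureTheory.IsProbabilityMeasure (μ k) := fun k => by
    obtain ⟨L, -, hP, -⟩ := hμ k
    exact hP
  set ν : ℕ → MeasureTheory.Measure (Literature.MathematicalPhysics.QuantumLattice.ZdPlaquette 4 → Fin (Summit.QuantumFields.YangMills.Theorems.EquipartitionPinsProbe.lieDim r) → ℝ) :=
    fun k => (μ k).map (Summit.QuantumFields.YangMills.Theorems.EquipartitionPinsProbe.plaqField r (β k)) with hν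
  have hνprob : ∀ k, MeasureTheory.IsProbabilityMeasure (ν k) := fun k =>
    MeasureTheory.Measure.isProbabilityMeasure_map (hmeas _).aemeasurable
  -- integrals against the laws are integrals against the states
  have hmap : ∀ (k : ℕ) (f : (Literature.MathematicalPhysics.QuantumLattice.ZdPlaquette 4 → Fin (Summit.QuantumFields.YangMills.Theorems.EquipartitionPinsProbe.lieDim r) → ℝ) → ℝ),
      Continuous f → ∫ Y, f Y ∂(ν k) = ∫ U, f (Summit.QuantumFields.YangMills.Theorems.EquipartitionPinsProbe.plaqField r (β k) U) ∂(μ k) := by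
    intro k f hf
    rw [hν, MeasureTheory.integral_map (hmeas _).aemeasurable hf.measurable.aestronglyMeasurable]
  have hweakν : ∀ f : (Literature.MathematicalPhysics.QuantumLattice.ZdPlaquette 4 → Fin (Summit.QuantumFields.YangMills.Theorems.EquipartitionPinsProbe.lieDim r) → ℝ) → ℝ, Continuous f →
      (∃ C : ℝ, ∀ Y, |f Y| ≤ C) →
      Filter.Tendsto (fun k : ℕ => ∫ Y, f Y ∂(ν k)) Filter.atTop (nhds (∫ Y, f Y ∂τ)) := by
    intro f hf hfb
    refine (hweak f hf hfb).congr' (Filter.Eventually.of_forall fun k => (hmap k f hf).symm)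
  -- uniformly bounded second moments of the laws (STUB TM) and of the tangent law (STUB T2')
  have hmomν : ∀ (p : Literature.MathematicalPhysics.QuantumLattice.ZdPlaquette 4) (a : Fin (Summit.QuantumFields.YangMills.Theorems.EquipartitionPinsProbe.lieDim r)), ∃ C : ℝ, ∀ k : ℕ,
      MeasureTheory.Integrable (fun Y => (Y p a) ^ 2) (ν k) ∧ ∫ Y, (Y p a) ^ 2 ∂(ν k) ≤ C := by
    intro p a
    obtain ⟨C, hC⟩ := stub_fieldMoments G hG r hequi β μ hβ hμ p a
    refine ⟨C, fun k => ?_⟩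
    have hg : Continuous fun Y : Literature.MathematicalPhysics.QuantumLattice.ZdPlaquette 4 → Fin (Summit.QuantumFields.YangMills.Theorems.EquipartitionPinsProbe.lieDim r) → ℝ => (Y p a) ^ 2 :=
      ((continuous_apply a).comp (continuous_apply p)).pow 2
    refine ⟨(MeasureTheory.integrable_map_measure hg.measurable.aestronglyMeasurable
      (hmeas _).aemeasurable).2 (hC k).1, ?_⟩
    rw [hmap k _ hg]
    exact (hC k).2
  have hmomτ := (stub_secondMoments G hG r hequi β μ hβ hμ τ hτ hweak).1
  obtain ⟨B, hB⟩ := hmomτ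
  refine stub_steinReduction (Summit.QuantumFields.YangMills.Theorems.EquipartitionPinsProbe.lieDim r) τ hτ (fun p a => (hB p a).1) ?_ S E h α hαE hαS
  intro S' h' e b hS'
  refine stub_steinSingleEdgeLimit (Summit.QuantumFields.YangMills.Theorems.EquipartitionPinsProbe.lieDim r) ν τ hνprob hτ hweakν hmomν ⟨B, hB⟩ S' h'
    (fun p => Literature.MathematicalPhysics.QuantumFieldTheory.plaquetteCurl (fun e' => if e' = e then (1 : ℝ) else 0) p) b ?_
  intro η hη
  have h1 := stub_steinFiniteBeta G hG r hequi e b S' h' hS' η hη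
  filter_upwards [hβ.eventually h1] with k hk
  have hk' := hk (μ k) (hμ k)
  have hlin : Continuous fun Y : Literature.MathematicalPhysics.QuantumLattice.ZdPlaquette 4 → Fin (Summit.QuantumFields.YangMills.Theorems.EquipartitionPinsProbe.lieDim r) → ℝ =>
      ∑ p ∈ S', ∑ a : Fin (Summit.QuantumFields.YangMills.Theorems.EquipartitionPinsProbe.lieDim r), h' p a * Y p a := by
    refine continuous_finsetSum _ fun p _ => continuous_finsetSum _ fun a _ => ?_
    exact continuous_const.mul ((continuous_apply a).comp (continuous_apply p))
  have hc1 : Continuous fun Y : Literature.MathematicalPhysics.QuantumLattice.ZdPlaquette 4 → Fin (Summit.QuantumFields.YangMills.Theorems.EquipartitionPinsProbe.lieDim r) → ℝ =>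
      Real.sin (∑ p ∈ S', ∑ a : Fin (Summit.QuantumFields.YangMills.Theorems.EquipartitionPinsProbe.lieDim r), h' p a * Y p a) :=
    Real.continuous_sin.comp hlin
  have hc2 : Continuous fun Y : Literature.MathematicalPhysics.QuantumLattice.ZdPlaquette 4 → Fin (Summit.QuantumFields.YangMills.Theorems.EquipartitionPinsProbe.lieDim r) → ℝ =>
      Real.cos (∑ p ∈ S', ∑ a : Fin (Summit.QuantumFields.YangMills.Theorems.EquipartitionPinsProbe.lieDim r), h' p a * Y p a) :=
    Real.continuous_cos.comp hlin
  have hc3 : Continuous fun Y : Literature.MathematicalPhysics.QuantumLattice.ZdPlaquette 4 → Fin (Summit.QuantumFields.YangMills.Theorems.EquipartitionPinsProbe.lieDim r) → ℝ =>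
      ∑ p ∈ S', Literature.MathematicalPhysics.QuantumFieldTheory.plaquetteCurl (fun e' => if e' = e then (1 : ℝ) else 0) p * Y p b :=
    continuous_finsetSum _ fun p _ => continuous_const.mul ((continuous_apply b).comp (continuous_apply p))
  have hc4 : Continuous fun Y : Literature.MathematicalPhysics.QuantumLattice.ZdPlaquette 4 → Fin (Summit.QuantumFields.YangMills.Theorems.EquipartitionPinsProbe.lieDim r) → ℝ =>
      Real.cos (∑ p ∈ S', ∑ a : Fin (Summit.QuantumFields.YangMills.Theorems.EquipartitionPinsProbe.lieDim r), h' p a * Y p a) *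
        ∑ p ∈ S', Literature.MathematicalPhysics.QuantumFieldTheory.plaquetteCurl (fun e' => if e' = e then (1 : ℝ) else 0) p * Y p b :=
    hc2.mul hc3
  have hc5 : Continuous fun Y : Literature.MathematicalPhysics.QuantumLattice.ZdPlaquette 4 → Fin (Summit.QuantumFields.YangMills.Theorems.EquipartitionPinsProbe.lieDim r) → ℝ =>
      Real.sin (∑ p ∈ S', ∑ a : Fin (Summit.QuantumFields.YangMills.Theorems.EquipartitionPinsProbe.lieDim r), h' p a * Y p a) *
        ∑ p ∈ S', Literature.MathematicalPhysics.QuantumFieldTheory.plaquetteCurl (fun e' => if e' = e then (1 : ℝ) else 0) p * Y p b :=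
    hc1.mul hc3
  rw [hmap k _ hc1, hmap k _ hc2, hmap k _ hc4, hmap k _ hc5]
  exact hk'

/-- STUB T_main — **tangent laws of the rescaled plaquette field, with `D = dim 𝔤_r`** (the
compactness half of the local free-gluon law with the number of colours pinned to the route's
`D = dim_ℝ span{X | exp(tX) ∈ r(G) ∀ t}`; THE gauge-theory stub, crux-sized — see the lead's Census):
uniform equipartition ⇒ for all sequences `β_k → ∞`, `μ_k ∈ infiniteVolumeLimitPoints r.ρ β_k`,
there are a subsequence `φ` and a probability measure `τ` on `ZdPlaquette 4 → Fin D → ℝ` with (T0)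
f.d.d. convergence of the rescaled plaquette energies to `½|Y_p|²`, (T1) a.s. closedness, (T2) the
uniform second-moment bound and the budget `∑_{i<j}∑_a E(Y^a_{(0;i,j)})² ≤ 3D`, (T3) the
trigonometric Stein identity. Assets: the exponential chart of `r(G)`
(`Literature.Analysis.Calculus.exists_exp_chart_range`, the sibling crux's `expChart` package),
translation structure of limit points (`map_configShift_mem_infiniteVolumeLimitPoints`), the
one-link Haar shift (p108068). -/
theorem stub_tangentCore :
    ∀ (G : Type) [Group G] [TopologicalSpace G] [IsTopologicalGroup G] [CompactSpace G],
      Literature.MathematicalPhysics.QuantumFieldTheory.IsCompactSimpleLieGroup G →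
      letI : MeasurableSpace G := borel G
      haveI : BorelSpace G := ⟨rfl⟩
      ∀ r : Literature.MathematicalPhysics.QuantumFieldTheory.LatticeRep G,
        (∀ ε : ℝ, 0 < ε → ∀ᶠ β : ℝ in Filter.atTop,
          ∀ μ ∈ Literature.MathematicalPhysics.QuantumLattice.infiniteVolumeLimitPoints
              (d := 4) r.ρ β,
            |β * (∫ U, (∑ i : Fin 4, ∑ j : Fin 4,
                if i < j then ((r.N : ℝ) -
                  Literature.MathematicalPhysics.QuantumLattice.plaquetteObs r.ρ 0 i j U) else 0) ∂μ) -
              3 * (Module.finrank ℝ ↥(Submodule.span ℝ {X : Matrix (Fin r.N) (Fin r.N) ℂ |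
                ∀ t : ℝ, NormedSpace.exp ((t : ℂ) • X) ∈ Set.range r.ρ}) : ℝ) / 2| < ε) →
        ∀ (β : ℕ → ℝ)
            (μ : ℕ → MeasureTheory.Measure (Literature.MathematicalPhysics.QuantumLattice.LGConfig 4 G)),
            Filter.Tendsto β Filter.atTop Filter.atTop →
            (∀ k, μ k ∈ Literature.MathematicalPhysics.QuantumLattice.infiniteVolumeLimitPoints
              (d := 4) r.ρ (β k)) →
            ∃ (φ : ℕ → ℕ) (τ : MeasureTheory.Measure
                (Literature.MathematicalPhysics.QuantumLattice.ZdPlaquette 4 → Fin (Module.finrank ℝ ↥(Submodule.span ℝ {X : Matrix (Fin r.N) (Fin r.N) ℂ | ∀ t : ℝ, NormedSpace.exp ((t : ℂ) • X) ∈ Set.range r.ρ})) → ℝ)),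
              StrictMono φ ∧ MeasureTheory.IsProbabilityMeasure τ ∧
              -- (T0) joint laws of rescaled plaquette energies converge along `φ`
              (∀ (m : ℕ) (p : Fin m → Literature.MathematicalPhysics.QuantumLattice.ZdPlaquette 4)
                  (f : (Fin m → ℝ) → ℝ), Continuous f → (∃ C : ℝ, ∀ v, |f v| ≤ C) →
                Filter.Tendsto (fun j : ℕ => ∫ U, f (fun i => β (φ j) * ((r.N : ℝ) -
                    Literature.MathematicalPhysics.QuantumLattice.plaquetteObs r.ρ
                      (p i).1 (p i).2.1.1 (p i).2.1.2 U)) ∂(μ (φ j)))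
                  Filter.atTop
                  (nhds (∫ Y, f (fun i => (1 / 2 : ℝ) * ∑ a : Fin (Module.finrank ℝ ↥(Submodule.span ℝ {X : Matrix (Fin r.N) (Fin r.N) ℂ | ∀ t : ℝ, NormedSpace.exp ((t : ℂ) • X) ∈ Set.range r.ρ})), (Y (p i) a) ^ 2) ∂τ))) ∧
              -- (T1) `τ` is supported on closed 2-cochains
              (∀ (x : Literature.Probability.LatticeModels.Site 4) (i j k : Fin 4)
                  (hij : i < j) (hjk : j < k) (a : Fin (Module.finrank ℝ ↥(Submodule.span ℝ {X : Matrix (Fin r.N) (Fin r.N) ℂ | ∀ t : ℝ, NormedSpace.exp ((t : ℂ) • X) ∈ Set.range r.ρ}))),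
                ∀ᵐ Y ∂τ,
                  (Y (x + Pi.single i 1, ⟨(j, k), hjk⟩) a - Y (x, ⟨(j, k), hjk⟩) a) -
                    (Y (x + Pi.single j 1, ⟨(i, k), hij.trans hjk⟩) a -
                      Y (x, ⟨(i, k), hij.trans hjk⟩) a) +
                    (Y (x + Pi.single k 1, ⟨(i, j), hij⟩) a - Y (x, ⟨(i, j), hij⟩) a) = 0) ∧
              -- (T2) second moments: uniform bound and the equipartition budget at the origin
              ((∃ B : ℝ, ∀ (p : Literature.MathematicalPhysics.QuantumLattice.ZdPlaquette 4)
                  (a : Fin (Module.finrank ℝ ↥(Submodule.span ℝ {X : Matrix (Fin r.N) (Fin r.N) ℂ | ∀ t : ℝ, NormedSpace.exp ((t : ℂ) • X) ∈ Set.range r.ρ}))),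
                  MeasureTheory.Integrable (fun Y => (Y p a) ^ 2) τ ∧ ∫ Y, (Y p a) ^ 2 ∂τ ≤ B) ∧
                (∑ i : Fin 4, ∑ j : Fin 4, ∑ a : Fin (Module.finrank ℝ ↥(Submodule.span ℝ {X : Matrix (Fin r.N) (Fin r.N) ℂ | ∀ t : ℝ, NormedSpace.exp ((t : ℂ) • X) ∈ Set.range r.ρ})),
                  if hij : i < j then ∫ Y, (Y ((0 : Literature.Probability.LatticeModels.Site 4),
                    ⟨(i, j), hij⟩) a) ^ 2 ∂τ else 0) ≤ 3 * (Module.finrank ℝ ↥(Submodule.span ℝ {X : Matrix (Fin r.N) (Fin r.N) ℂ | ∀ t : ℝ, NormedSpace.exp ((t : ℂ) • X) ∈ Set.range r.ρ}) : ℝ)) ∧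
              -- (T3) the Stein (linearised Schwinger–Dyson) identity, trigonometric form
              (∀ (S : Finset (Literature.MathematicalPhysics.QuantumLattice.ZdPlaquette 4))
                  (E : Finset (Literature.MathematicalPhysics.QuantumLattice.ZdEdge 4))
                  (h : Literature.MathematicalPhysics.QuantumLattice.ZdPlaquette 4 → Fin (Module.finrank ℝ ↥(Submodule.span ℝ {X : Matrix (Fin r.N) (Fin r.N) ℂ | ∀ t : ℝ, NormedSpace.exp ((t : ℂ) • X) ∈ Set.range r.ρ})) → ℝ)
                  (α : Literature.MathematicalPhysics.QuantumLattice.ZdEdge 4 → Fin (Module.finrank ℝ ↥(Submodule.span ℝ {X : Matrix (Fin r.N) (Fin r.N) ℂ | ∀ t : ℝ, NormedSpace.exp ((t : ℂ) • X) ∈ Set.range r.ρ})) → ℝ),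
                (∀ e, e ∉ E → α e = 0) →
                (∀ p, p ∉ S → ∀ a : Fin (Module.finrank ℝ ↥(Submodule.span ℝ {X : Matrix (Fin r.N) (Fin r.N) ℂ | ∀ t : ℝ, NormedSpace.exp ((t : ℂ) • X) ∈ Set.range r.ρ})),
                  Literature.MathematicalPhysics.QuantumFieldTheory.plaquetteCurl
                    (fun e => α e a) p = 0) →
                (∫ Y, Real.cos (∑ p ∈ S, ∑ a : Fin (Module.finrank ℝ ↥(Submodule.span ℝ {X : Matrix (Fin r.N) (Fin r.N) ℂ | ∀ t : ℝ, NormedSpace.exp ((t : ℂ) • X) ∈ Set.range r.ρ})), h p a * Y p a) *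
                    (∑ p ∈ S, ∑ a : Fin (Module.finrank ℝ ↥(Submodule.span ℝ {X : Matrix (Fin r.N) (Fin r.N) ℂ | ∀ t : ℝ, NormedSpace.exp ((t : ℂ) • X) ∈ Set.range r.ρ})),
                      Literature.MathematicalPhysics.QuantumFieldTheory.plaquetteCurl
                        (fun e => α e a) p * Y p a) ∂τ =
                  -(∑ p ∈ S, ∑ a : Fin (Module.finrank ℝ ↥(Submodule.span ℝ {X : Matrix (Fin r.N) (Fin r.N) ℂ | ∀ t : ℝ, NormedSpace.exp ((t : ℂ) • X) ∈ Set.range r.ρ})),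
                      Literature.MathematicalPhysics.QuantumFieldTheory.plaquetteCurl
                        (fun e => α e a) p * h p a) *
                    ∫ Y, Real.sin (∑ p ∈ S, ∑ a : Fin (Module.finrank ℝ ↥(Submodule.span ℝ {X : Matrix (Fin r.N) (Fin r.N) ℂ | ∀ t : ℝ, NormedSpace.exp ((t : ℂ) • X) ∈ Set.range r.ρ})), h p a * Y p a) ∂τ) ∧
                (∫ Y, Real.sin (∑ p ∈ S, ∑ a : Fin (Module.finrank ℝ ↥(Submodule.span ℝ {X : Matrix (Fin r.N) (Fin r.N) ℂ | ∀ t : ℝ, NormedSpace.exp ((t : ℂ) • X) ∈ Set.range r.ρ})), h p a * Y p a) *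
                    (∑ p ∈ S, ∑ a : Fin (Module.finrank ℝ ↥(Submodule.span ℝ {X : Matrix (Fin r.N) (Fin r.N) ℂ | ∀ t : ℝ, NormedSpace.exp ((t : ℂ) • X) ∈ Set.range r.ρ})),
                      Literature.MathematicalPhysics.QuantumFieldTheory.plaquetteCurl
                        (fun e => α e a) p * Y p a) ∂τ =
                  (∑ p ∈ S, ∑ a : Fin (Module.finrank ℝ ↥(Submodule.span ℝ {X : Matrix (Fin r.N) (Fin r.N) ℂ | ∀ t : ℝ, NormedSpace.exp ((t : ℂ) • X) ∈ Set.range r.ρ})),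
                      Literature.MathematicalPhysics.QuantumFieldTheory.plaquetteCurl
                        (fun e => α e a) p * h p a) *
                    ∫ Y, Real.cos (∑ p ∈ S, ∑ a : Fin (Module.finrank ℝ ↥(Submodule.span ℝ {X : Matrix (Fin r.N) (Fin r.N) ℂ | ∀ t : ℝ, NormedSpace.exp ((t : ℂ) • X) ∈ Set.range r.ρ})), h p a * Y p a) ∂τ))  := by
  intro G _ _ _ _ hG
  letI : MeasurableSpace G := borel G
  haveI : BorelSpace G := ⟨rfl⟩
  intro r hequi β μ hβ hμ
  haveI : SecondCountableTopology G :=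
    (r.continuous.isClosedEmbedding r.injective).isEmbedding.secondCountableTopology
  -- the rescaled plaquette field `Y^β = dA^β` (comb gauge) and its laws
  have hcont : ∀ b : ℝ, Continuous (Summit.QuantumFields.YangMills.Theorems.EquipartitionPinsProbe.plaqField r b) := fun b =>
    (stub_plaqFieldContinuous G r b).1
  have hmeas : ∀ b : ℝ, Measurable (Summit.QuantumFields.YangMills.Theorems.EquipartitionPinsProbe.plaqField r b) := fun b => (hcont b).measurable
  have hprob : ∀ k, MeasureTheory.IsProbabilityMeasure (μ k) := fun k => by
    obtain ⟨L, -, hP, -⟩ := hμ k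
    exact hP
  set ν : ℕ → MeasureTheory.Measure (Literature.MathematicalPhysics.QuantumLattice.ZdPlaquette 4 → Fin (Summit.QuantumFields.YangMills.Theorems.EquipartitionPinsProbe.lieDim r) → ℝ) :=
    fun k => (μ k).map (Summit.QuantumFields.YangMills.Theorems.EquipartitionPinsProbe.plaqField r (β k)) with hν
  have hνprob : ∀ k, MeasureTheory.IsProbabilityMeasure (ν k) := fun k =>
    MeasureTheory.Measure.isProbabilityMeasure_map (hmeas _).aemeasurable
  -- uniformly bounded second moments (STUB TM), transported to the laws
  have hmom : ∀ (p : Literature.MathematicalPhysics.QuantumLattice.ZdPlaquette 4) (a : Fin (Summit.QuantumFields.YangMills.Theorems.EquipartitionPinsProbe.lieDim r)), ∃ C : ℝ, ∀ k : ℕ,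
      MeasureTheory.Integrable (fun Y => (Y p a) ^ 2) (ν k) ∧ ∫ Y, (Y p a) ^ 2 ∂(ν k) ≤ C := by
    intro p a
    obtain ⟨C, hC⟩ := stub_fieldMoments G hG r hequi β μ hβ hμ p a
    refine ⟨C, fun k => ?_⟩
    have hg : Continuous fun Y : Literature.MathematicalPhysics.QuantumLattice.ZdPlaquette 4 → Fin (Summit.QuantumFields.YangMills.Theorems.EquipartitionPinsProbe.lieDim r) → ℝ => (Y p a) ^ 2 :=
      ((continuous_apply a).comp (continuous_apply p)).pow 2
    refine ⟨(MeasureTheory.integrable_map_measure hg.measurable.aestronglyMeasurable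
      (hmeas _).aemeasurable).2 (hC k).1, ?_⟩
    rw [hν, MeasureTheory.integral_map (hmeas _).aemeasurable hg.measurable.aestronglyMeasurable]
    exact (hC k).2
  -- extraction of a tangent law (STUB TX)
  obtain ⟨φ, τ, hφ, hτ, hweak⟩ := stub_extraction (Summit.QuantumFields.YangMills.Theorems.EquipartitionPinsProbe.lieDim r) ν hνprob hmom
  have hβφ : Filter.Tendsto (β ∘ φ) Filter.atTop Filter.atTop := hβ.comp hφ.tendsto_atTop
  have hμφ : ∀ k, (μ ∘ φ) k ∈ Literature.MathematicalPhysics.QuantumLattice.infiniteVolumeLimitPoints (d := 4) r.ρ ((β ∘ φ) k) :=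
    fun k => hμ (φ k)
  -- weak convergence read on the configurations
  have hweakμ : ∀ f : (Literature.MathematicalPhysics.QuantumLattice.ZdPlaquette 4 → Fin (Summit.QuantumFields.YangMills.Theorems.EquipartitionPinsProbe.lieDim r) → ℝ) → ℝ, Continuous f →
      (∃ C : ℝ, ∀ Y, |f Y| ≤ C) →
      Filter.Tendsto (fun k : ℕ => ∫ U, f (Summit.QuantumFields.YangMills.Theorems.EquipartitionPinsProbe.plaqField r ((β ∘ φ) k) U) ∂((μ ∘ φ) k))
        Filter.atTop (nhds (∫ Y, f Y ∂τ)) := by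
    intro f hf hfb
    have h := hweak f hf hfb
    refine h.congr' (Filter.Eventually.of_forall fun k => ?_)
    show ∫ Y, f Y ∂((μ (φ k)).map (Summit.QuantumFields.YangMills.Theorems.EquipartitionPinsProbe.plaqField r (β (φ k)))) = _
    rw [MeasureTheory.integral_map (hmeas _).aemeasurable hf.measurable.aestronglyMeasurable]
    rfl
  refine ⟨φ, τ, hφ, hτ, ?_, ?_, ?_, ?_⟩
  · -- (T0): STUB T0' + weak convergence
    intro m p f hf hfb
    obtain ⟨C, hC⟩ := hfb
    have hF : Continuous fun Y : Literature.MathematicalPhysics.QuantumLattice.ZdPlaquette 4 → Fin (Summit.QuantumFields.YangMills.Theorems.EquipartitionPinsProbe.lieDim r) → ℝ =>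
        f (fun i => (1 / 2 : ℝ) * ∑ a : Fin (Summit.QuantumFields.YangMills.Theorems.EquipartitionPinsProbe.lieDim r), (Y (p i) a) ^ 2) := by
      refine hf.comp (continuous_pi fun i => continuous_const.mul ?_)
      exact continuous_finsetSum _ fun a _ => ((continuous_apply a).comp (continuous_apply (p i))).pow 2
    have hlim := hweakμ _ hF ⟨C, fun Y => hC _⟩
    refine hlim.congr_dist ?_
    rw [Metric.tendsto_nhds]
    intro ε hε
    have hev := (stub_energyLaw G hG r hequi m p f hf ⟨C, hC⟩ ε hε)
    filter_upwards [hβφ.eventually hev] with k hk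
    rw [Real.dist_0_eq_abs, abs_of_nonneg dist_nonneg, Real.dist_eq, abs_sub_comm]
    simpa using hk _ (hμφ k)
  · -- (T1): `Y^β = dA^β` is closed for every configuration (STUB TK) and closedness passes to the
    -- limit (STUB TW)
    intro x i j k hij hjk a
    refine stub_closedLimit (Summit.QuantumFields.YangMills.Theorems.EquipartitionPinsProbe.lieDim r) (ν ∘ φ) τ (fun n => hνprob _) hτ hweak x i j k hij hjk a
      fun n => ?_
    show ∀ᵐ Y ∂((μ (φ n)).map (Summit.QuantumFields.YangMills.Theorems.EquipartitionPinsProbe.plaqField r (β (φ n)))), _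
    refine (MeasureTheory.ae_map_iff (hmeas _).aemeasurable ?_).2 (MeasureTheory.ae_of_all _ fun U => ?_)
    · refine (isClosed_eq ?_ continuous_const).measurableSet
      fun_prop
    · exact stub_curlClosed (fun e => Summit.QuantumFields.YangMills.Theorems.EquipartitionPinsProbe.linkField r (β (φ n)) U e a) x i j k hij hjk
  · -- (T2): STUB T2'
    exact stub_secondMoments G hG r hequi (β ∘ φ) (μ ∘ φ) hβφ hμφ τ hτ hweakμ
  · -- (T3): STUB T3'
    exact stub_steinLimit G hG r hequi (β ∘ φ) (μ ∘ φ) hβφ hμφ τ hτ hweakμ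


/-- STUB T (now a theorem of the skeleton) — **tangent laws exist**, from STUB T_a (`stub_liePos`,
`0 < dim 𝔤_r`) and STUB T_main (`stub_tangentCore`). -/
theorem stub_tangent :
    ∀ (G : Type) [Group G] [TopologicalSpace G] [IsTopologicalGroup G] [CompactSpace G],
      Literature.MathematicalPhysics.QuantumFieldTheory.IsCompactSimpleLieGroup G →
      letI : MeasurableSpace G := borel G
      haveI : BorelSpace G := ⟨rfl⟩
      ∀ r : Literature.MathematicalPhysics.QuantumFieldTheory.LatticeRep G,
        (∀ ε : ℝ, 0 < ε → ∀ᶠ β : ℝ in Filter.atTop,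
          ∀ μ ∈ Literature.MathematicalPhysics.QuantumLattice.infiniteVolumeLimitPoints
              (d := 4) r.ρ β,
            |β * (∫ U, (∑ i : Fin 4, ∑ j : Fin 4,
                if i < j then ((r.N : ℝ) -
                  Literature.MathematicalPhysics.QuantumLattice.plaquetteObs r.ρ 0 i j U) else 0) ∂μ) -
              3 * (Module.finrank ℝ ↥(Submodule.span ℝ {X : Matrix (Fin r.N) (Fin r.N) ℂ |
                ∀ t : ℝ, NormedSpace.exp ((t : ℂ) • X) ∈ Set.range r.ρ}) : ℝ) / 2| < ε) →
        ∃ D : ℕ, 0 < D ∧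
          ∀ (β : ℕ → ℝ)
            (μ : ℕ → MeasureTheory.Measure (Literature.MathematicalPhysics.QuantumLattice.LGConfig 4 G)),
            Filter.Tendsto β Filter.atTop Filter.atTop →
            (∀ k, μ k ∈ Literature.MathematicalPhysics.QuantumLattice.infiniteVolumeLimitPoints
              (d := 4) r.ρ (β k)) →
            ∃ (φ : ℕ → ℕ) (τ : MeasureTheory.Measure
                (Literature.MathematicalPhysics.QuantumLattice.ZdPlaquette 4 → Fin D → ℝ)),
              StrictMono φ ∧ MeasureTheory.IsProbabilityMeasure τ ∧
              -- (T0) joint laws of rescaled plaquette energies converge along `φ`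
              (∀ (m : ℕ) (p : Fin m → Literature.MathematicalPhysics.QuantumLattice.ZdPlaquette 4)
                  (f : (Fin m → ℝ) → ℝ), Continuous f → (∃ C : ℝ, ∀ v, |f v| ≤ C) →
                Filter.Tendsto (fun j : ℕ => ∫ U, f (fun i => β (φ j) * ((r.N : ℝ) -
                    Literature.MathematicalPhysics.QuantumLattice.plaquetteObs r.ρ
                      (p i).1 (p i).2.1.1 (p i).2.1.2 U)) ∂(μ (φ j)))
                  Filter.atTop
                  (nhds (∫ Y, f (fun i => (1 / 2 : ℝ) * ∑ a : Fin D, (Y (p i) a) ^ 2) ∂τ))) ∧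
              -- (T1) `τ` is supported on closed 2-cochains
              (∀ (x : Literature.Probability.LatticeModels.Site 4) (i j k : Fin 4)
                  (hij : i < j) (hjk : j < k) (a : Fin D),
                ∀ᵐ Y ∂τ,
                  (Y (x + Pi.single i 1, ⟨(j, k), hjk⟩) a - Y (x, ⟨(j, k), hjk⟩) a) -
                    (Y (x + Pi.single j 1, ⟨(i, k), hij.trans hjk⟩) a -
                      Y (x, ⟨(i, k), hij.trans hjk⟩) a) +
                    (Y (x + Pi.single k 1, ⟨(i, j), hij⟩) a - Y (x, ⟨(i, j), hij⟩) a) = 0) ∧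
              -- (T2) second moments: uniform bound and the equipartition budget at the origin
              ((∃ B : ℝ, ∀ (p : Literature.MathematicalPhysics.QuantumLattice.ZdPlaquette 4)
                  (a : Fin D),
                  MeasureTheory.Integrable (fun Y => (Y p a) ^ 2) τ ∧ ∫ Y, (Y p a) ^ 2 ∂τ ≤ B) ∧
                (∑ i : Fin 4, ∑ j : Fin 4, ∑ a : Fin D,
                  if hij : i < j then ∫ Y, (Y ((0 : Literature.Probability.LatticeModels.Site 4),
                    ⟨(i, j), hij⟩) a) ^ 2 ∂τ else 0) ≤ 3 * D) ∧
              -- (T3) the Stein (linearised Schwinger–Dyson) identity, trigonometric form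
              (∀ (S : Finset (Literature.MathematicalPhysics.QuantumLattice.ZdPlaquette 4))
                  (E : Finset (Literature.MathematicalPhysics.QuantumLattice.ZdEdge 4))
                  (h : Literature.MathematicalPhysics.QuantumLattice.ZdPlaquette 4 → Fin D → ℝ)
                  (α : Literature.MathematicalPhysics.QuantumLattice.ZdEdge 4 → Fin D → ℝ),
                (∀ e, e ∉ E → α e = 0) →
                (∀ p, p ∉ S → ∀ a : Fin D,
                  Literature.MathematicalPhysics.QuantumFieldTheory.plaquetteCurl
                    (fun e => α e a) p = 0) →
                (∫ Y, Real.cos (∑ p ∈ S, ∑ a : Fin D, h p a * Y p a) *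
                    (∑ p ∈ S, ∑ a : Fin D,
                      Literature.MathematicalPhysics.QuantumFieldTheory.plaquetteCurl
                        (fun e => α e a) p * Y p a) ∂τ =
                  -(∑ p ∈ S, ∑ a : Fin D,
                      Literature.MathematicalPhysics.QuantumFieldTheory.plaquetteCurl
                        (fun e => α e a) p * h p a) *
                    ∫ Y, Real.sin (∑ p ∈ S, ∑ a : Fin D, h p a * Y p a) ∂τ) ∧
                (∫ Y, Real.sin (∑ p ∈ S, ∑ a : Fin D, h p a * Y p a) *
                    (∑ p ∈ S, ∑ a : Fin D,
                      Literature.MathematicalPhysics.QuantumFieldTheory.plaquetteCurl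
                        (fun e => α e a) p * Y p a) ∂τ =
                  (∑ p ∈ S, ∑ a : Fin D,
                      Literature.MathematicalPhysics.QuantumFieldTheory.plaquetteCurl
                        (fun e => α e a) p * h p a) *
                    ∫ Y, Real.cos (∑ p ∈ S, ∑ a : Fin D, h p a * Y p a) ∂τ)) := by
  intro G _ _ _ _ hG
  letI : MeasurableSpace G := borel G
  haveI : BorelSpace G := ⟨rfl⟩
  intro r hequi
  exact ⟨_, stub_liePos G hG r, stub_tangentCore G hG r hequi⟩

/-- STUB K1 (LANDED p110317) — **the curvature kernel fixes exact forms** (`d* T = d*`, `T = d(−Δ)⁻¹d*` the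
two-plaquette kernel `curvatureTwoPoint`): for every edge `e = (x, i)` and plaquette `p`,
`∑_{q ∋ e} [q : e] T(q, p) = [p : e]`, the incidence number of `e` in `∂p`. (Hodge identity
`d*d = −Δ − dd*` on 1-forms, the Poisson identity `(−Δ)(latticeGreen/2) = δ₀`
(`latticeLaplacianZd_half_latticeGreen`), and `d*((−Δ)⁻¹d* δ_p) = 0` by telescoping.) -/
theorem stub_kernelExact :
    ∀ (x : Literature.Probability.LatticeModels.Site 4) (i : Fin 4)
      (p : Literature.MathematicalPhysics.QuantumLattice.ZdPlaquette 4),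
      (∑ j : Fin 4,
        if hij : i < j then
          (Literature.MathematicalPhysics.QuantumFieldTheory.curvatureTwoPoint (x, ⟨(i, j), hij⟩) p -
            Literature.MathematicalPhysics.QuantumFieldTheory.curvatureTwoPoint
              (x - Pi.single j 1, ⟨(i, j), hij⟩) p)
        else if hji : j < i then
          (Literature.MathematicalPhysics.QuantumFieldTheory.curvatureTwoPoint
              (x - Pi.single j 1, ⟨(j, i), hji⟩) p -
            Literature.MathematicalPhysics.QuantumFieldTheory.curvatureTwoPoint (x, ⟨(j, i), hji⟩) p)
        else 0) =
      Literature.MathematicalPhysics.QuantumFieldTheory.plaquetteCurl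
        (fun e => if e = (x, i) then (1 : ℝ) else 0) p :=
  Summit.QuantumFields.YangMills.Theorems.EquipartitionPinsProbe.stub_kernelExact

/-- STUB K2 (LANDED p109912) — **the curvature kernel is closed in each slot** (`d T = 0`): for every 3-cell
`(x; i<j<k)` and plaquette `q`, `∂ᵢT((·;j,k), q) − ∂ⱼT((·;i,k), q) + ∂ₖT((·;i,j), q) = 0` at `x`
(`T(·, q) = d(…)` by `curvatureTwoPoint_eq_plaquetteCurl`, and `d ∘ d = 0`). -/
theorem stub_kernelClosed :
    ∀ (q : Literature.MathematicalPhysics.QuantumLattice.ZdPlaquette 4)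
      (x : Literature.Probability.LatticeModels.Site 4) (i j k : Fin 4) (hij : i < j) (hjk : j < k),
      (Literature.MathematicalPhysics.QuantumFieldTheory.curvatureTwoPoint
            (x + Pi.single i 1, ⟨(j, k), hjk⟩) q -
          Literature.MathematicalPhysics.QuantumFieldTheory.curvatureTwoPoint (x, ⟨(j, k), hjk⟩) q) -
        (Literature.MathematicalPhysics.QuantumFieldTheory.curvatureTwoPoint
            (x + Pi.single j 1, ⟨(i, k), hij.trans hjk⟩) q -
          Literature.MathematicalPhysics.QuantumFieldTheory.curvatureTwoPoint
            (x, ⟨(i, k), hij.trans hjk⟩) q) +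
        (Literature.MathematicalPhysics.QuantumFieldTheory.curvatureTwoPoint
            (x + Pi.single k 1, ⟨(i, j), hij⟩) q -
          Literature.MathematicalPhysics.QuantumFieldTheory.curvatureTwoPoint (x, ⟨(i, j), hij⟩) q) =
      0 :=
  Summit.QuantumFields.YangMills.Theorems.EquipartitionPinsProbe.stub_kernelClosed

/-- STUB K3 (LANDED p110629) — **the curvature kernel decays**: `T(p, q + v) → 0` as `v → ∞` in `ℤ⁴` (each entry is a
finite signed sum of values of `latticeGreen`, and `latticeGreen x = a₄|x|⁻² + O(|x|⁻⁴)`,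
`latticeGreen_asymptotics`). -/
theorem stub_kernelDecay :
    ∀ (p q : Literature.MathematicalPhysics.QuantumLattice.ZdPlaquette 4),
      Filter.Tendsto (fun v : Literature.Probability.LatticeModels.Site 4 =>
          Literature.MathematicalPhysics.QuantumFieldTheory.curvatureTwoPoint p (q.1 + v, q.2))
        Filter.cofinite (nhds 0) :=
  Summit.QuantumFields.YangMills.Theorems.EquipartitionPinsProbe.stub_kernelDecay

/-- STUB H (LANDED p110812) — **Hodge identity on 2-cochains of `ℤ⁴`**: a 2-cochain `c` that is co-closed
(`(d*c)(x,i) = ∑_{j>i} (c(x;i,j) − c(x−eⱼ;i,j)) + ∑_{j<i} (c(x−eⱼ;j,i) − c(x;j,i)) = 0`) and closed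
(`∂ᵢc_{jk} − ∂ⱼc_{ik} + ∂ₖc_{ij} = 0`) has harmonic components: `Δ c_{(·;i,j)} = 0`
(`dd* + d*d = −Δ` componentwise). -/
theorem stub_hodge :
    ∀ (c : Literature.MathematicalPhysics.QuantumLattice.ZdPlaquette 4 → ℝ),
      (∀ (x : Literature.Probability.LatticeModels.Site 4) (i : Fin 4),
        (∑ j : Fin 4,
          if hij : i < j then (c (x, ⟨(i, j), hij⟩) - c (x - Pi.single j 1, ⟨(i, j), hij⟩))
          else if hji : j < i then (c (x - Pi.single j 1, ⟨(j, i), hji⟩) - c (x, ⟨(j, i), hji⟩))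
          else 0) = 0) →
      (∀ (x : Literature.Probability.LatticeModels.Site 4) (i j k : Fin 4) (hij : i < j) (hjk : j < k),
        (c (x + Pi.single i 1, ⟨(j, k), hjk⟩) - c (x, ⟨(j, k), hjk⟩)) -
          (c (x + Pi.single j 1, ⟨(i, k), hij.trans hjk⟩) - c (x, ⟨(i, k), hij.trans hjk⟩)) +
          (c (x + Pi.single k 1, ⟨(i, j), hij⟩) - c (x, ⟨(i, j), hij⟩)) = 0) →
      ∀ (i j : Fin 4) (hij : i < j) (x : Literature.Probability.LatticeModels.Site 4),
        Literature.Probability.LatticeModels.latticeLaplacianZd (fun y => c (y, ⟨(i, j), hij⟩)) x = 0 :=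
  Summit.QuantumFields.YangMills.Theorems.EquipartitionPinsProbe.stub_hodge

/-- STUB L (LANDED p111448) — **Liouville on `ℤᵈ`**: a bounded harmonic function (`latticeLaplacianZd u = 0`) is
constant (maximum principle for the bounded harmonic difference `u(· + eᵢ) − u` at a maximising
sequence, by compactness of `[−B, B]^{ℤᵈ}`). -/
theorem stub_liouville :
    ∀ (d : ℕ) (u : Literature.Probability.LatticeModels.Site d → ℝ),
      (∃ B : ℝ, ∀ x, |u x| ≤ B) →
      (∀ x, Literature.Probability.LatticeModels.latticeLaplacianZd u x = 0) →
      ∀ x y, u x = u y :=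
  Summit.QuantumFields.YangMills.Theorems.EquipartitionPinsProbe.stub_liouville

/-- STUB R1 (LANDED p112456) — **the Stein flow along exact directions**: for a probability measure `τ` on
`ℝ^D`-valued 2-cochains with integrable coordinates and the trigonometric Stein identity (T3), the
characteristic functional transforms along `h ↦ h + dα` (`dα = plaquetteCurl α`, finitely supported)
by the Gaussian factor: `E cos⟨Y, h + dα⟩ = e^{−⟨dα,h⟩ − ½‖dα‖²} E cos⟨Y,h⟩`, same for `sin`
(differentiate `t ↦ E cos⟨Y, h + t dα⟩` under the integral sign, use (T3) at `h + t dα` to get the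
linear ODE `y' = −(⟨dα,h⟩ + t‖dα‖²) y`, and integrate). -/
theorem stub_steinFlow :
    ∀ (D : ℕ) (τ : MeasureTheory.Measure
        (Literature.MathematicalPhysics.QuantumLattice.ZdPlaquette 4 → Fin D → ℝ)),
      MeasureTheory.IsProbabilityMeasure τ →
      (∀ (p : Literature.MathematicalPhysics.QuantumLattice.ZdPlaquette 4) (a : Fin D),
        MeasureTheory.Integrable (fun Y : Literature.MathematicalPhysics.QuantumLattice.ZdPlaquette 4 → Fin D → ℝ => Y p a) τ) →
      (∀ (S : Finset (Literature.MathematicalPhysics.QuantumLattice.ZdPlaquette 4))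
          (E : Finset (Literature.MathematicalPhysics.QuantumLattice.ZdEdge 4))
          (h : Literature.MathematicalPhysics.QuantumLattice.ZdPlaquette 4 → Fin D → ℝ)
          (α : Literature.MathematicalPhysics.QuantumLattice.ZdEdge 4 → Fin D → ℝ),
        (∀ e, e ∉ E → α e = 0) →
        (∀ p, p ∉ S → ∀ a : Fin D,
          Literature.MathematicalPhysics.QuantumFieldTheory.plaquetteCurl (fun e => α e a) p = 0) →
        (∫ Y, Real.cos (∑ p ∈ S, ∑ a : Fin D, h p a * Y p a) *
            (∑ p ∈ S, ∑ a : Fin D,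
              Literature.MathematicalPhysics.QuantumFieldTheory.plaquetteCurl
                (fun e => α e a) p * Y p a) ∂τ =
          -(∑ p ∈ S, ∑ a : Fin D,
              Literature.MathematicalPhysics.QuantumFieldTheory.plaquetteCurl
                (fun e => α e a) p * h p a) *
            ∫ Y, Real.sin (∑ p ∈ S, ∑ a : Fin D, h p a * Y p a) ∂τ) ∧
        (∫ Y, Real.sin (∑ p ∈ S, ∑ a : Fin D, h p a * Y p a) *
            (∑ p ∈ S, ∑ a : Fin D,
              Literature.MathematicalPhysics.QuantumFieldTheory.plaquetteCurl
                (fun e => α e a) p * Y p a) ∂τ =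
          (∑ p ∈ S, ∑ a : Fin D,
              Literature.MathematicalPhysics.QuantumFieldTheory.plaquetteCurl
                (fun e => α e a) p * h p a) *
            ∫ Y, Real.cos (∑ p ∈ S, ∑ a : Fin D, h p a * Y p a) ∂τ)) →
      ∀ (S : Finset (Literature.MathematicalPhysics.QuantumLattice.ZdPlaquette 4))
          (E : Finset (Literature.MathematicalPhysics.QuantumLattice.ZdEdge 4))
          (h : Literature.MathematicalPhysics.QuantumLattice.ZdPlaquette 4 → Fin D → ℝ)
          (α : Literature.MathematicalPhysics.QuantumLattice.ZdEdge 4 → Fin D → ℝ),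
        (∀ e, e ∉ E → α e = 0) →
        (∀ p, p ∉ S → ∀ a : Fin D,
          Literature.MathematicalPhysics.QuantumFieldTheory.plaquetteCurl (fun e => α e a) p = 0) →
        (∫ Y, Real.cos (∑ p ∈ S, ∑ a : Fin D,
            (h p a + Literature.MathematicalPhysics.QuantumFieldTheory.plaquetteCurl (fun e => α e a) p) * Y p a) ∂τ =
          Real.exp (-(∑ p ∈ S, ∑ a : Fin D,
                Literature.MathematicalPhysics.QuantumFieldTheory.plaquetteCurl (fun e => α e a) p * h p a) -
              (∑ p ∈ S, ∑ a : Fin D,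
                (Literature.MathematicalPhysics.QuantumFieldTheory.plaquetteCurl (fun e => α e a) p) ^ 2) / 2) *
            ∫ Y, Real.cos (∑ p ∈ S, ∑ a : Fin D, h p a * Y p a) ∂τ) ∧
        (∫ Y, Real.sin (∑ p ∈ S, ∑ a : Fin D,
            (h p a + Literature.MathematicalPhysics.QuantumFieldTheory.plaquetteCurl (fun e => α e a) p) * Y p a) ∂τ =
          Real.exp (-(∑ p ∈ S, ∑ a : Fin D,
                Literature.MathematicalPhysics.QuantumFieldTheory.plaquetteCurl (fun e => α e a) p * h p a) -
              (∑ p ∈ S, ∑ a : Fin D,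
                (Literature.MathematicalPhysics.QuantumFieldTheory.plaquetteCurl (fun e => α e a) p) ^ 2) / 2) *
            ∫ Y, Real.sin (∑ p ∈ S, ∑ a : Fin D, h p a * Y p a) ∂τ) :=
  Summit.QuantumFields.YangMills.Theorems.EquipartitionPinsProbe.stub_steinFlow

/-- STUB R2 (LANDED p116527) — **the curvature kernel reproduces finitely supported exact forms** (`T dα = dα`):
`∑_q (dα)_q T(q, p) = (dα)_p` for every finitely supported 1-cochain `α` (linearity over the edges
of STUB K1, `stub_kernelExact`, landed p110317; the sum over `S ⊇ supp dα` equals the sum over all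
plaquettes touching `supp α` because the summand vanishes off `supp dα`). -/
theorem stub_kernelFixesExact :
    ∀ (S : Finset (Literature.MathematicalPhysics.QuantumLattice.ZdPlaquette 4))
        (E : Finset (Literature.MathematicalPhysics.QuantumLattice.ZdEdge 4))
        (α : Literature.MathematicalPhysics.QuantumLattice.ZdEdge 4 → ℝ),
      (∀ e, e ∉ E → α e = 0) →
      (∀ p, p ∉ S → Literature.MathematicalPhysics.QuantumFieldTheory.plaquetteCurl α p = 0) →
      ∀ p : Literature.MathematicalPhysics.QuantumLattice.ZdPlaquette 4,
        ∑ q ∈ S, Literature.MathematicalPhysics.QuantumFieldTheory.plaquetteCurl α q *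
            Literature.MathematicalPhysics.QuantumFieldTheory.curvatureTwoPoint q p =
          Literature.MathematicalPhysics.QuantumFieldTheory.plaquetteCurl α p :=
  Summit.QuantumFields.YangMills.Theorems.EquipartitionPinsProbe.stub_kernelFixesExact

/-- STUB R4 (LANDED p113292) — **line averages have vanishing Gaussian variance**: with `c(n) = T((0;i,j),(ne₀;i,j))`
(`→ 0` by STUB K3 `stub_kernelDecay`, landed p110629, and stationarity `curvatureTwoPoint_shift`),
`L⁻² ∑_{s,t<L} c(t − s) → 0` (Cesàro). -/
theorem stub_lineVariance :
    ∀ (i j : Fin 4) (hij : i < j),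
      Filter.Tendsto (fun L : ℕ =>
          (∑ s ∈ Finset.range L, ∑ t ∈ Finset.range L,
            Literature.MathematicalPhysics.QuantumFieldTheory.curvatureTwoPoint
              ((Pi.single (0 : Fin 4) (s : ℤ) : Literature.Probability.LatticeModels.Site 4), ⟨(i, j), hij⟩)
              ((Pi.single (0 : Fin 4) (t : ℤ) : Literature.Probability.LatticeModels.Site 4), ⟨(i, j), hij⟩)) /
            ((L : ℝ) ^ 2))
        Filter.atTop (nhds 0) :=
  Summit.QuantumFields.YangMills.Theorems.EquipartitionPinsProbe.stub_lineVariance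

/-- STUB R3 (LANDED p116724) — **finitely supported 2-cochains with vanishing plane sums are `ℓ¹`-limits of exact
plus co-exact finitely supported cochains**: if `g` is supported in `S` and `∑_{p ∈ plane (i,j)} g_p = 0`
for each of the six planes, then for every `ε > 0` there are a finitely supported 1-cochain `α` and
finitely many 3-cells `κ = (x; i<j<k)` with coefficients `r κ` such that
`‖g − dα − ∑ r_κ f_κ‖_{ℓ¹} < ε`, where `f_κ = δ_{(x+eᵢ;j,k)} − δ_{(x;j,k)} − δ_{(x+eⱼ;i,k)} + δ_{(x;i,k)} +
δ_{(x+eₖ;i,j)} − δ_{(x;i,j)}` is the face cochain of `κ` (Hahn–Banach in `ℓ¹`: a bounded `c ⊥` all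
`dδ_e` and all `f_κ` is co-closed and closed, hence harmonic componentwise by STUB H (landed p110812)
and constant on each plane by STUB L (landed p111448), so it annihilates `g`). -/
theorem stub_density :
    ∀ (g : Literature.MathematicalPhysics.QuantumLattice.ZdPlaquette 4 → ℝ)
        (S : Finset (Literature.MathematicalPhysics.QuantumLattice.ZdPlaquette 4)),
      (∀ p, p ∉ S → g p = 0) →
      (∀ (i j : Fin 4) (hij : i < j),
        ∑ p ∈ S, (if p.2 = ⟨(i, j), hij⟩ then g p else 0) = 0) →
      ∀ ε : ℝ, 0 < ε →
        ∃ (S' : Finset (Literature.MathematicalPhysics.QuantumLattice.ZdPlaquette 4))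
          (E : Finset (Literature.MathematicalPhysics.QuantumLattice.ZdEdge 4))
          (α : Literature.MathematicalPhysics.QuantumLattice.ZdEdge 4 → ℝ)
          (K : Finset (Literature.Probability.LatticeModels.Site 4 × Fin 4 × Fin 4 × Fin 4))
          (r : Literature.Probability.LatticeModels.Site 4 × Fin 4 × Fin 4 × Fin 4 → ℝ),
          S ⊆ S' ∧ (∀ e, e ∉ E → α e = 0) ∧
          (∀ p, p ∉ S' → Literature.MathematicalPhysics.QuantumFieldTheory.plaquetteCurl α p = 0) ∧
          (∀ κ ∈ K, κ.2.1 < κ.2.2.1 ∧ κ.2.2.1 < κ.2.2.2 ∧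
            ∀ p : Literature.MathematicalPhysics.QuantumLattice.ZdPlaquette 4,
              (fun (κ : Literature.Probability.LatticeModels.Site 4 × Fin 4 × Fin 4 × Fin 4)
                  (p : Literature.MathematicalPhysics.QuantumLattice.ZdPlaquette 4) =>
                if hκ : κ.2.1 < κ.2.2.1 ∧ κ.2.2.1 < κ.2.2.2 then
                  ((if p = (κ.1 + Pi.single κ.2.1 1, ⟨(κ.2.2.1, κ.2.2.2), hκ.2⟩) then (1 : ℝ) else 0) -
                    (if p = (κ.1, ⟨(κ.2.2.1, κ.2.2.2), hκ.2⟩) then (1 : ℝ) else 0) -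
                    (if p = (κ.1 + Pi.single κ.2.2.1 1, ⟨(κ.2.1, κ.2.2.2), hκ.1.trans hκ.2⟩) then (1 : ℝ) else 0) +
                    (if p = (κ.1, ⟨(κ.2.1, κ.2.2.2), hκ.1.trans hκ.2⟩) then (1 : ℝ) else 0) +
                    (if p = (κ.1 + Pi.single κ.2.2.2 1, ⟨(κ.2.1, κ.2.2.1), hκ.1⟩) then (1 : ℝ) else 0) -
                    (if p = (κ.1, ⟨(κ.2.1, κ.2.2.1), hκ.1⟩) then (1 : ℝ) else 0))
                else 0) κ p ≠ 0 → p ∈ S') ∧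
          ∑ p ∈ S', |g p - Literature.MathematicalPhysics.QuantumFieldTheory.plaquetteCurl α p -
              ∑ κ ∈ K, r κ *
                (fun (κ : Literature.Probability.LatticeModels.Site 4 × Fin 4 × Fin 4 × Fin 4)
                    (p : Literature.MathematicalPhysics.QuantumLattice.ZdPlaquette 4) =>
                  if hκ : κ.2.1 < κ.2.2.1 ∧ κ.2.2.1 < κ.2.2.2 then
                    ((if p = (κ.1 + Pi.single κ.2.1 1, ⟨(κ.2.2.1, κ.2.2.2), hκ.2⟩) then (1 : ℝ) else 0) -
                      (if p = (κ.1, ⟨(κ.2.2.1, κ.2.2.2), hκ.2⟩) then (1 : ℝ) else 0) -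
                      (if p = (κ.1 + Pi.single κ.2.2.1 1, ⟨(κ.2.1, κ.2.2.2), hκ.1.trans hκ.2⟩) then (1 : ℝ) else 0) +
                      (if p = (κ.1, ⟨(κ.2.1, κ.2.2.2), hκ.1.trans hκ.2⟩) then (1 : ℝ) else 0) +
                      (if p = (κ.1 + Pi.single κ.2.2.2 1, ⟨(κ.2.1, κ.2.2.1), hκ.1⟩) then (1 : ℝ) else 0) -
                      (if p = (κ.1, ⟨(κ.2.1, κ.2.2.1), hκ.1⟩) then (1 : ℝ) else 0))
                  else 0) κ p| < ε :=
  Summit.QuantumFields.YangMills.Theorems.EquipartitionPinsProbe.stub_density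

/-- STUB R6 (LANDED p112870) — **identification of the curvature Gaussian field from its characteristic functional**:
a probability measure on `ℝ^D`-valued 2-cochains of `ℤ⁴` with `E cos⟨Y,h⟩ = exp(−½ ∑ h h T)` and
`E sin⟨Y,h⟩ = 0` for all finitely supported `h` (`T = curvatureTwoPoint`, colours independent) IS
`curvatureGaussianField 4 D` (every finite linear combination is `gaussianReal 0 (∑ h h T)` by
`Measure.ext_of_charFun`, hence the coordinate process is Gaussian with mean `0` and covariance
`δ_ab T`; conclude with `eq_curvatureGaussianField_of_isGaussianProcess`). -/
theorem stub_gaussFromCharFun :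
    ∀ (D : ℕ) (τ : MeasureTheory.Measure
        (Literature.MathematicalPhysics.QuantumLattice.ZdPlaquette 4 → Fin D → ℝ)),
      MeasureTheory.IsProbabilityMeasure τ →
      (∀ (S : Finset (Literature.MathematicalPhysics.QuantumLattice.ZdPlaquette 4))
          (h : Literature.MathematicalPhysics.QuantumLattice.ZdPlaquette 4 → Fin D → ℝ),
        (∫ Y, Real.cos (∑ p ∈ S, ∑ a : Fin D, h p a * Y p a) ∂τ =
          Real.exp (-(∑ p ∈ S, ∑ q ∈ S, ∑ a : Fin D,
            h p a * h q a * Literature.MathematicalPhysics.QuantumFieldTheory.curvatureTwoPoint p q) / 2)) ∧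
        (∫ Y, Real.sin (∑ p ∈ S, ∑ a : Fin D, h p a * Y p a) ∂τ = 0)) →
      τ = Literature.MathematicalPhysics.QuantumFieldTheory.curvatureGaussianField 4 D :=
  Summit.QuantumFields.YangMills.Theorems.EquipartitionPinsProbe.stub_gaussFromCharFun

/-- STUB F1 — **invariance of `e^{Q/2} Φ_τ` under exact shifts**: GIVEN the statements of STUB R1
(Stein flow, landed p112456) and STUB R2 (`T dα = dα`, landed p116527), for every probability measure
`τ` with integrable coordinates and the Stein identity (T3), the functionals
`h ↦ exp(Q_S(h)/2) · E cos⟨Y,h⟩_S` and `h ↦ exp(Q_S(h)/2) · E sin⟨Y,h⟩_S`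
(`Q_S(h) = ∑_{p,q∈S}∑_a h_p^a h_q^a T(p,q)`) are unchanged by `h ↦ h + dα` (finitely supported
`α`, `supp dα ⊆ S`): R1 gives the factor `e^{−⟨dα,h⟩ − ½‖dα‖²}` on the integral, R2 (with the
symmetry `curvatureTwoPoint_comm`) gives `Q_S(h + dα) = Q_S(h) + 2⟨dα,h⟩ + ‖dα‖²`. -/
theorem stub_exactShiftInvariance :
    -- (R1)
    (∀ (D : ℕ) (τ : MeasureTheory.Measure
        (Literature.MathematicalPhysics.QuantumLattice.ZdPlaquette 4 → Fin D → ℝ)),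
      MeasureTheory.IsProbabilityMeasure τ →
      (∀ (p : Literature.MathematicalPhysics.QuantumLattice.ZdPlaquette 4) (a : Fin D),
        MeasureTheory.Integrable (fun Y : Literature.MathematicalPhysics.QuantumLattice.ZdPlaquette 4 → Fin D → ℝ => Y p a) τ) →
      (∀ (S : Finset (Literature.MathematicalPhysics.QuantumLattice.ZdPlaquette 4))
          (E : Finset (Literature.MathematicalPhysics.QuantumLattice.ZdEdge 4))
          (h : Literature.MathematicalPhysics.QuantumLattice.ZdPlaquette 4 → Fin D → ℝ)
          (α : Literature.MathematicalPhysics.QuantumLattice.ZdEdge 4 → Fin D → ℝ),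
        (∀ e, e ∉ E → α e = 0) →
        (∀ p, p ∉ S → ∀ a : Fin D,
          Literature.MathematicalPhysics.QuantumFieldTheory.plaquetteCurl (fun e => α e a) p = 0) →
        (∫ Y, Real.cos (∑ p ∈ S, ∑ a : Fin D, h p a * Y p a) *
            (∑ p ∈ S, ∑ a : Fin D,
              Literature.MathematicalPhysics.QuantumFieldTheory.plaquetteCurl
                (fun e => α e a) p * Y p a) ∂τ =
          -(∑ p ∈ S, ∑ a : Fin D,
              Literature.MathematicalPhysics.QuantumFieldTheory.plaquetteCurl
                (fun e => α e a) p * h p a) *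
            ∫ Y, Real.sin (∑ p ∈ S, ∑ a : Fin D, h p a * Y p a) ∂τ) ∧
        (∫ Y, Real.sin (∑ p ∈ S, ∑ a : Fin D, h p a * Y p a) *
            (∑ p ∈ S, ∑ a : Fin D,
              Literature.MathematicalPhysics.QuantumFieldTheory.plaquetteCurl
                (fun e => α e a) p * Y p a) ∂τ =
          (∑ p ∈ S, ∑ a : Fin D,
              Literature.MathematicalPhysics.QuantumFieldTheory.plaquetteCurl
                (fun e => α e a) p * h p a) *
            ∫ Y, Real.cos (∑ p ∈ S, ∑ a : Fin D, h p a * Y p a) ∂τ)) →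
      ∀ (S : Finset (Literature.MathematicalPhysics.QuantumLattice.ZdPlaquette 4))
          (E : Finset (Literature.MathematicalPhysics.QuantumLattice.ZdEdge 4))
          (h : Literature.MathematicalPhysics.QuantumLattice.ZdPlaquette 4 → Fin D → ℝ)
          (α : Literature.MathematicalPhysics.QuantumLattice.ZdEdge 4 → Fin D → ℝ),
        (∀ e, e ∉ E → α e = 0) →
        (∀ p, p ∉ S → ∀ a : Fin D,
          Literature.MathematicalPhysics.QuantumFieldTheory.plaquetteCurl (fun e => α e a) p = 0) →
        (∫ Y, Real.cos (∑ p ∈ S, ∑ a : Fin D,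
            (h p a + Literature.MathematicalPhysics.QuantumFieldTheory.plaquetteCurl (fun e => α e a) p) * Y p a) ∂τ =
          Real.exp (-(∑ p ∈ S, ∑ a : Fin D,
                Literature.MathematicalPhysics.QuantumFieldTheory.plaquetteCurl (fun e => α e a) p * h p a) -
              (∑ p ∈ S, ∑ a : Fin D,
                (Literature.MathematicalPhysics.QuantumFieldTheory.plaquetteCurl (fun e => α e a) p) ^ 2) / 2) *
            ∫ Y, Real.cos (∑ p ∈ S, ∑ a : Fin D, h p a * Y p a) ∂τ) ∧
        (∫ Y, Real.sin (∑ p ∈ S, ∑ a : Fin D,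
            (h p a + Literature.MathematicalPhysics.QuantumFieldTheory.plaquetteCurl (fun e => α e a) p) * Y p a) ∂τ =
          Real.exp (-(∑ p ∈ S, ∑ a : Fin D,
                Literature.MathematicalPhysics.QuantumFieldTheory.plaquetteCurl (fun e => α e a) p * h p a) -
              (∑ p ∈ S, ∑ a : Fin D,
                (Literature.MathematicalPhysics.QuantumFieldTheory.plaquetteCurl (fun e => α e a) p) ^ 2) / 2) *
            ∫ Y, Real.sin (∑ p ∈ S, ∑ a : Fin D, h p a * Y p a) ∂τ)) →
    -- (R2)
    (∀ (S : Finset (Literature.MathematicalPhysics.QuantumLattice.ZdPlaquette 4))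
        (E : Finset (Literature.MathematicalPhysics.QuantumLattice.ZdEdge 4))
        (α : Literature.MathematicalPhysics.QuantumLattice.ZdEdge 4 → ℝ),
      (∀ e, e ∉ E → α e = 0) →
      (∀ p, p ∉ S → Literature.MathematicalPhysics.QuantumFieldTheory.plaquetteCurl α p = 0) →
      ∀ p : Literature.MathematicalPhysics.QuantumLattice.ZdPlaquette 4,
        ∑ q ∈ S, Literature.MathematicalPhysics.QuantumFieldTheory.plaquetteCurl α q *
            Literature.MathematicalPhysics.QuantumFieldTheory.curvatureTwoPoint q p =
          Literature.MathematicalPhysics.QuantumFieldTheory.plaquetteCurl α p) →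
    ∀ (D : ℕ) (τ : MeasureTheory.Measure
        (Literature.MathematicalPhysics.QuantumLattice.ZdPlaquette 4 → Fin D → ℝ)),
      MeasureTheory.IsProbabilityMeasure τ →
      (∀ (p : Literature.MathematicalPhysics.QuantumLattice.ZdPlaquette 4) (a : Fin D),
        MeasureTheory.Integrable (fun Y : Literature.MathematicalPhysics.QuantumLattice.ZdPlaquette 4 → Fin D → ℝ => Y p a) τ) →
      (∀ (S : Finset (Literature.MathematicalPhysics.QuantumLattice.ZdPlaquette 4))
          (E : Finset (Literature.MathematicalPhysics.QuantumLattice.ZdEdge 4))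
          (h : Literature.MathematicalPhysics.QuantumLattice.ZdPlaquette 4 → Fin D → ℝ)
          (α : Literature.MathematicalPhysics.QuantumLattice.ZdEdge 4 → Fin D → ℝ),
        (∀ e, e ∉ E → α e = 0) →
        (∀ p, p ∉ S → ∀ a : Fin D,
          Literature.MathematicalPhysics.QuantumFieldTheory.plaquetteCurl (fun e => α e a) p = 0) →
        (∫ Y, Real.cos (∑ p ∈ S, ∑ a : Fin D, h p a * Y p a) *
            (∑ p ∈ S, ∑ a : Fin D,
              Literature.MathematicalPhysics.QuantumFieldTheory.plaquetteCurl
                (fun e => α e a) p * Y p a) ∂τ =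
          -(∑ p ∈ S, ∑ a : Fin D,
              Literature.MathematicalPhysics.QuantumFieldTheory.plaquetteCurl
                (fun e => α e a) p * h p a) *
            ∫ Y, Real.sin (∑ p ∈ S, ∑ a : Fin D, h p a * Y p a) ∂τ) ∧
        (∫ Y, Real.sin (∑ p ∈ S, ∑ a : Fin D, h p a * Y p a) *
            (∑ p ∈ S, ∑ a : Fin D,
              Literature.MathematicalPhysics.QuantumFieldTheory.plaquetteCurl
                (fun e => α e a) p * Y p a) ∂τ =
          (∑ p ∈ S, ∑ a : Fin D,
              Literature.MathematicalPhysics.QuantumFieldTheory.plaquetteCurl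
                (fun e => α e a) p * h p a) *
            ∫ Y, Real.cos (∑ p ∈ S, ∑ a : Fin D, h p a * Y p a) ∂τ)) →
      ∀ (S : Finset (Literature.MathematicalPhysics.QuantumLattice.ZdPlaquette 4))
          (E : Finset (Literature.MathematicalPhysics.QuantumLattice.ZdEdge 4))
          (h : Literature.MathematicalPhysics.QuantumLattice.ZdPlaquette 4 → Fin D → ℝ)
          (α : Literature.MathematicalPhysics.QuantumLattice.ZdEdge 4 → Fin D → ℝ),
        (∀ e, e ∉ E → α e = 0) →
        (∀ p, p ∉ S → ∀ a : Fin D,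
          Literature.MathematicalPhysics.QuantumFieldTheory.plaquetteCurl (fun e => α e a) p = 0) →
        (Real.exp ((∑ p ∈ S, ∑ q ∈ S, ∑ a : Fin D,
              (h p a + Literature.MathematicalPhysics.QuantumFieldTheory.plaquetteCurl (fun e => α e a) p) *
                (h q a + Literature.MathematicalPhysics.QuantumFieldTheory.plaquetteCurl (fun e => α e a) q) *
                Literature.MathematicalPhysics.QuantumFieldTheory.curvatureTwoPoint p q) / 2) *
            ∫ Y, Real.cos (∑ p ∈ S, ∑ a : Fin D,
              (h p a + Literature.MathematicalPhysics.QuantumFieldTheory.plaquetteCurl (fun e => α e a) p) * Y p a) ∂τ =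
          Real.exp ((∑ p ∈ S, ∑ q ∈ S, ∑ a : Fin D,
              h p a * h q a * Literature.MathematicalPhysics.QuantumFieldTheory.curvatureTwoPoint p q) / 2) *
            ∫ Y, Real.cos (∑ p ∈ S, ∑ a : Fin D, h p a * Y p a) ∂τ) ∧
        (Real.exp ((∑ p ∈ S, ∑ q ∈ S, ∑ a : Fin D,
              (h p a + Literature.MathematicalPhysics.QuantumFieldTheory.plaquetteCurl (fun e => α e a) p) *
                (h q a + Literature.MathematicalPhysics.QuantumFieldTheory.plaquetteCurl (fun e => α e a) q) *
                Literature.MathematicalPhysics.QuantumFieldTheory.curvatureTwoPoint p q) / 2) *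
            ∫ Y, Real.sin (∑ p ∈ S, ∑ a : Fin D,
              (h p a + Literature.MathematicalPhysics.QuantumFieldTheory.plaquetteCurl (fun e => α e a) p) * Y p a) ∂τ =
          Real.exp ((∑ p ∈ S, ∑ q ∈ S, ∑ a : Fin D,
              h p a * h q a * Literature.MathematicalPhysics.QuantumFieldTheory.curvatureTwoPoint p q) / 2) *
            ∫ Y, Real.sin (∑ p ∈ S, ∑ a : Fin D, h p a * Y p a) ∂τ) :=
  Summit.QuantumFields.YangMills.Theorems.EquipartitionPinsProbe.stub_exactShiftInvariance

/-- STUB F2 — **invariance of `e^{Q/2} Φ_τ` under co-exact (cube) shifts**: GIVEN the statement of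
STUB K2 (`dT = 0`, landed p109912), for every measure `τ` supported on closed cochains (T1), adding
`r` times the face cochain `f_κ = δ_{(x+eᵢ;j,k)} − δ_{(x;j,k)} − δ_{(x+eⱼ;i,k)} + δ_{(x;i,k)} + δ_{(x+eₖ;i,j)} −
δ_{(x;i,j)}` of a 3-cell `κ = (x; i<j<k)` in one colour `b` to `h` changes neither `E cos⟨Y,h⟩_S`,
`E sin⟨Y,h⟩_S` (the pairing changes by `r (dY)^b_κ = 0` a.s.) nor `Q_S(h)` (`∑_p f_κ(p) T(p,q) = 0` by
K2), provided the six faces lie in `S`. -/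
theorem stub_cubeShiftInvariance :
    -- (K2)
    (∀ (q : Literature.MathematicalPhysics.QuantumLattice.ZdPlaquette 4)
        (x : Literature.Probability.LatticeModels.Site 4) (i j k : Fin 4) (hij : i < j) (hjk : j < k),
      (Literature.MathematicalPhysics.QuantumFieldTheory.curvatureTwoPoint
            (x + Pi.single i 1, ⟨(j, k), hjk⟩) q -
          Literature.MathematicalPhysics.QuantumFieldTheory.curvatureTwoPoint (x, ⟨(j, k), hjk⟩) q) -
        (Literature.MathematicalPhysics.QuantumFieldTheory.curvatureTwoPoint
            (x + Pi.single j 1, ⟨(i, k), hij.trans hjk⟩) q -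
          Literature.MathematicalPhysics.QuantumFieldTheory.curvatureTwoPoint
            (x, ⟨(i, k), hij.trans hjk⟩) q) +
        (Literature.MathematicalPhysics.QuantumFieldTheory.curvatureTwoPoint
            (x + Pi.single k 1, ⟨(i, j), hij⟩) q -
          Literature.MathematicalPhysics.QuantumFieldTheory.curvatureTwoPoint (x, ⟨(i, j), hij⟩) q) =
      0) →
    ∀ (D : ℕ) (τ : MeasureTheory.Measure
        (Literature.MathematicalPhysics.QuantumLattice.ZdPlaquette 4 → Fin D → ℝ)),
      (∀ (x : Literature.Probability.LatticeModels.Site 4) (i j k : Fin 4)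
          (hij : i < j) (hjk : j < k) (a : Fin D),
        ∀ᵐ Y ∂τ,
          (Y (x + Pi.single i 1, ⟨(j, k), hjk⟩) a - Y (x, ⟨(j, k), hjk⟩) a) -
            (Y (x + Pi.single j 1, ⟨(i, k), hij.trans hjk⟩) a -
              Y (x, ⟨(i, k), hij.trans hjk⟩) a) +
            (Y (x + Pi.single k 1, ⟨(i, j), hij⟩) a - Y (x, ⟨(i, j), hij⟩) a) = 0) →
      ∀ (S : Finset (Literature.MathematicalPhysics.QuantumLattice.ZdPlaquette 4))
          (h : Literature.MathematicalPhysics.QuantumLattice.ZdPlaquette 4 → Fin D → ℝ)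
          (x : Literature.Probability.LatticeModels.Site 4) (i j k : Fin 4) (hij : i < j) (hjk : j < k)
          (b : Fin D) (r : ℝ),
        (x + Pi.single i 1, ⟨(j, k), hjk⟩) ∈ S → (x, ⟨(j, k), hjk⟩) ∈ S →
        (x + Pi.single j 1, ⟨(i, k), hij.trans hjk⟩) ∈ S → (x, ⟨(i, k), hij.trans hjk⟩) ∈ S →
        (x + Pi.single k 1, ⟨(i, j), hij⟩) ∈ S → (x, ⟨(i, j), hij⟩) ∈ S →
        (Real.exp ((∑ p ∈ S, ∑ q ∈ S, ∑ a : Fin D,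
              (fun (p : Literature.MathematicalPhysics.QuantumLattice.ZdPlaquette 4) (a : Fin D) =>
                h p a + (if a = b then r *
                  ((if p = (x + Pi.single i 1, ⟨(j, k), hjk⟩) then (1 : ℝ) else 0) -
                    (if p = (x, ⟨(j, k), hjk⟩) then (1 : ℝ) else 0) -
                    (if p = (x + Pi.single j 1, ⟨(i, k), hij.trans hjk⟩) then (1 : ℝ) else 0) +
                    (if p = (x, ⟨(i, k), hij.trans hjk⟩) then (1 : ℝ) else 0) +
                    (if p = (x + Pi.single k 1, ⟨(i, j), hij⟩) then (1 : ℝ) else 0) -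
                    (if p = (x, ⟨(i, j), hij⟩) then (1 : ℝ) else 0)) else 0)) p a *
              (fun (p : Literature.MathematicalPhysics.QuantumLattice.ZdPlaquette 4) (a : Fin D) =>
                h p a + (if a = b then r *
                  ((if p = (x + Pi.single i 1, ⟨(j, k), hjk⟩) then (1 : ℝ) else 0) -
                    (if p = (x, ⟨(j, k), hjk⟩) then (1 : ℝ) else 0) -
                    (if p = (x + Pi.single j 1, ⟨(i, k), hij.trans hjk⟩) then (1 : ℝ) else 0) +
                    (if p = (x, ⟨(i, k), hij.trans hjk⟩) then (1 : ℝ) else 0) +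
                    (if p = (x + Pi.single k 1, ⟨(i, j), hij⟩) then (1 : ℝ) else 0) -
                    (if p = (x, ⟨(i, j), hij⟩) then (1 : ℝ) else 0)) else 0)) q a *
                Literature.MathematicalPhysics.QuantumFieldTheory.curvatureTwoPoint p q) / 2) *
            ∫ Y, Real.cos (∑ p ∈ S, ∑ a : Fin D,
              (fun (p : Literature.MathematicalPhysics.QuantumLattice.ZdPlaquette 4) (a : Fin D) =>
                h p a + (if a = b then r *
                  ((if p = (x + Pi.single i 1, ⟨(j, k), hjk⟩) then (1 : ℝ) else 0) -
                    (if p = (x, ⟨(j, k), hjk⟩) then (1 : ℝ) else 0) -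
                    (if p = (x + Pi.single j 1, ⟨(i, k), hij.trans hjk⟩) then (1 : ℝ) else 0) +
                    (if p = (x, ⟨(i, k), hij.trans hjk⟩) then (1 : ℝ) else 0) +
                    (if p = (x + Pi.single k 1, ⟨(i, j), hij⟩) then (1 : ℝ) else 0) -
                    (if p = (x, ⟨(i, j), hij⟩) then (1 : ℝ) else 0)) else 0)) p a * Y p a) ∂τ =
          Real.exp ((∑ p ∈ S, ∑ q ∈ S, ∑ a : Fin D,
              h p a * h q a * Literature.MathematicalPhysics.QuantumFieldTheory.curvatureTwoPoint p q) / 2) *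
            ∫ Y, Real.cos (∑ p ∈ S, ∑ a : Fin D, h p a * Y p a) ∂τ) ∧
        (Real.exp ((∑ p ∈ S, ∑ q ∈ S, ∑ a : Fin D,
              (fun (p : Literature.MathematicalPhysics.QuantumLattice.ZdPlaquette 4) (a : Fin D) =>
                h p a + (if a = b then r *
                  ((if p = (x + Pi.single i 1, ⟨(j, k), hjk⟩) then (1 : ℝ) else 0) -
                    (if p = (x, ⟨(j, k), hjk⟩) then (1 : ℝ) else 0) -
                    (if p = (x + Pi.single j 1, ⟨(i, k), hij.trans hjk⟩) then (1 : ℝ) else 0) +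
                    (if p = (x, ⟨(i, k), hij.trans hjk⟩) then (1 : ℝ) else 0) +
                    (if p = (x + Pi.single k 1, ⟨(i, j), hij⟩) then (1 : ℝ) else 0) -
                    (if p = (x, ⟨(i, j), hij⟩) then (1 : ℝ) else 0)) else 0)) p a *
              (fun (p : Literature.MathematicalPhysics.QuantumLattice.ZdPlaquette 4) (a : Fin D) =>
                h p a + (if a = b then r *
                  ((if p = (x + Pi.single i 1, ⟨(j, k), hjk⟩) then (1 : ℝ) else 0) -
                    (if p = (x, ⟨(j, k), hjk⟩) then (1 : ℝ) else 0) -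
                    (if p = (x + Pi.single j 1, ⟨(i, k), hij.trans hjk⟩) then (1 : ℝ) else 0) +
                    (if p = (x, ⟨(i, k), hij.trans hjk⟩) then (1 : ℝ) else 0) +
                    (if p = (x + Pi.single k 1, ⟨(i, j), hij⟩) then (1 : ℝ) else 0) -
                    (if p = (x, ⟨(i, j), hij⟩) then (1 : ℝ) else 0)) else 0)) q a *
                Literature.MathematicalPhysics.QuantumFieldTheory.curvatureTwoPoint p q) / 2) *
            ∫ Y, Real.sin (∑ p ∈ S, ∑ a : Fin D,
              (fun (p : Literature.MathematicalPhysics.QuantumLattice.ZdPlaquette 4) (a : Fin D) =>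
                h p a + (if a = b then r *
                  ((if p = (x + Pi.single i 1, ⟨(j, k), hjk⟩) then (1 : ℝ) else 0) -
                    (if p = (x, ⟨(j, k), hjk⟩) then (1 : ℝ) else 0) -
                    (if p = (x + Pi.single j 1, ⟨(i, k), hij.trans hjk⟩) then (1 : ℝ) else 0) +
                    (if p = (x, ⟨(i, k), hij.trans hjk⟩) then (1 : ℝ) else 0) +
                    (if p = (x + Pi.single k 1, ⟨(i, j), hij⟩) then (1 : ℝ) else 0) -
                    (if p = (x, ⟨(i, j), hij⟩) then (1 : ℝ) else 0)) else 0)) p a * Y p a) ∂τ =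
          Real.exp ((∑ p ∈ S, ∑ q ∈ S, ∑ a : Fin D,
              h p a * h q a * Literature.MathematicalPhysics.QuantumFieldTheory.curvatureTwoPoint p q) / 2) *
            ∫ Y, Real.sin (∑ p ∈ S, ∑ a : Fin D, h p a * Y p a) ∂τ) :=
  Summit.QuantumFields.YangMills.Theorems.EquipartitionPinsProbe.stub_cubeShiftInvariance

/-- STUB F5 — **factorization through the constant 2-forms**: GIVEN the conclusions of STUBS F1, F2
(invariance of `Ψ = e^{Q/2}Φ_τ` under exact and cube shifts) and the statement of STUB R3 (density,
landed p116724): for a probability measure `τ` with (T1), uniformly `L²`-bounded coordinates (T2a) and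
(T3), `Ψ` takes the same value at two test cochains `h, h'` on `S` whose plane–colour sums agree
(`g = h' − h` has zero plane sums in each colour, so by R3 it is an `ℓ¹`-limit of exact-plus-cube
cochains `w`; `Ψ(h + w) = Ψ(h)` by F1/F2 (induction over the cubes), and `Ψ` is `ℓ¹`-continuous on
bounded sets because `|E cos⟨Y,u⟩ − E cos⟨Y,v⟩| ≤ sup_p E|Y_p| · ‖u − v‖₁ ≤ √B ‖u − v‖₁` and
`|T(p,q)| ≤ ½`). -/
theorem stub_factorization :
    -- (F1, conclusion)
    (∀ (D : ℕ) (τ : MeasureTheory.Measure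
        (Literature.MathematicalPhysics.QuantumLattice.ZdPlaquette 4 → Fin D → ℝ)),
      MeasureTheory.IsProbabilityMeasure τ →
      (∀ (p : Literature.MathematicalPhysics.QuantumLattice.ZdPlaquette 4) (a : Fin D),
        MeasureTheory.Integrable (fun Y : Literature.MathematicalPhysics.QuantumLattice.ZdPlaquette 4 → Fin D → ℝ => Y p a) τ) →
      (∀ (S : Finset (Literature.MathematicalPhysics.QuantumLattice.ZdPlaquette 4))
          (E : Finset (Literature.MathematicalPhysics.QuantumLattice.ZdEdge 4))
          (h : Literature.MathematicalPhysics.QuantumLattice.ZdPlaquette 4 → Fin D → ℝ)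
          (α : Literature.MathematicalPhysics.QuantumLattice.ZdEdge 4 → Fin D → ℝ),
        (∀ e, e ∉ E → α e = 0) →
        (∀ p, p ∉ S → ∀ a : Fin D,
          Literature.MathematicalPhysics.QuantumFieldTheory.plaquetteCurl (fun e => α e a) p = 0) →
        (∫ Y, Real.cos (∑ p ∈ S, ∑ a : Fin D, h p a * Y p a) *
            (∑ p ∈ S, ∑ a : Fin D,
              Literature.MathematicalPhysics.QuantumFieldTheory.plaquetteCurl
                (fun e => α e a) p * Y p a) ∂τ =
          -(∑ p ∈ S, ∑ a : Fin D,
              Literature.MathematicalPhysics.QuantumFieldTheory.plaquetteCurl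
                (fun e => α e a) p * h p a) *
            ∫ Y, Real.sin (∑ p ∈ S, ∑ a : Fin D, h p a * Y p a) ∂τ) ∧
        (∫ Y, Real.sin (∑ p ∈ S, ∑ a : Fin D, h p a * Y p a) *
            (∑ p ∈ S, ∑ a : Fin D,
              Literature.MathematicalPhysics.QuantumFieldTheory.plaquetteCurl
                (fun e => α e a) p * Y p a) ∂τ =
          (∑ p ∈ S, ∑ a : Fin D,
              Literature.MathematicalPhysics.QuantumFieldTheory.plaquetteCurl
                (fun e => α e a) p * h p a) *
            ∫ Y, Real.cos (∑ p ∈ S, ∑ a : Fin D, h p a * Y p a) ∂τ)) →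
      ∀ (S : Finset (Literature.MathematicalPhysics.QuantumLattice.ZdPlaquette 4))
          (E : Finset (Literature.MathematicalPhysics.QuantumLattice.ZdEdge 4))
          (h : Literature.MathematicalPhysics.QuantumLattice.ZdPlaquette 4 → Fin D → ℝ)
          (α : Literature.MathematicalPhysics.QuantumLattice.ZdEdge 4 → Fin D → ℝ),
        (∀ e, e ∉ E → α e = 0) →
        (∀ p, p ∉ S → ∀ a : Fin D,
          Literature.MathematicalPhysics.QuantumFieldTheory.plaquetteCurl (fun e => α e a) p = 0) →
        (Real.exp ((∑ p ∈ S, ∑ q ∈ S, ∑ a : Fin D,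
              (h p a + Literature.MathematicalPhysics.QuantumFieldTheory.plaquetteCurl (fun e => α e a) p) *
                (h q a + Literature.MathematicalPhysics.QuantumFieldTheory.plaquetteCurl (fun e => α e a) q) *
                Literature.MathematicalPhysics.QuantumFieldTheory.curvatureTwoPoint p q) / 2) *
            ∫ Y, Real.cos (∑ p ∈ S, ∑ a : Fin D,
              (h p a + Literature.MathematicalPhysics.QuantumFieldTheory.plaquetteCurl (fun e => α e a) p) * Y p a) ∂τ =
          Real.exp ((∑ p ∈ S, ∑ q ∈ S, ∑ a : Fin D,
              h p a * h q a * Literature.MathematicalPhysics.QuantumFieldTheory.curvatureTwoPoint p q) / 2) *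
            ∫ Y, Real.cos (∑ p ∈ S, ∑ a : Fin D, h p a * Y p a) ∂τ) ∧
        (Real.exp ((∑ p ∈ S, ∑ q ∈ S, ∑ a : Fin D,
              (h p a + Literature.MathematicalPhysics.QuantumFieldTheory.plaquetteCurl (fun e => α e a) p) *
                (h q a + Literature.MathematicalPhysics.QuantumFieldTheory.plaquetteCurl (fun e => α e a) q) *
                Literature.MathematicalPhysics.QuantumFieldTheory.curvatureTwoPoint p q) / 2) *
            ∫ Y, Real.sin (∑ p ∈ S, ∑ a : Fin D,
              (h p a + Literature.MathematicalPhysics.QuantumFieldTheory.plaquetteCurl (fun e => α e a) p) * Y p a) ∂τ =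
          Real.exp ((∑ p ∈ S, ∑ q ∈ S, ∑ a : Fin D,
              h p a * h q a * Literature.MathematicalPhysics.QuantumFieldTheory.curvatureTwoPoint p q) / 2) *
            ∫ Y, Real.sin (∑ p ∈ S, ∑ a : Fin D, h p a * Y p a) ∂τ)) →
    -- (F2, conclusion)
    (∀ (D : ℕ) (τ : MeasureTheory.Measure
        (Literature.MathematicalPhysics.QuantumLattice.ZdPlaquette 4 → Fin D → ℝ)),
      (∀ (x : Literature.Probability.LatticeModels.Site 4) (i j k : Fin 4)
          (hij : i < j) (hjk : j < k) (a : Fin D),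
        ∀ᵐ Y ∂τ,
          (Y (x + Pi.single i 1, ⟨(j, k), hjk⟩) a - Y (x, ⟨(j, k), hjk⟩) a) -
            (Y (x + Pi.single j 1, ⟨(i, k), hij.trans hjk⟩) a -
              Y (x, ⟨(i, k), hij.trans hjk⟩) a) +
            (Y (x + Pi.single k 1, ⟨(i, j), hij⟩) a - Y (x, ⟨(i, j), hij⟩) a) = 0) →
      ∀ (S : Finset (Literature.MathematicalPhysics.QuantumLattice.ZdPlaquette 4))
          (h : Literature.MathematicalPhysics.QuantumLattice.ZdPlaquette 4 → Fin D → ℝ)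
          (x : Literature.Probability.LatticeModels.Site 4) (i j k : Fin 4) (hij : i < j) (hjk : j < k)
          (b : Fin D) (r : ℝ),
        (x + Pi.single i 1, ⟨(j, k), hjk⟩) ∈ S → (x, ⟨(j, k), hjk⟩) ∈ S →
        (x + Pi.single j 1, ⟨(i, k), hij.trans hjk⟩) ∈ S → (x, ⟨(i, k), hij.trans hjk⟩) ∈ S →
        (x + Pi.single k 1, ⟨(i, j), hij⟩) ∈ S → (x, ⟨(i, j), hij⟩) ∈ S →
        (Real.exp ((∑ p ∈ S, ∑ q ∈ S, ∑ a : Fin D,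
              (fun (p : Literature.MathematicalPhysics.QuantumLattice.ZdPlaquette 4) (a : Fin D) =>
                h p a + (if a = b then r *
                  ((if p = (x + Pi.single i 1, ⟨(j, k), hjk⟩) then (1 : ℝ) else 0) -
                    (if p = (x, ⟨(j, k), hjk⟩) then (1 : ℝ) else 0) -
                    (if p = (x + Pi.single j 1, ⟨(i, k), hij.trans hjk⟩) then (1 : ℝ) else 0) +
                    (if p = (x, ⟨(i, k), hij.trans hjk⟩) then (1 : ℝ) else 0) +
                    (if p = (x + Pi.single k 1, ⟨(i, j), hij⟩) then (1 : ℝ) else 0) -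
                    (if p = (x, ⟨(i, j), hij⟩) then (1 : ℝ) else 0)) else 0)) p a *
              (fun (p : Literature.MathematicalPhysics.QuantumLattice.ZdPlaquette 4) (a : Fin D) =>
                h p a + (if a = b then r *
                  ((if p = (x + Pi.single i 1, ⟨(j, k), hjk⟩) then (1 : ℝ) else 0) -
                    (if p = (x, ⟨(j, k), hjk⟩) then (1 : ℝ) else 0) -
                    (if p = (x + Pi.single j 1, ⟨(i, k), hij.trans hjk⟩) then (1 : ℝ) else 0) +
                    (if p = (x, ⟨(i, k), hij.trans hjk⟩) then (1 : ℝ) else 0) +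
                    (if p = (x + Pi.single k 1, ⟨(i, j), hij⟩) then (1 : ℝ) else 0) -
                    (if p = (x, ⟨(i, j), hij⟩) then (1 : ℝ) else 0)) else 0)) q a *
                Literature.MathematicalPhysics.QuantumFieldTheory.curvatureTwoPoint p q) / 2) *
            ∫ Y, Real.cos (∑ p ∈ S, ∑ a : Fin D,
              (fun (p : Literature.MathematicalPhysics.QuantumLattice.ZdPlaquette 4) (a : Fin D) =>
                h p a + (if a = b then r *
                  ((if p = (x + Pi.single i 1, ⟨(j, k), hjk⟩) then (1 : ℝ) else 0) -
                    (if p = (x, ⟨(j, k), hjk⟩) then (1 : ℝ) else 0) -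
                    (if p = (x + Pi.single j 1, ⟨(i, k), hij.trans hjk⟩) then (1 : ℝ) else 0) +
                    (if p = (x, ⟨(i, k), hij.trans hjk⟩) then (1 : ℝ) else 0) +
                    (if p = (x + Pi.single k 1, ⟨(i, j), hij⟩) then (1 : ℝ) else 0) -
                    (if p = (x, ⟨(i, j), hij⟩) then (1 : ℝ) else 0)) else 0)) p a * Y p a) ∂τ =
          Real.exp ((∑ p ∈ S, ∑ q ∈ S, ∑ a : Fin D,
              h p a * h q a * Literature.MathematicalPhysics.QuantumFieldTheory.curvatureTwoPoint p q) / 2) *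
            ∫ Y, Real.cos (∑ p ∈ S, ∑ a : Fin D, h p a * Y p a) ∂τ) ∧
        (Real.exp ((∑ p ∈ S, ∑ q ∈ S, ∑ a : Fin D,
              (fun (p : Literature.MathematicalPhysics.QuantumLattice.ZdPlaquette 4) (a : Fin D) =>
                h p a + (if a = b then r *
                  ((if p = (x + Pi.single i 1, ⟨(j, k), hjk⟩) then (1 : ℝ) else 0) -
                    (if p = (x, ⟨(j, k), hjk⟩) then (1 : ℝ) else 0) -
                    (if p = (x + Pi.single j 1, ⟨(i, k), hij.trans hjk⟩) then (1 : ℝ) else 0) +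
                    (if p = (x, ⟨(i, k), hij.trans hjk⟩) then (1 : ℝ) else 0) +
                    (if p = (x + Pi.single k 1, ⟨(i, j), hij⟩) then (1 : ℝ) else 0) -
                    (if p = (x, ⟨(i, j), hij⟩) then (1 : ℝ) else 0)) else 0)) p a *
              (fun (p : Literature.MathematicalPhysics.QuantumLattice.ZdPlaquette 4) (a : Fin D) =>
                h p a + (if a = b then r *
                  ((if p = (x + Pi.single i 1, ⟨(j, k), hjk⟩) then (1 : ℝ) else 0) -
                    (if p = (x, ⟨(j, k), hjk⟩) then (1 : ℝ) else 0) -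
                    (if p = (x + Pi.single j 1, ⟨(i, k), hij.trans hjk⟩) then (1 : ℝ) else 0) +
                    (if p = (x, ⟨(i, k), hij.trans hjk⟩) then (1 : ℝ) else 0) +
                    (if p = (x + Pi.single k 1, ⟨(i, j), hij⟩) then (1 : ℝ) else 0) -
                    (if p = (x, ⟨(i, j), hij⟩) then (1 : ℝ) else 0)) else 0)) q a *
                Literature.MathematicalPhysics.QuantumFieldTheory.curvatureTwoPoint p q) / 2) *
            ∫ Y, Real.sin (∑ p ∈ S, ∑ a : Fin D,
              (fun (p : Literature.MathematicalPhysics.QuantumLattice.ZdPlaquette 4) (a : Fin D) =>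
                h p a + (if a = b then r *
                  ((if p = (x + Pi.single i 1, ⟨(j, k), hjk⟩) then (1 : ℝ) else 0) -
                    (if p = (x, ⟨(j, k), hjk⟩) then (1 : ℝ) else 0) -
                    (if p = (x + Pi.single j 1, ⟨(i, k), hij.trans hjk⟩) then (1 : ℝ) else 0) +
                    (if p = (x, ⟨(i, k), hij.trans hjk⟩) then (1 : ℝ) else 0) +
                    (if p = (x + Pi.single k 1, ⟨(i, j), hij⟩) then (1 : ℝ) else 0) -
                    (if p = (x, ⟨(i, j), hij⟩) then (1 : ℝ) else 0)) else 0)) p a * Y p a) ∂τ =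
          Real.exp ((∑ p ∈ S, ∑ q ∈ S, ∑ a : Fin D,
              h p a * h q a * Literature.MathematicalPhysics.QuantumFieldTheory.curvatureTwoPoint p q) / 2) *
            ∫ Y, Real.sin (∑ p ∈ S, ∑ a : Fin D, h p a * Y p a) ∂τ)) →
    -- (R3)
    (∀ (g : Literature.MathematicalPhysics.QuantumLattice.ZdPlaquette 4 → ℝ)
        (S : Finset (Literature.MathematicalPhysics.QuantumLattice.ZdPlaquette 4)),
      (∀ p, p ∉ S → g p = 0) →
      (∀ (i j : Fin 4) (hij : i < j),
        ∑ p ∈ S, (if p.2 = ⟨(i, j), hij⟩ then g p else 0) = 0) →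
      ∀ ε : ℝ, 0 < ε →
        ∃ (S' : Finset (Literature.MathematicalPhysics.QuantumLattice.ZdPlaquette 4))
          (E : Finset (Literature.MathematicalPhysics.QuantumLattice.ZdEdge 4))
          (α : Literature.MathematicalPhysics.QuantumLattice.ZdEdge 4 → ℝ)
          (K : Finset (Literature.Probability.LatticeModels.Site 4 × Fin 4 × Fin 4 × Fin 4))
          (r : Literature.Probability.LatticeModels.Site 4 × Fin 4 × Fin 4 × Fin 4 → ℝ),
          S ⊆ S' ∧ (∀ e, e ∉ E → α e = 0) ∧
          (∀ p, p ∉ S' → Literature.MathematicalPhysics.QuantumFieldTheory.plaquetteCurl α p = 0) ∧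
          (∀ κ ∈ K, κ.2.1 < κ.2.2.1 ∧ κ.2.2.1 < κ.2.2.2 ∧
            ∀ p : Literature.MathematicalPhysics.QuantumLattice.ZdPlaquette 4,
              (fun (κ : Literature.Probability.LatticeModels.Site 4 × Fin 4 × Fin 4 × Fin 4)
                  (p : Literature.MathematicalPhysics.QuantumLattice.ZdPlaquette 4) =>
                if hκ : κ.2.1 < κ.2.2.1 ∧ κ.2.2.1 < κ.2.2.2 then
                  ((if p = (κ.1 + Pi.single κ.2.1 1, ⟨(κ.2.2.1, κ.2.2.2), hκ.2⟩) then (1 : ℝ) else 0) -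
                    (if p = (κ.1, ⟨(κ.2.2.1, κ.2.2.2), hκ.2⟩) then (1 : ℝ) else 0) -
                    (if p = (κ.1 + Pi.single κ.2.2.1 1, ⟨(κ.2.1, κ.2.2.2), hκ.1.trans hκ.2⟩) then (1 : ℝ) else 0) +
                    (if p = (κ.1, ⟨(κ.2.1, κ.2.2.2), hκ.1.trans hκ.2⟩) then (1 : ℝ) else 0) +
                    (if p = (κ.1 + Pi.single κ.2.2.2 1, ⟨(κ.2.1, κ.2.2.1), hκ.1⟩) then (1 : ℝ) else 0) -
                    (if p = (κ.1, ⟨(κ.2.1, κ.2.2.1), hκ.1⟩) then (1 : ℝ) else 0))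
                else 0) κ p ≠ 0 → p ∈ S') ∧
          ∑ p ∈ S', |g p - Literature.MathematicalPhysics.QuantumFieldTheory.plaquetteCurl α p -
              ∑ κ ∈ K, r κ *
                (fun (κ : Literature.Probability.LatticeModels.Site 4 × Fin 4 × Fin 4 × Fin 4)
                    (p : Literature.MathematicalPhysics.QuantumLattice.ZdPlaquette 4) =>
                  if hκ : κ.2.1 < κ.2.2.1 ∧ κ.2.2.1 < κ.2.2.2 then
                    ((if p = (κ.1 + Pi.single κ.2.1 1, ⟨(κ.2.2.1, κ.2.2.2), hκ.2⟩) then (1 : ℝ) else 0) -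
                      (if p = (κ.1, ⟨(κ.2.2.1, κ.2.2.2), hκ.2⟩) then (1 : ℝ) else 0) -
                      (if p = (κ.1 + Pi.single κ.2.2.1 1, ⟨(κ.2.1, κ.2.2.2), hκ.1.trans hκ.2⟩) then (1 : ℝ) else 0) +
                      (if p = (κ.1, ⟨(κ.2.1, κ.2.2.2), hκ.1.trans hκ.2⟩) then (1 : ℝ) else 0) +
                      (if p = (κ.1 + Pi.single κ.2.2.2 1, ⟨(κ.2.1, κ.2.2.1), hκ.1⟩) then (1 : ℝ) else 0) -
                      (if p = (κ.1, ⟨(κ.2.1, κ.2.2.1), hκ.1⟩) then (1 : ℝ) else 0))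
                  else 0) κ p| < ε) →
    ∀ (D : ℕ) (τ : MeasureTheory.Measure
        (Literature.MathematicalPhysics.QuantumLattice.ZdPlaquette 4 → Fin D → ℝ)),
      MeasureTheory.IsProbabilityMeasure τ →
      (∀ (p : Literature.MathematicalPhysics.QuantumLattice.ZdPlaquette 4) (a : Fin D),
        MeasureTheory.Integrable (fun Y : Literature.MathematicalPhysics.QuantumLattice.ZdPlaquette 4 → Fin D → ℝ => Y p a) τ) →
      (∀ (x : Literature.Probability.LatticeModels.Site 4) (i j k : Fin 4)
          (hij : i < j) (hjk : j < k) (a : Fin D),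
        ∀ᵐ Y ∂τ,
          (Y (x + Pi.single i 1, ⟨(j, k), hjk⟩) a - Y (x, ⟨(j, k), hjk⟩) a) -
            (Y (x + Pi.single j 1, ⟨(i, k), hij.trans hjk⟩) a -
              Y (x, ⟨(i, k), hij.trans hjk⟩) a) +
            (Y (x + Pi.single k 1, ⟨(i, j), hij⟩) a - Y (x, ⟨(i, j), hij⟩) a) = 0) →
      (∃ B : ℝ, ∀ (p : Literature.MathematicalPhysics.QuantumLattice.ZdPlaquette 4) (a : Fin D),
          MeasureTheory.Integrable (fun Y => (Y p a) ^ 2) τ ∧ ∫ Y, (Y p a) ^ 2 ∂τ ≤ B) →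
      (∀ (S : Finset (Literature.MathematicalPhysics.QuantumLattice.ZdPlaquette 4))
          (E : Finset (Literature.MathematicalPhysics.QuantumLattice.ZdEdge 4))
          (h : Literature.MathematicalPhysics.QuantumLattice.ZdPlaquette 4 → Fin D → ℝ)
          (α : Literature.MathematicalPhysics.QuantumLattice.ZdEdge 4 → Fin D → ℝ),
        (∀ e, e ∉ E → α e = 0) →
        (∀ p, p ∉ S → ∀ a : Fin D,
          Literature.MathematicalPhysics.QuantumFieldTheory.plaquetteCurl (fun e => α e a) p = 0) →
        (∫ Y, Real.cos (∑ p ∈ S, ∑ a : Fin D, h p a * Y p a) *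
            (∑ p ∈ S, ∑ a : Fin D,
              Literature.MathematicalPhysics.QuantumFieldTheory.plaquetteCurl
                (fun e => α e a) p * Y p a) ∂τ =
          -(∑ p ∈ S, ∑ a : Fin D,
              Literature.MathematicalPhysics.QuantumFieldTheory.plaquetteCurl
                (fun e => α e a) p * h p a) *
            ∫ Y, Real.sin (∑ p ∈ S, ∑ a : Fin D, h p a * Y p a) ∂τ) ∧
        (∫ Y, Real.sin (∑ p ∈ S, ∑ a : Fin D, h p a * Y p a) *
            (∑ p ∈ S, ∑ a : Fin D,
              Literature.MathematicalPhysics.QuantumFieldTheory.plaquetteCurl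
                (fun e => α e a) p * Y p a) ∂τ =
          (∑ p ∈ S, ∑ a : Fin D,
              Literature.MathematicalPhysics.QuantumFieldTheory.plaquetteCurl
                (fun e => α e a) p * h p a) *
            ∫ Y, Real.cos (∑ p ∈ S, ∑ a : Fin D, h p a * Y p a) ∂τ)) →
      ∀ (S : Finset (Literature.MathematicalPhysics.QuantumLattice.ZdPlaquette 4))
          (h h' : Literature.MathematicalPhysics.QuantumLattice.ZdPlaquette 4 → Fin D → ℝ),
        (∀ (i j : Fin 4) (hij : i < j) (a : Fin D),
          ∑ p ∈ S, (if p.2 = ⟨(i, j), hij⟩ then h p a else 0) =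
            ∑ p ∈ S, (if p.2 = ⟨(i, j), hij⟩ then h' p a else 0)) →
        (Real.exp ((∑ p ∈ S, ∑ q ∈ S, ∑ a : Fin D,
              h p a * h q a * Literature.MathematicalPhysics.QuantumFieldTheory.curvatureTwoPoint p q) / 2) *
            ∫ Y, Real.cos (∑ p ∈ S, ∑ a : Fin D, h p a * Y p a) ∂τ =
          Real.exp ((∑ p ∈ S, ∑ q ∈ S, ∑ a : Fin D,
              h' p a * h' q a * Literature.MathematicalPhysics.QuantumFieldTheory.curvatureTwoPoint p q) / 2) *
            ∫ Y, Real.cos (∑ p ∈ S, ∑ a : Fin D, h' p a * Y p a) ∂τ) ∧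
        (Real.exp ((∑ p ∈ S, ∑ q ∈ S, ∑ a : Fin D,
              h p a * h q a * Literature.MathematicalPhysics.QuantumFieldTheory.curvatureTwoPoint p q) / 2) *
            ∫ Y, Real.sin (∑ p ∈ S, ∑ a : Fin D, h p a * Y p a) ∂τ =
          Real.exp ((∑ p ∈ S, ∑ q ∈ S, ∑ a : Fin D,
              h' p a * h' q a * Literature.MathematicalPhysics.QuantumFieldTheory.curvatureTwoPoint p q) / 2) *
            ∫ Y, Real.sin (∑ p ∈ S, ∑ a : Fin D, h' p a * Y p a) ∂τ) :=
  Summit.QuantumFields.YangMills.Theorems.EquipartitionPinsProbe.stub_factorization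

/-- STUB F6 — **second moments from the characteristic function**: for a square-integrable pairing
`X = ⟨Y,h⟩_S`, `(1 − E cos(sX))/s² → E X²/2` as `s → 0`, `s ≠ 0` (dominated convergence with
`0 ≤ 1 − cos u ≤ u²/2` and `|cos u − (1 − u²/2)| ≤ (5/96)|u|⁴` for `|u| ≤ 1`, `Real.cos_bound`). -/
theorem stub_cosMoment :
    ∀ (D : ℕ) (τ : MeasureTheory.Measure
        (Literature.MathematicalPhysics.QuantumLattice.ZdPlaquette 4 → Fin D → ℝ)),
      MeasureTheory.IsProbabilityMeasure τ →
      (∀ (p : Literature.MathematicalPhysics.QuantumLattice.ZdPlaquette 4) (a : Fin D),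
        MeasureTheory.Integrable (fun Y => (Y p a) ^ 2) τ) →
      ∀ (S : Finset (Literature.MathematicalPhysics.QuantumLattice.ZdPlaquette 4))
        (h : Literature.MathematicalPhysics.QuantumLattice.ZdPlaquette 4 → Fin D → ℝ),
        Filter.Tendsto (fun s : ℝ =>
            (1 - ∫ Y, Real.cos (s * ∑ p ∈ S, ∑ a : Fin D, h p a * Y p a) ∂τ) / s ^ 2)
          (nhdsWithin 0 {(0 : ℝ)}ᶜ)
          (nhds ((∫ Y, (∑ p ∈ S, ∑ a : Fin D, h p a * Y p a) ^ 2 ∂τ) / 2)) :=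
  Summit.QuantumFields.YangMills.Theorems.EquipartitionPinsProbe.stub_cosMoment

/-- STUB R — **rigidity of the lattice Maxwell field under the equipartition budget** (pure
probability; the identification half of the local law). GIVEN the conclusion of STUB F5
(factorization of `Ψ = e^{Q/2}Φ_τ` through the plane–colour sums), STUB F6 (second moments from the
characteristic function), STUB R4 (line variance, landed p113292) and STUB R6 (Gaussian
identification, landed p112870): every probability measure `τ` on `ℝ^D`-valued 2-cochains of `ℤ⁴`
with (T1) closedness, (T2) uniformly bounded second moments and the budget
`∑_{i<j}∑_a E(Y^a_{(0;i,j)})² ≤ 3D`, (T3) the Stein identity, IS `curvatureGaussianField 4 D`.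
Route (held by the lead): for a plaquette indicator `δ` and its line averages `h_L` (same
plane–colour sums), F5 + F6 give `E(Y_p^a)² − T(p,p) = E⟨Y,h_L⟩² − Q(h_L) ≥ −Q(h_L) → 0` (R4), so
`E(Y^a_{(0;i,j)})² ≥ ½` for all six planes and `D` colours; the budget forces equality, hence
`E⟨Y,h_L⟩² = Q(h_L) → 0`; for a general `h` the `k`-weighted line averages `g_L` have the same
plane–colour sums, `E⟨Y,g_L⟩² → 0` and `Q(g_L) → 0` (Cauchy–Schwarz; `Q` is positive semidefinite),
so `Ψ(h) = lim Ψ(g_L) = (1, 0)`, i.e. `E cos⟨Y,h⟩ = e^{−Q(h)/2}`, `E sin⟨Y,h⟩ = 0`, and R6 concludes. -/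
theorem stub_rigidity :
    -- (F5, conclusion)
    (∀ (D : ℕ) (τ : MeasureTheory.Measure
        (Literature.MathematicalPhysics.QuantumLattice.ZdPlaquette 4 → Fin D → ℝ)),
      MeasureTheory.IsProbabilityMeasure τ →
      (∀ (p : Literature.MathematicalPhysics.QuantumLattice.ZdPlaquette 4) (a : Fin D),
        MeasureTheory.Integrable (fun Y : Literature.MathematicalPhysics.QuantumLattice.ZdPlaquette 4 → Fin D → ℝ => Y p a) τ) →
      (∀ (x : Literature.Probability.LatticeModels.Site 4) (i j k : Fin 4)
          (hij : i < j) (hjk : j < k) (a : Fin D),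
        ∀ᵐ Y ∂τ,
          (Y (x + Pi.single i 1, ⟨(j, k), hjk⟩) a - Y (x, ⟨(j, k), hjk⟩) a) -
            (Y (x + Pi.single j 1, ⟨(i, k), hij.trans hjk⟩) a -
              Y (x, ⟨(i, k), hij.trans hjk⟩) a) +
            (Y (x + Pi.single k 1, ⟨(i, j), hij⟩) a - Y (x, ⟨(i, j), hij⟩) a) = 0) →
      (∃ B : ℝ, ∀ (p : Literature.MathematicalPhysics.QuantumLattice.ZdPlaquette 4) (a : Fin D),
          MeasureTheory.Integrable (fun Y => (Y p a) ^ 2) τ ∧ ∫ Y, (Y p a) ^ 2 ∂τ ≤ B) →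
      (∀ (S : Finset (Literature.MathematicalPhysics.QuantumLattice.ZdPlaquette 4))
          (E : Finset (Literature.MathematicalPhysics.QuantumLattice.ZdEdge 4))
          (h : Literature.MathematicalPhysics.QuantumLattice.ZdPlaquette 4 → Fin D → ℝ)
          (α : Literature.MathematicalPhysics.QuantumLattice.ZdEdge 4 → Fin D → ℝ),
        (∀ e, e ∉ E → α e = 0) →
        (∀ p, p ∉ S → ∀ a : Fin D,
          Literature.MathematicalPhysics.QuantumFieldTheory.plaquetteCurl (fun e => α e a) p = 0) →
        (∫ Y, Real.cos (∑ p ∈ S, ∑ a : Fin D, h p a * Y p a) *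
            (∑ p ∈ S, ∑ a : Fin D,
              Literature.MathematicalPhysics.QuantumFieldTheory.plaquetteCurl
                (fun e => α e a) p * Y p a) ∂τ =
          -(∑ p ∈ S, ∑ a : Fin D,
              Literature.MathematicalPhysics.QuantumFieldTheory.plaquetteCurl
                (fun e => α e a) p * h p a) *
            ∫ Y, Real.sin (∑ p ∈ S, ∑ a : Fin D, h p a * Y p a) ∂τ) ∧
        (∫ Y, Real.sin (∑ p ∈ S, ∑ a : Fin D, h p a * Y p a) *
            (∑ p ∈ S, ∑ a : Fin D,
              Literature.MathematicalPhysics.QuantumFieldTheory.plaquetteCurl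
                (fun e => α e a) p * Y p a) ∂τ =
          (∑ p ∈ S, ∑ a : Fin D,
              Literature.MathematicalPhysics.QuantumFieldTheory.plaquetteCurl
                (fun e => α e a) p * h p a) *
            ∫ Y, Real.cos (∑ p ∈ S, ∑ a : Fin D, h p a * Y p a) ∂τ)) →
      ∀ (S : Finset (Literature.MathematicalPhysics.QuantumLattice.ZdPlaquette 4))
          (h h' : Literature.MathematicalPhysics.QuantumLattice.ZdPlaquette 4 → Fin D → ℝ),
        (∀ (i j : Fin 4) (hij : i < j) (a : Fin D),
          ∑ p ∈ S, (if p.2 = ⟨(i, j), hij⟩ then h p a else 0) =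
            ∑ p ∈ S, (if p.2 = ⟨(i, j), hij⟩ then h' p a else 0)) →
        (Real.exp ((∑ p ∈ S, ∑ q ∈ S, ∑ a : Fin D,
              h p a * h q a * Literature.MathematicalPhysics.QuantumFieldTheory.curvatureTwoPoint p q) / 2) *
            ∫ Y, Real.cos (∑ p ∈ S, ∑ a : Fin D, h p a * Y p a) ∂τ =
          Real.exp ((∑ p ∈ S, ∑ q ∈ S, ∑ a : Fin D,
              h' p a * h' q a * Literature.MathematicalPhysics.QuantumFieldTheory.curvatureTwoPoint p q) / 2) *
            ∫ Y, Real.cos (∑ p ∈ S, ∑ a : Fin D, h' p a * Y p a) ∂τ) ∧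
        (Real.exp ((∑ p ∈ S, ∑ q ∈ S, ∑ a : Fin D,
              h p a * h q a * Literature.MathematicalPhysics.QuantumFieldTheory.curvatureTwoPoint p q) / 2) *
            ∫ Y, Real.sin (∑ p ∈ S, ∑ a : Fin D, h p a * Y p a) ∂τ =
          Real.exp ((∑ p ∈ S, ∑ q ∈ S, ∑ a : Fin D,
              h' p a * h' q a * Literature.MathematicalPhysics.QuantumFieldTheory.curvatureTwoPoint p q) / 2) *
            ∫ Y, Real.sin (∑ p ∈ S, ∑ a : Fin D, h' p a * Y p a) ∂τ)) →
    -- (F6)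
    (∀ (D : ℕ) (τ : MeasureTheory.Measure
        (Literature.MathematicalPhysics.QuantumLattice.ZdPlaquette 4 → Fin D → ℝ)),
      MeasureTheory.IsProbabilityMeasure τ →
      (∀ (p : Literature.MathematicalPhysics.QuantumLattice.ZdPlaquette 4) (a : Fin D),
        MeasureTheory.Integrable (fun Y => (Y p a) ^ 2) τ) →
      ∀ (S : Finset (Literature.MathematicalPhysics.QuantumLattice.ZdPlaquette 4))
        (h : Literature.MathematicalPhysics.QuantumLattice.ZdPlaquette 4 → Fin D → ℝ),
        Filter.Tendsto (fun s : ℝ =>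
            (1 - ∫ Y, Real.cos (s * ∑ p ∈ S, ∑ a : Fin D, h p a * Y p a) ∂τ) / s ^ 2)
          (nhdsWithin 0 {(0 : ℝ)}ᶜ)
          (nhds ((∫ Y, (∑ p ∈ S, ∑ a : Fin D, h p a * Y p a) ^ 2 ∂τ) / 2))) →
    -- (R4)
    (∀ (i j : Fin 4) (hij : i < j),
      Filter.Tendsto (fun L : ℕ =>
          (∑ s ∈ Finset.range L, ∑ t ∈ Finset.range L,
            Literature.MathematicalPhysics.QuantumFieldTheory.curvatureTwoPoint
              ((Pi.single (0 : Fin 4) (s : ℤ) : Literature.Probability.LatticeModels.Site 4), ⟨(i, j), hij⟩)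
              ((Pi.single (0 : Fin 4) (t : ℤ) : Literature.Probability.LatticeModels.Site 4), ⟨(i, j), hij⟩)) /
            ((L : ℝ) ^ 2))
        Filter.atTop (nhds 0)) →
    -- (R6)
    (∀ (D : ℕ) (τ : MeasureTheory.Measure
        (Literature.MathematicalPhysics.QuantumLattice.ZdPlaquette 4 → Fin D → ℝ)),
      MeasureTheory.IsProbabilityMeasure τ →
      (∀ (S : Finset (Literature.MathematicalPhysics.QuantumLattice.ZdPlaquette 4))
          (h : Literature.MathematicalPhysics.QuantumLattice.ZdPlaquette 4 → Fin D → ℝ),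
        (∫ Y, Real.cos (∑ p ∈ S, ∑ a : Fin D, h p a * Y p a) ∂τ =
          Real.exp (-(∑ p ∈ S, ∑ q ∈ S, ∑ a : Fin D,
            h p a * h q a * Literature.MathematicalPhysics.QuantumFieldTheory.curvatureTwoPoint p q) / 2)) ∧
        (∫ Y, Real.sin (∑ p ∈ S, ∑ a : Fin D, h p a * Y p a) ∂τ = 0)) →
      τ = Literature.MathematicalPhysics.QuantumFieldTheory.curvatureGaussianField 4 D) →
    -- (R)
    ∀ (D : ℕ) (τ : MeasureTheory.Measure
        (Literature.MathematicalPhysics.QuantumLattice.ZdPlaquette 4 → Fin D → ℝ)),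
      MeasureTheory.IsProbabilityMeasure τ →
      (∀ (x : Literature.Probability.LatticeModels.Site 4) (i j k : Fin 4)
          (hij : i < j) (hjk : j < k) (a : Fin D),
        ∀ᵐ Y ∂τ,
          (Y (x + Pi.single i 1, ⟨(j, k), hjk⟩) a - Y (x, ⟨(j, k), hjk⟩) a) -
            (Y (x + Pi.single j 1, ⟨(i, k), hij.trans hjk⟩) a -
              Y (x, ⟨(i, k), hij.trans hjk⟩) a) +
            (Y (x + Pi.single k 1, ⟨(i, j), hij⟩) a - Y (x, ⟨(i, j), hij⟩) a) = 0) →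
      ((∃ B : ℝ, ∀ (p : Literature.MathematicalPhysics.QuantumLattice.ZdPlaquette 4) (a : Fin D),
          MeasureTheory.Integrable (fun Y => (Y p a) ^ 2) τ ∧ ∫ Y, (Y p a) ^ 2 ∂τ ≤ B) ∧
        (∑ i : Fin 4, ∑ j : Fin 4, ∑ a : Fin D,
          if hij : i < j then ∫ Y, (Y ((0 : Literature.Probability.LatticeModels.Site 4),
            ⟨(i, j), hij⟩) a) ^ 2 ∂τ else 0) ≤ 3 * D) →
      (∀ (S : Finset (Literature.MathematicalPhysics.QuantumLattice.ZdPlaquette 4))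
          (E : Finset (Literature.MathematicalPhysics.QuantumLattice.ZdEdge 4))
          (h : Literature.MathematicalPhysics.QuantumLattice.ZdPlaquette 4 → Fin D → ℝ)
          (α : Literature.MathematicalPhysics.QuantumLattice.ZdEdge 4 → Fin D → ℝ),
        (∀ e, e ∉ E → α e = 0) →
        (∀ p, p ∉ S → ∀ a : Fin D,
          Literature.MathematicalPhysics.QuantumFieldTheory.plaquetteCurl (fun e => α e a) p = 0) →
        (∫ Y, Real.cos (∑ p ∈ S, ∑ a : Fin D, h p a * Y p a) *
            (∑ p ∈ S, ∑ a : Fin D,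
              Literature.MathematicalPhysics.QuantumFieldTheory.plaquetteCurl
                (fun e => α e a) p * Y p a) ∂τ =
          -(∑ p ∈ S, ∑ a : Fin D,
              Literature.MathematicalPhysics.QuantumFieldTheory.plaquetteCurl
                (fun e => α e a) p * h p a) *
            ∫ Y, Real.sin (∑ p ∈ S, ∑ a : Fin D, h p a * Y p a) ∂τ) ∧
        (∫ Y, Real.sin (∑ p ∈ S, ∑ a : Fin D, h p a * Y p a) *
            (∑ p ∈ S, ∑ a : Fin D,
              Literature.MathematicalPhysics.QuantumFieldTheory.plaquetteCurl
                (fun e => α e a) p * Y p a) ∂τ =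
          (∑ p ∈ S, ∑ a : Fin D,
              Literature.MathematicalPhysics.QuantumFieldTheory.plaquetteCurl
                (fun e => α e a) p * h p a) *
            ∫ Y, Real.cos (∑ p ∈ S, ∑ a : Fin D, h p a * Y p a) ∂τ)) →
      τ = Literature.MathematicalPhysics.QuantumFieldTheory.curvatureGaussianField 4 D:=
  Summit.QuantumFields.YangMills.Theorems.EquipartitionPinsProbe.stub_rigidity

/-- STUB 2b (LANDED p107617) — **the free-gluon profile (2 × 2 Gaussian determinant)**. -/
theorem stub_gaussianProfile :
    ∀ (D n : ℕ),
      (∫ Y, Real.exp (-(∑ a : Fin D,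
            (Y (Literature.MathematicalPhysics.QuantumFieldTheory.plaquette12 (d := 4)
              (by norm_num) 0) a) ^ 2)) *
          Real.exp (-(∑ a : Fin D,
            (Y (Literature.MathematicalPhysics.QuantumFieldTheory.plaquette12 (d := 4)
              (by norm_num) (Pi.single (0 : Fin 4) (n : ℤ) :
                Literature.Probability.LatticeModels.Site 4)) a) ^ 2))
          ∂(Literature.MathematicalPhysics.QuantumFieldTheory.curvatureGaussianField 4 D)) -
        (∫ Y, Real.exp (-(∑ a : Fin D,
            (Y (Literature.MathematicalPhysics.QuantumFieldTheory.plaquette12 (d := 4)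
              (by norm_num) 0) a) ^ 2))
          ∂(Literature.MathematicalPhysics.QuantumFieldTheory.curvatureGaussianField 4 D)) *
        (∫ Y, Real.exp (-(∑ a : Fin D,
            (Y (Literature.MathematicalPhysics.QuantumFieldTheory.plaquette12 (d := 4)
              (by norm_num) (Pi.single (0 : Fin 4) (n : ℤ) :
                Literature.Probability.LatticeModels.Site 4)) a) ^ 2))
          ∂(Literature.MathematicalPhysics.QuantumFieldTheory.curvatureGaussianField 4 D)) =
      (2 : ℝ) ^ (-(D : ℝ)) *
        ((1 - (Literature.MathematicalPhysics.QuantumFieldTheory.curvaturePlaquetteCorr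
            (d := 4) (by norm_num) (n : ℤ)) ^ 2) ^ (-((D : ℝ) / 2)) - 1) :=
  Summit.QuantumFields.YangMills.Theorems.EquipartitionPinsProbe.stub_gaussianProfile

/-- STUB 3 (LANDED p107700) — **`c_n` is a second difference of the axis Green function**. -/
theorem stub_secondDifference :
    ∀ n : ℤ, n ≠ 0 →
      Literature.MathematicalPhysics.QuantumFieldTheory.curvaturePlaquetteCorr (d := 4) (by norm_num) n =
        (1 / 3 : ℝ) *
          (Literature.Probability.LatticeModels.latticeGreen
              (Pi.single (0 : Fin 4) (n + 1) : Literature.Probability.LatticeModels.Site 4) +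
            Literature.Probability.LatticeModels.latticeGreen
              (Pi.single (0 : Fin 4) (n - 1) : Literature.Probability.LatticeModels.Site 4) -
            2 * Literature.Probability.LatticeModels.latticeGreen
              (Pi.single (0 : Fin 4) n : Literature.Probability.LatticeModels.Site 4)) :=
  Summit.QuantumFields.YangMills.Theorems.EquipartitionPinsProbe.stub_secondDifference

/-- STUB 4 (LANDED p103989) — **the Poisson-kernel integral**. -/
theorem stub_poissonIntegral :
    ∀ a : ℝ, 1 < a → ∀ n : ℕ,
      ∫ θ in (-Real.pi)..Real.pi, Real.cos (n * θ) / (a - Real.cos θ) =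
        2 * Real.pi * (a - Real.sqrt (a ^ 2 - 1)) ^ n / Real.sqrt (a ^ 2 - 1) :=
  Summit.QuantumFields.YangMills.Theorems.EquipartitionPinsProbe.stub_poissonIntegral

/-- STUB 5 (LANDED p105895) — **mixed representation of the axis second difference**. -/
theorem stub_axisFourier :
    (∀ a : ℝ, 1 < a → ∀ n : ℕ,
      ∫ θ in (-Real.pi)..Real.pi, Real.cos (n * θ) / (a - Real.cos θ) =
        2 * Real.pi * (a - Real.sqrt (a ^ 2 - 1)) ^ n / Real.sqrt (a ^ 2 - 1)) →
    ∀ n : ℤ, n ≠ 0 →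
      Literature.Probability.LatticeModels.latticeGreen
          (Pi.single (0 : Fin 4) (n + 1) : Literature.Probability.LatticeModels.Site 4) +
        Literature.Probability.LatticeModels.latticeGreen
          (Pi.single (0 : Fin 4) (n - 1) : Literature.Probability.LatticeModels.Site 4) -
        2 * Literature.Probability.LatticeModels.latticeGreen
          (Pi.single (0 : Fin 4) n : Literature.Probability.LatticeModels.Site 4) =
      2 / (2 * Real.pi) ^ 3 *
        ∫ k in Literature.Probability.LatticeModels.brillouin 3,
          Real.sqrt (Literature.Probability.LatticeModels.dispersion k /
              (Literature.Probability.LatticeModels.dispersion k + 2)) *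
            (1 + Literature.Probability.LatticeModels.dispersion k -
              Real.sqrt (Literature.Probability.LatticeModels.dispersion k *
                (Literature.Probability.LatticeModels.dispersion k + 2))) ^ n.natAbs :=
  Summit.QuantumFields.YangMills.Theorems.EquipartitionPinsProbe.stub_axisFourier

/-- STUB 6 (LANDED p106718) — **positivity, boundedness and sub-exponential decay of `J_n`**. -/
theorem stub_profile :
    (∀ n : ℕ,
      0 < ∫ k in Literature.Probability.LatticeModels.brillouin 3,
          Real.sqrt (Literature.Probability.LatticeModels.dispersion k /
              (Literature.Probability.LatticeModels.dispersion k + 2)) *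
            (1 + Literature.Probability.LatticeModels.dispersion k -
              Real.sqrt (Literature.Probability.LatticeModels.dispersion k *
                (Literature.Probability.LatticeModels.dispersion k + 2))) ^ n ∧
      (∫ k in Literature.Probability.LatticeModels.brillouin 3,
          Real.sqrt (Literature.Probability.LatticeModels.dispersion k /
              (Literature.Probability.LatticeModels.dispersion k + 2)) *
            (1 + Literature.Probability.LatticeModels.dispersion k -
              Real.sqrt (Literature.Probability.LatticeModels.dispersion k *
                (Literature.Probability.LatticeModels.dispersion k + 2))) ^ n) ≤
        (2 * Real.pi) ^ 3) ∧
    (∀ ε : ℝ, 0 < ε → ∃ C : ℝ, 0 < C ∧ ∀ n : ℕ,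
      C * Real.exp (-(ε * n)) ≤
        ∫ k in Literature.Probability.LatticeModels.brillouin 3,
          Real.sqrt (Literature.Probability.LatticeModels.dispersion k /
              (Literature.Probability.LatticeModels.dispersion k + 2)) *
            (1 + Literature.Probability.LatticeModels.dispersion k -
              Real.sqrt (Literature.Probability.LatticeModels.dispersion k *
                (Literature.Probability.LatticeModels.dispersion k + 2))) ^ n) :=
  Summit.QuantumFields.YangMills.Theorems.EquipartitionPinsProbe.stub_profile

/-! ## §2 The local free-gluon law from STUB T and STUB R (soft: compactness + contradiction) -/

open Literature.Probability.LatticeModels Literature.MathematicalPhysics.QuantumFieldTheory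
open Literature.MathematicalPhysics.QuantumLattice

/-- `3 ≤ 4`. -/
theorem three_le_four : 3 ≤ 4 := by norm_num

/-- Plaquette observables of a translated configuration: `O_{(x;i,j)}(θ_v U) = O_{(x−v;i,j)} U`. -/
theorem plaquetteObs_configShift' {G : Type} [Group G] [MeasurableSpace G] {N d : ℕ}
    (ρ : G →* Matrix (Fin N) (Fin N) ℂ) (v x : Site d) (i j : Fin d) (U : LGConfig d G) :
    plaquetteObs ρ x i j (configShift v U) = plaquetteObs ρ (x - v) i j U := by
  simp only [plaquetteObs, plaquetteHolonomyZd,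
    Literature.MathematicalPhysics.QuantumLattice.configShift_apply, add_sub_right_comm]

/-- The probe `ψ(u) = exp(−2u₊)` at `u = s/2`, `s ≥ 0`, is `exp(−s)`. -/
theorem probe_half {s : ℝ} (hs : 0 ≤ s) : Real.exp (-2 * max ((1 / 2 : ℝ) * s) 0) = Real.exp (-s) := by
  rw [max_eq_left (by positivity)]
  congr 1
  ring

/-- The statement of the LOCAL FREE-GLUON LAW in its two-plaquette gauge-invariant shadow (formerly
the registered stub `stub_localLaw`; now a theorem of this skeleton, `localLaw`). -/
def LocalLaw : Prop :=
  ∀ (G : Type) [Group G] [TopologicalSpace G] [IsTopologicalGroup G] [CompactSpace G],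
    Literature.MathematicalPhysics.QuantumFieldTheory.IsCompactSimpleLieGroup G →
    letI : MeasurableSpace G := borel G
    haveI : BorelSpace G := ⟨rfl⟩
    ∀ r : Literature.MathematicalPhysics.QuantumFieldTheory.LatticeRep G,
      (∀ ε : ℝ, 0 < ε → ∀ᶠ β : ℝ in Filter.atTop,
        ∀ μ ∈ Literature.MathematicalPhysics.QuantumLattice.infiniteVolumeLimitPoints
            (d := 4) r.ρ β,
          |β * (∫ U, (∑ i : Fin 4, ∑ j : Fin 4,
              if i < j then ((r.N : ℝ) -
                Literature.MathematicalPhysics.QuantumLattice.plaquetteObs r.ρ 0 i j U) else 0) ∂μ) -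
            3 * (Module.finrank ℝ ↥(Submodule.span ℝ {X : Matrix (Fin r.N) (Fin r.N) ℂ |
              ∀ t : ℝ, NormedSpace.exp ((t : ℂ) • X) ∈ Set.range r.ρ}) : ℝ) / 2| < ε) →
      ∃ D : ℕ, 0 < D ∧
        ∀ (n : ℕ) (ε : ℝ), 0 < ε → ∀ᶠ β : ℝ in Filter.atTop,
          ∀ μ ∈ Literature.MathematicalPhysics.QuantumLattice.infiniteVolumeLimitPoints
              (d := 4) r.ρ β,
            |(∫ U, Real.exp (-2 * max (β * ((r.N : ℝ) -
                  Literature.MathematicalPhysics.QuantumLattice.plaquetteObs r.ρ 0 1 2 U)) 0) *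
                Real.exp (-2 * max (β * ((r.N : ℝ) -
                  Literature.MathematicalPhysics.QuantumLattice.plaquetteObs r.ρ 0 1 2
                    (Literature.MathematicalPhysics.QuantumLattice.configShift
                      (-(Pi.single 0 (n : ℤ))) U))) 0) ∂μ) -
              (∫ U, Real.exp (-2 * max (β * ((r.N : ℝ) -
                  Literature.MathematicalPhysics.QuantumLattice.plaquetteObs r.ρ 0 1 2 U)) 0) ∂μ) *
              (∫ U, Real.exp (-2 * max (β * ((r.N : ℝ) -
                  Literature.MathematicalPhysics.QuantumLattice.plaquetteObs r.ρ 0 1 2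
                    (Literature.MathematicalPhysics.QuantumLattice.configShift
                      (-(Pi.single 0 (n : ℤ))) U))) 0) ∂μ) -
              ((∫ Y, Real.exp (-(∑ a : Fin D,
                    (Y (Literature.MathematicalPhysics.QuantumFieldTheory.plaquette12 (d := 4)
                      (by norm_num) 0) a) ^ 2)) *
                  Real.exp (-(∑ a : Fin D,
                    (Y (Literature.MathematicalPhysics.QuantumFieldTheory.plaquette12 (d := 4)
                      (by norm_num) (Pi.single (0 : Fin 4) (n : ℤ) :
                        Literature.Probability.LatticeModels.Site 4)) a) ^ 2))
                  ∂(Literature.MathematicalPhysics.QuantumFieldTheory.curvatureGaussianField 4 D)) -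
                (∫ Y, Real.exp (-(∑ a : Fin D,
                    (Y (Literature.MathematicalPhysics.QuantumFieldTheory.plaquette12 (d := 4)
                      (by norm_num) 0) a) ^ 2))
                  ∂(Literature.MathematicalPhysics.QuantumFieldTheory.curvatureGaussianField 4 D)) *
                (∫ Y, Real.exp (-(∑ a : Fin D,
                    (Y (Literature.MathematicalPhysics.QuantumFieldTheory.plaquette12 (d := 4)
                      (by norm_num) (Pi.single (0 : Fin 4) (n : ℤ) :
                        Literature.Probability.LatticeModels.Site 4)) a) ^ 2))
                  ∂(Literature.MathematicalPhysics.QuantumFieldTheory.curvatureGaussianField 4 D)))| < ε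

/-- **The local free-gluon law from tangent laws (STUB T) and rigidity (STUB R's conclusion).**
Soft argument: if the conclusion failed for some `n, ε`, there would be `β_k → ∞` and torus-limit
states `μ_k` whose probe covariance stays `ε` away from the Gaussian one; STUB T extracts a
subsequence and a tangent law `τ` with (T0)–(T3); rigidity identifies `τ = curvatureGaussianField 4 D`;
then (T0), applied to the bounded continuous test functions `ψ(u₀)ψ(u₁)`, `ψ(u₀)`, `ψ(u₁)`
(`ψ(u) = e^{−2u₊}`, `ψ(½|y|²) = e^{−|y|²}`) at the two plaquettes `(0;1,2)`, `(ne₀;1,2)`, makes the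
probe covariances converge to the Gaussian one — contradiction. -/
theorem localLaw_of_tangent_of_rigidity
    (hT : ∀ (G : Type) [Group G] [TopologicalSpace G] [IsTopologicalGroup G] [CompactSpace G],
      Literature.MathematicalPhysics.QuantumFieldTheory.IsCompactSimpleLieGroup G →
      letI : MeasurableSpace G := borel G
      haveI : BorelSpace G := ⟨rfl⟩
      ∀ r : Literature.MathematicalPhysics.QuantumFieldTheory.LatticeRep G,
        (∀ ε : ℝ, 0 < ε → ∀ᶠ β : ℝ in Filter.atTop,
          ∀ μ ∈ Literature.MathematicalPhysics.QuantumLattice.infiniteVolumeLimitPoints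
              (d := 4) r.ρ β,
            |β * (∫ U, (∑ i : Fin 4, ∑ j : Fin 4,
                if i < j then ((r.N : ℝ) -
                  Literature.MathematicalPhysics.QuantumLattice.plaquetteObs r.ρ 0 i j U) else 0) ∂μ) -
              3 * (Module.finrank ℝ ↥(Submodule.span ℝ {X : Matrix (Fin r.N) (Fin r.N) ℂ |
                ∀ t : ℝ, NormedSpace.exp ((t : ℂ) • X) ∈ Set.range r.ρ}) : ℝ) / 2| < ε) →
        ∃ D : ℕ, 0 < D ∧
          ∀ (β : ℕ → ℝ)
            (μ : ℕ → MeasureTheory.Measure (Literature.MathematicalPhysics.QuantumLattice.LGConfig 4 G)),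
            Filter.Tendsto β Filter.atTop Filter.atTop →
            (∀ k, μ k ∈ Literature.MathematicalPhysics.QuantumLattice.infiniteVolumeLimitPoints
              (d := 4) r.ρ (β k)) →
            ∃ (φ : ℕ → ℕ) (τ : MeasureTheory.Measure
                (Literature.MathematicalPhysics.QuantumLattice.ZdPlaquette 4 → Fin D → ℝ)),
              StrictMono φ ∧ MeasureTheory.IsProbabilityMeasure τ ∧
              (∀ (m : ℕ) (p : Fin m → Literature.MathematicalPhysics.QuantumLattice.ZdPlaquette 4)
                  (f : (Fin m → ℝ) → ℝ), Continuous f → (∃ C : ℝ, ∀ v, |f v| ≤ C) →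
                Filter.Tendsto (fun j : ℕ => ∫ U, f (fun i => β (φ j) * ((r.N : ℝ) -
                    Literature.MathematicalPhysics.QuantumLattice.plaquetteObs r.ρ
                      (p i).1 (p i).2.1.1 (p i).2.1.2 U)) ∂(μ (φ j)))
                  Filter.atTop
                  (nhds (∫ Y, f (fun i => (1 / 2 : ℝ) * ∑ a : Fin D, (Y (p i) a) ^ 2) ∂τ))) ∧
              (∀ (x : Literature.Probability.LatticeModels.Site 4) (i j k : Fin 4)
                  (hij : i < j) (hjk : j < k) (a : Fin D),
                ∀ᵐ Y ∂τ,
                  (Y (x + Pi.single i 1, ⟨(j, k), hjk⟩) a - Y (x, ⟨(j, k), hjk⟩) a) -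
                    (Y (x + Pi.single j 1, ⟨(i, k), hij.trans hjk⟩) a -
                      Y (x, ⟨(i, k), hij.trans hjk⟩) a) +
                    (Y (x + Pi.single k 1, ⟨(i, j), hij⟩) a - Y (x, ⟨(i, j), hij⟩) a) = 0) ∧
              ((∃ B : ℝ, ∀ (p : Literature.MathematicalPhysics.QuantumLattice.ZdPlaquette 4)
                  (a : Fin D),
                  MeasureTheory.Integrable (fun Y => (Y p a) ^ 2) τ ∧ ∫ Y, (Y p a) ^ 2 ∂τ ≤ B) ∧
                (∑ i : Fin 4, ∑ j : Fin 4, ∑ a : Fin D,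
                  if hij : i < j then ∫ Y, (Y ((0 : Literature.Probability.LatticeModels.Site 4),
                    ⟨(i, j), hij⟩) a) ^ 2 ∂τ else 0) ≤ 3 * D) ∧
              (∀ (S : Finset (Literature.MathematicalPhysics.QuantumLattice.ZdPlaquette 4))
                  (E : Finset (Literature.MathematicalPhysics.QuantumLattice.ZdEdge 4))
                  (h : Literature.MathematicalPhysics.QuantumLattice.ZdPlaquette 4 → Fin D → ℝ)
                  (α : Literature.MathematicalPhysics.QuantumLattice.ZdEdge 4 → Fin D → ℝ),
                (∀ e, e ∉ E → α e = 0) →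
                (∀ p, p ∉ S → ∀ a : Fin D,
                  Literature.MathematicalPhysics.QuantumFieldTheory.plaquetteCurl
                    (fun e => α e a) p = 0) →
                (∫ Y, Real.cos (∑ p ∈ S, ∑ a : Fin D, h p a * Y p a) *
                    (∑ p ∈ S, ∑ a : Fin D,
                      Literature.MathematicalPhysics.QuantumFieldTheory.plaquetteCurl
                        (fun e => α e a) p * Y p a) ∂τ =
                  -(∑ p ∈ S, ∑ a : Fin D,
                      Literature.MathematicalPhysics.QuantumFieldTheory.plaquetteCurl
                        (fun e => α e a) p * h p a) *
                    ∫ Y, Real.sin (∑ p ∈ S, ∑ a : Fin D, h p a * Y p a) ∂τ) ∧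
                (∫ Y, Real.sin (∑ p ∈ S, ∑ a : Fin D, h p a * Y p a) *
                    (∑ p ∈ S, ∑ a : Fin D,
                      Literature.MathematicalPhysics.QuantumFieldTheory.plaquetteCurl
                        (fun e => α e a) p * Y p a) ∂τ =
                  (∑ p ∈ S, ∑ a : Fin D,
                      Literature.MathematicalPhysics.QuantumFieldTheory.plaquetteCurl
                        (fun e => α e a) p * h p a) *
                    ∫ Y, Real.cos (∑ p ∈ S, ∑ a : Fin D, h p a * Y p a) ∂τ)))
    (hR : ∀ (D : ℕ) (τ : MeasureTheory.Measure
        (Literature.MathematicalPhysics.QuantumLattice.ZdPlaquette 4 → Fin D → ℝ)),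
      MeasureTheory.IsProbabilityMeasure τ →
      (∀ (x : Literature.Probability.LatticeModels.Site 4) (i j k : Fin 4)
          (hij : i < j) (hjk : j < k) (a : Fin D),
        ∀ᵐ Y ∂τ,
          (Y (x + Pi.single i 1, ⟨(j, k), hjk⟩) a - Y (x, ⟨(j, k), hjk⟩) a) -
            (Y (x + Pi.single j 1, ⟨(i, k), hij.trans hjk⟩) a -
              Y (x, ⟨(i, k), hij.trans hjk⟩) a) +
            (Y (x + Pi.single k 1, ⟨(i, j), hij⟩) a - Y (x, ⟨(i, j), hij⟩) a) = 0) →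
      ((∃ B : ℝ, ∀ (p : Literature.MathematicalPhysics.QuantumLattice.ZdPlaquette 4) (a : Fin D),
          MeasureTheory.Integrable (fun Y => (Y p a) ^ 2) τ ∧ ∫ Y, (Y p a) ^ 2 ∂τ ≤ B) ∧
        (∑ i : Fin 4, ∑ j : Fin 4, ∑ a : Fin D,
          if hij : i < j then ∫ Y, (Y ((0 : Literature.Probability.LatticeModels.Site 4),
            ⟨(i, j), hij⟩) a) ^ 2 ∂τ else 0) ≤ 3 * D) →
      (∀ (S : Finset (Literature.MathematicalPhysics.QuantumLattice.ZdPlaquette 4))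
          (E : Finset (Literature.MathematicalPhysics.QuantumLattice.ZdEdge 4))
          (h : Literature.MathematicalPhysics.QuantumLattice.ZdPlaquette 4 → Fin D → ℝ)
          (α : Literature.MathematicalPhysics.QuantumLattice.ZdEdge 4 → Fin D → ℝ),
        (∀ e, e ∉ E → α e = 0) →
        (∀ p, p ∉ S → ∀ a : Fin D,
          Literature.MathematicalPhysics.QuantumFieldTheory.plaquetteCurl (fun e => α e a) p = 0) →
        (∫ Y, Real.cos (∑ p ∈ S, ∑ a : Fin D, h p a * Y p a) *
            (∑ p ∈ S, ∑ a : Fin D,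
              Literature.MathematicalPhysics.QuantumFieldTheory.plaquetteCurl
                (fun e => α e a) p * Y p a) ∂τ =
          -(∑ p ∈ S, ∑ a : Fin D,
              Literature.MathematicalPhysics.QuantumFieldTheory.plaquetteCurl
                (fun e => α e a) p * h p a) *
            ∫ Y, Real.sin (∑ p ∈ S, ∑ a : Fin D, h p a * Y p a) ∂τ) ∧
        (∫ Y, Real.sin (∑ p ∈ S, ∑ a : Fin D, h p a * Y p a) *
            (∑ p ∈ S, ∑ a : Fin D,
              Literature.MathematicalPhysics.QuantumFieldTheory.plaquetteCurl
                (fun e => α e a) p * Y p a) ∂τ =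
          (∑ p ∈ S, ∑ a : Fin D,
              Literature.MathematicalPhysics.QuantumFieldTheory.plaquetteCurl
                (fun e => α e a) p * h p a) *
            ∫ Y, Real.cos (∑ p ∈ S, ∑ a : Fin D, h p a * Y p a) ∂τ)) →
      τ = Literature.MathematicalPhysics.QuantumFieldTheory.curvatureGaussianField 4 D) :
    LocalLaw := by
  intro G _ _ _ _ hG
  letI : MeasurableSpace G := borel G
  haveI : BorelSpace G := ⟨rfl⟩
  intro r hequi
  obtain ⟨D, hD, hTan⟩ := hT G hG r hequi
  refine ⟨D, hD, ?_⟩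
  intro n ε hε
  -- the probe and the two plaquettes
  set ψ : ℝ → ℝ := fun u => Real.exp (-2 * max u 0) with hψ
  have hψc : Continuous ψ := by
    simp only [hψ]
    fun_prop
  have hψb : ∀ u, |ψ u| ≤ 1 := fun u => by
    simp only [hψ]
    rw [abs_of_pos (Real.exp_pos _)]
    apply Real.exp_le_one_iff.2
    have : 0 ≤ max u 0 := le_max_right _ _
    linarith
  set p0 : ZdPlaquette 4 := plaquette12 (d := 4) three_le_four 0 with hp0
  set pn : ZdPlaquette 4 := plaquette12 (d := 4) three_le_four (Pi.single (0 : Fin 4) (n : ℤ))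
    with hpn
  by_contra hcon
  -- extract a bad sequence `βs k ≥ k`, `μs k`
  rw [Filter.not_eventually] at hcon
  have hfreq := Filter.frequently_atTop.1 hcon
  choose βs hβs hbad using fun k : ℕ => hfreq (k : ℝ)
  have hbad' : ∀ k : ℕ, ∃ μ ∈ infiniteVolumeLimitPoints (d := 4) r.ρ (βs k),
      ε ≤ |(∫ U, ψ (βs k * ((r.N : ℝ) - plaquetteObs r.ρ 0 1 2 U)) *
              ψ (βs k * ((r.N : ℝ) - plaquetteObs r.ρ 0 1 2
                (configShift (-(Pi.single 0 (n : ℤ))) U))) ∂μ) -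
            (∫ U, ψ (βs k * ((r.N : ℝ) - plaquetteObs r.ρ 0 1 2 U)) ∂μ) *
            (∫ U, ψ (βs k * ((r.N : ℝ) - plaquetteObs r.ρ 0 1 2
                (configShift (-(Pi.single 0 (n : ℤ))) U))) ∂μ) -
            ((∫ Y, Real.exp (-(∑ a : Fin D, (Y p0 a) ^ 2)) *
                Real.exp (-(∑ a : Fin D, (Y pn a) ^ 2)) ∂(curvatureGaussianField 4 D)) -
              (∫ Y, Real.exp (-(∑ a : Fin D, (Y p0 a) ^ 2)) ∂(curvatureGaussianField 4 D)) *
              (∫ Y, Real.exp (-(∑ a : Fin D, (Y pn a) ^ 2)) ∂(curvatureGaussianField 4 D)))| := by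
    intro k
    have hk := hbad k
    push Not at hk
    obtain ⟨μ, hμ, hge⟩ := hk
    exact ⟨μ, hμ, hge⟩
  choose μs hμs hge using hbad'
  have hβtend : Tendsto βs atTop atTop :=
    tendsto_atTop_mono hβs tendsto_natCast_atTop_atTop
  obtain ⟨φ, τ, hφ, hτ, hT0, hT1, hT2, hT3⟩ := hTan βs μs hβtend hμs
  have hτeq : τ = curvatureGaussianField 4 D := hR D τ hτ hT1 hT2 hT3
  -- the three test functions
  set f2 : (Fin 2 → ℝ) → ℝ := fun v => ψ (v 0) * ψ (v 1) with hf2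
  set fa : (Fin 2 → ℝ) → ℝ := fun v => ψ (v 0) with hfa
  set fb : (Fin 2 → ℝ) → ℝ := fun v => ψ (v 1) with hfb
  have hf2c : Continuous f2 := by simp only [hf2]; fun_prop
  have hfac : Continuous fa := by simp only [hfa]; fun_prop
  have hfbc : Continuous fb := by simp only [hfb]; fun_prop
  have hf2b : ∃ C : ℝ, ∀ v, |f2 v| ≤ C := ⟨1, fun v => by
    simp only [hf2, abs_mul]
    calc |ψ (v 0)| * |ψ (v 1)| ≤ 1 * 1 :=
          mul_le_mul (hψb _) (hψb _) (abs_nonneg _) zero_le_one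
      _ = 1 := one_mul _⟩
  have hfab : ∃ C : ℝ, ∀ v, |fa v| ≤ C := ⟨1, fun v => hψb _⟩
  have hfbb : ∃ C : ℝ, ∀ v, |fb v| ≤ C := ⟨1, fun v => hψb _⟩
  have l2 := hT0 2 ![p0, pn] f2 hf2c hf2b
  have la := hT0 2 ![p0, pn] fa hfac hfab
  have lb := hT0 2 ![p0, pn] fb hfbc hfbb
  -- identify the integrands on the lattice side
  have hshift : ∀ (U : LGConfig 4 G),
      plaquetteObs r.ρ 0 1 2 (configShift (-(Pi.single 0 (n : ℤ))) U) =
        plaquetteObs r.ρ pn.1 pn.2.1.1 pn.2.1.2 U := by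
    intro U
    rw [plaquetteObs_configShift']
    simp [hpn, plaquette12]
  have h0 : ∀ (U : LGConfig 4 G),
      plaquetteObs r.ρ 0 1 2 U = plaquetteObs r.ρ p0.1 p0.2.1.1 p0.2.1.2 U := by
    intro U
    simp [hp0, plaquette12]
  -- identify the integrands on the Gaussian side
  have hG2 : ∀ Y : ZdPlaquette 4 → Fin D → ℝ,
      f2 (fun i => (1 / 2 : ℝ) * ∑ a : Fin D, (Y (![p0, pn] i) a) ^ 2) =
        Real.exp (-(∑ a : Fin D, (Y p0 a) ^ 2)) * Real.exp (-(∑ a : Fin D, (Y pn a) ^ 2)) := by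
    intro Y
    simp only [hf2, hψ, Matrix.cons_val_zero, Matrix.cons_val_one]
    rw [probe_half (Finset.sum_nonneg fun a _ => sq_nonneg _),
      probe_half (Finset.sum_nonneg fun a _ => sq_nonneg _)]
  have hGa : ∀ Y : ZdPlaquette 4 → Fin D → ℝ,
      fa (fun i => (1 / 2 : ℝ) * ∑ a : Fin D, (Y (![p0, pn] i) a) ^ 2) =
        Real.exp (-(∑ a : Fin D, (Y p0 a) ^ 2)) := by
    intro Y
    simp only [hfa, hψ, Matrix.cons_val_zero]
    rw [probe_half (Finset.sum_nonneg fun a _ => sq_nonneg _)]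
  have hGb : ∀ Y : ZdPlaquette 4 → Fin D → ℝ,
      fb (fun i => (1 / 2 : ℝ) * ∑ a : Fin D, (Y (![p0, pn] i) a) ^ 2) =
        Real.exp (-(∑ a : Fin D, (Y pn a) ^ 2)) := by
    intro Y
    simp only [hfb, hψ, Matrix.cons_val_one, Matrix.cons_val_fin_one]
    rw [probe_half (Finset.sum_nonneg fun a _ => sq_nonneg _)]
  simp only [hG2] at l2
  simp only [hGa] at la
  simp only [hGb] at lb
  -- lattice side
  have hL2 : ∀ (j : ℕ) (U : LGConfig 4 G),
      f2 (fun i => βs (φ j) * ((r.N : ℝ) - plaquetteObs r.ρ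
          ((![p0, pn] : Fin 2 → ZdPlaquette 4) i).1 ((![p0, pn] : Fin 2 → ZdPlaquette 4) i).2.1.1
          ((![p0, pn] : Fin 2 → ZdPlaquette 4) i).2.1.2 U)) =
        ψ (βs (φ j) * ((r.N : ℝ) - plaquetteObs r.ρ 0 1 2 U)) *
          ψ (βs (φ j) * ((r.N : ℝ) - plaquetteObs r.ρ 0 1 2
            (configShift (-(Pi.single 0 (n : ℤ))) U))) := by
    intro j U
    simp only [hf2, Matrix.cons_val_zero, Matrix.cons_val_one, hshift, h0]
  have hLa : ∀ (j : ℕ) (U : LGConfig 4 G),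
      fa (fun i => βs (φ j) * ((r.N : ℝ) - plaquetteObs r.ρ
          ((![p0, pn] : Fin 2 → ZdPlaquette 4) i).1 ((![p0, pn] : Fin 2 → ZdPlaquette 4) i).2.1.1
          ((![p0, pn] : Fin 2 → ZdPlaquette 4) i).2.1.2 U)) =
        ψ (βs (φ j) * ((r.N : ℝ) - plaquetteObs r.ρ 0 1 2 U)) := by
    intro j U
    simp only [hfa, Matrix.cons_val_zero, h0]
  have hLb : ∀ (j : ℕ) (U : LGConfig 4 G),
      fb (fun i => βs (φ j) * ((r.N : ℝ) - plaquetteObs r.ρ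
          ((![p0, pn] : Fin 2 → ZdPlaquette 4) i).1 ((![p0, pn] : Fin 2 → ZdPlaquette 4) i).2.1.1
          ((![p0, pn] : Fin 2 → ZdPlaquette 4) i).2.1.2 U)) =
        ψ (βs (φ j) * ((r.N : ℝ) - plaquetteObs r.ρ 0 1 2
            (configShift (-(Pi.single 0 (n : ℤ))) U))) := by
    intro j U
    simp only [hfb, Matrix.cons_val_one, Matrix.cons_val_fin_one, hshift]
  simp only [hL2] at l2
  simp only [hLa] at la
  simp only [hLb] at lb
  -- combine
  have lcov := l2.sub (la.mul lb)
  rw [hτeq] at lcov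
  have hev := (Metric.tendsto_nhds.1 lcov) ε hε
  obtain ⟨j, hj⟩ := hev.exists
  have := hge (φ j)
  rw [Real.dist_eq] at hj
  linarith

/-- **The local free-gluon law** (formerly STUB 2 `stub_localLaw`), from STUB T and STUB R (the latter
fed with STUBS F5 (F1 (R1, R2), F2 (K2), R3), F6, R4, R6; STUBS K1, K3 are consumed by R2, R4 and
H, L by R3). -/
theorem localLaw : LocalLaw :=
  localLaw_of_tangent_of_rigidity stub_tangent
    (stub_rigidity
      (stub_factorization (stub_exactShiftInvariance stub_steinFlow stub_kernelFixesExact)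
        (stub_cubeShiftInvariance stub_kernelClosed) stub_density)
      stub_cosMoment stub_lineVariance stub_gaussFromCharFun)

/-! ## §3 Short names and the proved glue (from lead gen 0) -/

/-- The Källén–Lehmann weight `w(k) = √(ε(k)/(ε(k)+2))` (`= tanh(ω(k)/2)`). -/
def klWeight (k : Fin 3 → ℝ) : ℝ := Real.sqrt (dispersion k / (dispersion k + 2))

/-- The transfer-matrix eigenvalue `r(k) = 1 + ε(k) − √(ε(k)(ε(k)+2))` (`= e^{−ω(k)}`). -/
def klRatio (k : Fin 3 → ℝ) : ℝ := 1 + dispersion k - Real.sqrt (dispersion k * (dispersion k + 2))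

/-- The Källén–Lehmann integral `J_n = ∫_{[−π,π]³} w(k) r(k)ⁿ dk`. -/
def klIntegral (n : ℕ) : ℝ := ∫ k in brillouin 3, klWeight k * klRatio k ^ n

/-- The plaquette two-point numbers `c_n` of the lattice Maxwell field in `d = 4`. -/
def corr (n : ℤ) : ℝ := curvaturePlaquetteCorr (d := 4) three_le_four n

/-- The free-gluon probe profile `g_D(n) = 2^{−D} ((1 − c_n²)^{−D/2} − 1)`. -/
def profile (D : ℕ) (n : ℕ) : ℝ :=
  (2 : ℝ) ^ (-(D : ℝ)) * ((1 - corr (n : ℤ) ^ 2) ^ (-((D : ℝ) / 2)) - 1)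



/-- `c_n = (2/3)(2π)^{−3} J_{|n|}` for `n ≠ 0` (STUBS 3, 4, 5). -/
theorem corr_eq_klIntegral {n : ℤ} (hn : n ≠ 0) :
    corr n = 2 / 3 / (2 * Real.pi) ^ 3 * klIntegral n.natAbs := by
  have h3 := stub_secondDifference n hn
  have h5 := stub_axisFourier stub_poissonIntegral n hn
  simp only [corr, klIntegral, klWeight, klRatio]
  rw [show curvaturePlaquetteCorr (d := 4) three_le_four n =
      curvaturePlaquetteCorr (d := 4) (by norm_num) n from rfl, h3, h5]
  ring

/-- `0 < c_n` for `n ≠ 0`. -/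
theorem corr_pos {n : ℤ} (hn : n ≠ 0) : 0 < corr n := by
  rw [corr_eq_klIntegral hn]
  have hJ := (stub_profile.1 n.natAbs).1
  have : (0 : ℝ) < 2 / 3 / (2 * Real.pi) ^ 3 := by positivity
  exact mul_pos this hJ

/-- `c_n ≤ 2/3` for `n ≠ 0`. -/
theorem corr_le {n : ℤ} (hn : n ≠ 0) : corr n ≤ 2 / 3 := by
  rw [corr_eq_klIntegral hn]
  have hJ := (stub_profile.1 n.natAbs).2
  have hπ : (0 : ℝ) < (2 * Real.pi) ^ 3 := by positivity
  calc 2 / 3 / (2 * Real.pi) ^ 3 * klIntegral n.natAbs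
      ≤ 2 / 3 / (2 * Real.pi) ^ 3 * (2 * Real.pi) ^ 3 := by
        exact mul_le_mul_of_nonneg_left hJ (by positivity)
    _ = 2 / 3 := by field_simp

/-- Sub-exponential lower bound: for every `ε > 0` there is `C > 0` with `C e^{−ε n} ≤ c_n` for all
`n ≥ 1`. -/
theorem corr_subexp {ε : ℝ} (hε : 0 < ε) :
    ∃ C : ℝ, 0 < C ∧ ∀ n : ℕ, n ≠ 0 → C * Real.exp (-(ε * n)) ≤ corr (n : ℤ) := by
  obtain ⟨C, hC, hCn⟩ := stub_profile.2 ε hε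
  refine ⟨2 / 3 / (2 * Real.pi) ^ 3 * C, by positivity, fun n hn => ?_⟩
  have hn' : (n : ℤ) ≠ 0 := by exact_mod_cast hn
  rw [corr_eq_klIntegral hn', Int.natAbs_natCast, mul_assoc]
  exact mul_le_mul_of_nonneg_left (hCn n) (by positivity)

/-- `0 < 1 − c_n²` for `n ≠ 0`. -/
theorem one_sub_corr_sq_pos {n : ℤ} (hn : n ≠ 0) : 0 < 1 - corr n ^ 2 := by
  have h1 := corr_pos hn
  have h2 := corr_le hn
  nlinarith

/-- Bernoulli-type lower bound: for `0 ≤ x < 1` and `a ≥ 0`, `(1 − x)^{−a} − 1 ≥ a x`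
(`1 − x ≤ e^{−x}` and `1 + a x ≤ e^{a x}`). -/
theorem rpow_neg_sub_one_ge {x a : ℝ} (hx1 : x < 1) (ha : 0 ≤ a) :
    a * x ≤ (1 - x) ^ (-a) - 1 := by
  have h1x : 0 < 1 - x := by linarith
  -- `(1 - x)^(-a) = exp(-a * log(1 - x)) ≥ exp(a x)` since `log(1 - x) ≤ -x`
  have hlog : Real.log (1 - x) ≤ -x := by
    have := Real.log_le_sub_one_of_pos h1x
    linarith
  have hexp : Real.exp (a * x) ≤ (1 - x) ^ (-a) := by
    rw [Real.rpow_def_of_pos h1x]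
    apply Real.exp_le_exp.2
    nlinarith
  have hlin : a * x + 1 ≤ Real.exp (a * x) := Real.add_one_le_exp _
  linarith

/-- `g_D(n) ≥ 2^{−D} (D/2) c_n²` for `n ≠ 0`. -/
theorem profile_ge {D : ℕ} {n : ℕ} (hn : n ≠ 0) :
    (2 : ℝ) ^ (-(D : ℝ)) * ((D : ℝ) / 2 * corr (n : ℤ) ^ 2) ≤ profile D n := by
  have hn' : (n : ℤ) ≠ 0 := by exact_mod_cast hn
  unfold profile
  refine mul_le_mul_of_nonneg_left ?_ (by positivity)
  have hx1 : corr (n : ℤ) ^ 2 < 1 := by have := one_sub_corr_sq_pos hn'; linarith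
  have := rpow_neg_sub_one_ge hx1 (a := (D : ℝ) / 2) (by positivity)
  simpa [neg_div] using this

/-- `0 < g_D(n)` for `n ≠ 0` and `D ≥ 1`. -/
theorem profile_pos {D : ℕ} (hD : 0 < D) {n : ℕ} (hn : n ≠ 0) : 0 < profile D n := by
  have hn' : (n : ℤ) ≠ 0 := by exact_mod_cast hn
  refine lt_of_lt_of_le ?_ (profile_ge hn)
  have hc := corr_pos hn'
  have hD' : (0 : ℝ) < D := by exact_mod_cast hD
  positivity

/-- **The sub-exponential clause of the crux** for the profile `g_D`, `D ≥ 1`: for every `m > 0`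
there are `s < t` with `0 < g(2s)` and `g(2s) e^{−m(2t−2s)} < g(2t)`. Proof: otherwise
`g(2t) ≤ g(2) e^{−2m(t−1)}` for all `t > 1`, contradicting `g(2t) ≥ 2^{−D}(D/2) C² e^{−4εt}` with
`4ε < 2m`. -/
theorem profile_clause {D : ℕ} (hD : 0 < D) :
    ∀ m : ℝ, 0 < m → ∃ s t : ℕ, s < t ∧ 0 < profile D (2 * s) ∧
      profile D (2 * s) * Real.exp (-(m * (2 * (t : ℝ) - 2 * (s : ℝ)))) < profile D (2 * t) := by
  intro m hm
  by_contra hcon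
  push Not at hcon
  -- lower bound along even integers
  obtain ⟨C, hC, hCn⟩ := corr_subexp (ε := m / 4) (by positivity)
  have hg2 : 0 < profile D (2 * 1) := profile_pos hD (by norm_num)
  -- for every t > 1: profile D (2t) ≤ profile D 2 * exp(-m(2t-2))
  have hup : ∀ t : ℕ, 1 < t →
      profile D (2 * t) ≤ profile D (2 * 1) * Real.exp (-(m * (2 * (t : ℝ) - 2 * ((1 : ℕ) : ℝ)))) :=
    fun t ht => hcon 1 t ht hg2
  -- lower bound: profile D (2t) ≥ K * exp(-(m/4) * (2t)) ^ 2-ish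
  have hlow : ∀ t : ℕ, t ≠ 0 →
      (2 : ℝ) ^ (-(D : ℝ)) * ((D : ℝ) / 2 * (C * Real.exp (-(m / 4 * ((2 * t : ℕ) : ℝ)))) ^ 2) ≤
        profile D (2 * t) := by
    intro t ht
    have h2t : 2 * t ≠ 0 := by omega
    refine le_trans ?_ (profile_ge h2t)
    refine mul_le_mul_of_nonneg_left ?_ (by positivity)
    refine mul_le_mul_of_nonneg_left ?_ (by positivity)
    have h0 : 0 ≤ C * Real.exp (-(m / 4 * ((2 * t : ℕ) : ℝ))) := by positivity
    have := hCn (2 * t) h2t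
    exact pow_le_pow_left₀ h0 this 2
  -- combine: K e^{-m t} ≤ profile(2t) ≤ P e^{-2m(t-1)} ⇒ e^{m t} ≤ P e^{2m} / K, contradiction
  set K : ℝ := (2 : ℝ) ^ (-(D : ℝ)) * ((D : ℝ) / 2 * C ^ 2) with hK
  have hKpos : 0 < K := by
    have hD' : (0 : ℝ) < D := by exact_mod_cast hD
    positivity
  set P : ℝ := profile D (2 * 1) with hP
  -- choose t large with exp(m t) > P * exp(2m) / K
  obtain ⟨t, ht⟩ : ∃ t : ℕ, P * Real.exp (2 * m) / K < Real.exp (m * t) ∧ 1 < t := by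
    have htend : Tendsto (fun t : ℕ => Real.exp (m * t)) atTop atTop := by
      refine Real.tendsto_exp_atTop.comp ?_
      exact Tendsto.const_mul_atTop hm tendsto_natCast_atTop_atTop
    have h1 := (htend.eventually_gt_atTop (P * Real.exp (2 * m) / K))
    have h2 := eventually_gt_atTop 1
    exact (h1.and h2).exists
  have ht0 : t ≠ 0 := by omega
  have hl := hlow t ht0
  have hu := hup t ht.2
  -- rewrite the lower bound
  have hexp2 : (C * Real.exp (-(m / 4 * ((2 * t : ℕ) : ℝ)))) ^ 2 = C ^ 2 * Real.exp (-(m * t)) := by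
    rw [mul_pow, ← Real.exp_nat_mul]
    congr 1
    congr 1
    push_cast
    ring
  rw [hexp2] at hl
  have hl' : K * Real.exp (-(m * t)) ≤ profile D (2 * t) := by
    rw [hK]
    convert hl using 1
    ring
  have hu' : profile D (2 * t) ≤ P * Real.exp (2 * m) * Real.exp (-(2 * m * t)) := by
    rw [hP]
    convert hu using 1
    rw [mul_assoc, ← Real.exp_add]
    congr 1
    congr 1
    push_cast
    ring
  have hchain : K * Real.exp (-(m * t)) ≤ P * Real.exp (2 * m) * Real.exp (-(2 * m * t)) :=
    hl'.trans hu'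
  -- multiply by exp(2 m t)
  clear_value K P
  have h3 : K * Real.exp (m * t) ≤ P * Real.exp (2 * m) := by
    have hmul := mul_le_mul_of_nonneg_right hchain (Real.exp_pos (2 * m * t)).le
    have e1 : K * Real.exp (-(m * t)) * Real.exp (2 * m * t) = K * Real.exp (m * t) := by
      rw [mul_assoc, ← Real.exp_add]
      congr 1
      congr 1
      ring
    have e2 : P * Real.exp (2 * m) * Real.exp (-(2 * m * t)) * Real.exp (2 * m * t) =
        P * Real.exp (2 * m) := by
      rw [mul_assoc, ← Real.exp_add, neg_add_cancel, Real.exp_zero, mul_one]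
    rw [e1, e2] at hmul
    exact hmul
  have hmt : Real.exp (m * t) ≤ P * Real.exp (2 * m) / K := by
    rw [le_div_iff₀ hKpos, mul_comm]
    exact h3
  linarith [ht.1]

/-- The probe `φ(x) = exp(−2 x₊)` is continuous. -/
theorem continuous_probe : Continuous fun x : ℝ => Real.exp (-2 * max x 0) := by
  fun_prop

/-- The probe is bounded by `1`. -/
theorem abs_probe_le (x : ℝ) : |Real.exp (-2 * max x 0)| ≤ 1 := by
  rw [abs_of_pos (Real.exp_pos _)]
  apply Real.exp_le_one_iff.2
  have : 0 ≤ max x 0 := le_max_right _ _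
  linarith

/-! ## §4 The composition -/

/-- **The line closes the crux modulo its stubs**: STUB 1 feeds the local law of §2 (STUBS T, R,
K1, K2, K3, H, L), whose profile `g_D` satisfies the sub-exponential clause by STUBS 3–6 and the glue
of §3. -/
theorem EquipartitionPinsProbe_of :
    Summit.QuantumFields.YangMills.Theses.EquipartitionCriticality.EquipartitionPinsProbe := by
  intro G _ _ _ _ hG r hK
  obtain ⟨D, hD, hlim⟩ := localLaw G hG r (stub_equipartition G hG r hK)
  refine ⟨fun x => Real.exp (-2 * max x 0), continuous_probe, ⟨1, abs_probe_le⟩, profile D,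
    profile_clause hD, ?_⟩
  intro n ε hε
  have hg := stub_gaussianProfile D n
  simp only [profile, corr]
  rw [show curvaturePlaquetteCorr (d := 4) three_le_four (n : ℤ) =
      curvaturePlaquetteCorr (d := 4) (by norm_num) (n : ℤ) from rfl, ← hg]
  exact hlim n ε hε

end Summit.QuantumFields.YangMills.Cruxes.EquipartitionPinsProbe.Sketch

end
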